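import Literature.NumberTheory.LFunctions.Zhang2022.TypedSection10B
import Literature.NumberTheory.LFunctions.Zhang2022.Section18SjNormMajorant
import Literature.NumberTheory.LFunctions.Zhang2022.Section15ResidueParams
import Literature.NumberTheory.LFunctions.Zhang2022.Section9Ded97
import Literature.NumberTheory.LFunctions.Zhang2022.Section8XiZeroTailMean
import Literature.NumberTheory.LFunctions.Zhang2022.Section10Lemma101
import Literature.NumberTheory.LFunctions.Zhang2022.SkeletonLemma84Rel
import HarnessLib

/-!
# Zhang (2022) §10, `Θ₁(𝐚₁₃,𝐚₂₁)`: "the sum over `dr < P^{0.5}` is `o(α)`" — the DEDUCTION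
# `Lemma 10.1 + Lemma 8.4 ⇒ Typed.Sec10B.Small1321` (node `Z22:§10.u042`), kernel-checked

Topic `Literature/NumberTheory/LFunctions/Zhang2022` (Landau–Siegel audit tree; verdict-neutral).
Y. Zhang, *Discrete mean estimates and the Landau–Siegel zero*, arXiv:2211.02515v1 (2022)
[Zhang2022LandauSiegel], §10 p. 58 (tex L2977): in the evaluation of `Θ₁(𝐚₁₃,𝐚₂₁)`, "The right side
is split into three sums in the same way as in the last subsection. By Lemma 10.1 and the results in
Section 8, the sum over `dr < P^{0.5}` is `o(α)`" — **an unrefereed manuscript under adjudication**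
(campaign D-0069, layer L3, free-list item F1-rest (a′), L3 LEDGER #11). This file PROVES that
implication over the tree's objects, as the edge

* `small1321_of : Skeleton.Lemma101 c′ → Skeleton.Lemma84 c′ → Typed.Sec10B.Small1321 c′`.

Nothing here asserts Lemma 10.1, Lemma 8.4, (A), or anything about Theorems 1–2 of the manuscript.

## The argument (the manuscript's one line, made explicit)

For `1 ≤ dr < P^{1/2}` the `(d,r)`-term of `S_j(𝐚₁₃,𝐚₂₁)` (`Typed.Sec10B.drSum … 0 P^{1/2}`) is
`w(d,r)·M(dr)·N(d,r)` with `|w| ≤ |λ₀ⱼ(dr)|/(drφ(r))` (`norm_drWeight_le`),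
`M(dr) = Σ_m χ(m)f̃(log(drm)/log P)m^{−(1−β_j)} = 𝔳₁ⱼ(dr)` (`mSum13_eq_frakv1`: both truncations lie
beyond the support of `f̃`), and `N(d,r) = S₁ + ῑ₂S₂` where `S_k = Σ_n χ(n)conj ϰ_k(drn)ξ₀ⱼ(n;d,r)/n`
is `(log P_k)⁻¹ ×` the sum of Lemma 8.4 at `x = P_k/(dr)` (`μ = 6, 7`; `conj (x/n)^{β_μ} =
(x/n)^{−β_μ}` as `β_μ ∈ iℝ`: `conjVk1Sum_eq`, `conjVk2Sum_eq`).
* Zone 1, `dr ≤ P^{1/2}/T`: (10.2) gives `|𝔳₁ⱼ| ≤ C₁T^{−c}`.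
* Zone 2, `P^{1/2}/T < dr < P^{1/2}`: (10.5) gives `|𝔳₁ⱼ| ≤ C₁𝓛⁻⁷`, and `S₂ = 0` (`S2_eq_zero`).
* `S₁`: `T < P₁/(dr) < P`, so Lemma 8.4 applies: `|S₁| ≤ (log P₁)⁻¹(|L′(1,χ)|K_g + C₄)(1 + |Π(d,r)|)`
  (`norm_S1_le`; `|𝔤_{j6}| ≤ K_g` is the tree's `Section9Discharge.exists_norm_frakgW_le`).
* `S₂` (zone 1 only): `x₂ = P₂/(dr)` is `≤ 1` (empty), `> T` (Lemma 8.4), or in `(1, T]`, where the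
  manuscript's "results in Section 8" do not reach; there the crude bound
  `|Σ| ≤ log x₂ · Σ_{n<x₂}|ξ₀ⱼ|/n` and the tree's unconditional `ξ₀ⱼ`-tail mean
  `XiZeroMajorant.xiZeroTailMean` (`≪ 𝓛(1 + log x)³`, sz-d37 p414341) give `≪ 𝓛(1 + log T)⁴`
  (`norm_S2_le`) — harmless against `T^{−c}`.
* Weights: `|λ₀ⱼ(n)| ≤ (φ(n)/n)∏_{q∣n}(1 + 25/q)` (tree `Sec18SjNorm.norm_lamZero_le`),
  `|Π(d,r)| ≤ (dr/φ(dr))(d/φ(d))` (`norm_PiW_le`), hence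
  `|λ₀ⱼ(dr)|(1+|Π|)/(drφ(r)) ≤ 2G(d)/d·G(r)/r²`, `G(n) = ∏_{q∣n}(1 + 52/q)` (`pairWeight_le`), and the
  WINDOW mean value `Σ_{A<n≤B} G(n)/n ≤ e⁵²(1 + log(B/A))` (`sum_prod_window_le`, from a window
  harmonic bound `harmonic_window_le`) gives `Σ_{A<dr≤B} weight ≤ 4e¹⁰⁴(1 + log(B/A))`
  (`pairSum_window_le`): `≪ 𝓛⁹` on zone 1, `≪ log T = 𝓛^{1.1}` on zone 2.
* Total (`norm_drSum_low_le`, `endgame`): `≪ T^{−c}𝓛^{O(1)} + 𝓛⁻⁷·𝓛²𝓛⁻⁹·𝓛^{1.1} = o(𝓛⁻⁹) = o(α)`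
  (`α = π𝓛⁻⁹`), with every constant explicit.

Inputs cited by name, never restated: `Skeleton.Lemma101`, `Skeleton.Lemma84`, `Typed.Sec10B.*`
(`drSum`, `drWeight`, `mSum13`, `nSum21`, `Small1321`), `Skeleton.vk1/vk2/lamZero/xiZero/PiW/frakgW/
frakv1/Nsupp`, `Sec18SjNorm.norm_lamZero_le`, `XiZeroMajorant.xiZeroTailMean`,
`ResidueValues.norm_deriv_LFunction_one_le` (`|L′(1,χ)| ≤ 2e^{9/2}(1+𝓛)𝓛`),
`Section9Discharge.exists_norm_frakgW_le`, `MertensBound.totient_eq_mul_prod_one_sub_inv`.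
No `def`, no new named fact; 0 sorries; standard axioms.

## References
* Y. Zhang, arXiv:2211.02515v1 (2022), §10 p. 58; §8 Lemma 8.4, (8.6), (8.10); §7 p. 34.
  [cite: Zhang2022LandauSiegel, §10 p. 58]
-/

noncomputable section

open Complex Real Finset ComplexConjugate

namespace Literature.NumberTheory.LFunctions.Zhang2022.Sj1321Outer

open Literature.NumberTheory.LFunctions.Zhang2022.Skeleton
open Literature.NumberTheory.LFunctions.Zhang2022.Typed.Sec10B

/-! ## Part A. Window sums of the multiplicative majorant `n⁻¹∏_{q∣n}(1 + c/q)` -/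

/-- Harmonic sum over a finite set of integers in a window `(a, b]`:
`Σ_{m ∈ M} 1/m ≤ 1 + log(b/a)`. [cite: Zhang2022LandauSiegel, §10 p. 58] -/
theorem harmonic_window_le (M : Finset ℕ) :
    ∀ {a b : ℝ}, 0 < a → a ≤ b → (∀ m ∈ M, a < (m : ℝ) ∧ (m : ℝ) ≤ b) →
      ∑ m ∈ M, (m : ℝ)⁻¹ ≤ 1 + Real.log (b / a) := by
  induction M using Finset.induction_on_max with
  | empty =>
    intro a b ha hab _
    rw [sum_empty]
    have : 0 ≤ Real.log (b / a) := Real.log_nonneg (by rw [le_div_iff₀ ha]; linarith)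
    linarith
  | insert m s hlt ih =>
    intro a b ha hab hmem
    have hm := hmem m (mem_insert_self m s)
    have hms : m ∉ s := fun h => lt_irrefl m (hlt m h)
    rw [sum_insert hms]
    have hm0 : (0 : ℝ) < m := lt_trans ha hm.1
    have hlogb : Real.log ((m : ℝ) / a) ≤ Real.log (b / a) :=
      Real.log_le_log (div_pos hm0 ha) (div_le_div_of_nonneg_right hm.2 ha.le)
    rcases s.eq_empty_or_nonempty with hs | hs
    · subst hs
      rw [sum_empty, add_zero]
      have hm1 : (1 : ℝ) ≤ m := by
        have : 0 < m := by exact_mod_cast hm0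
        exact_mod_cast this
      have hlog : 0 ≤ Real.log (b / a) := Real.log_nonneg (by rw [le_div_iff₀ ha]; linarith)
      calc (m : ℝ)⁻¹ ≤ 1 := inv_le_one_of_one_le₀ hm1
        _ ≤ 1 + Real.log (b / a) := by linarith
    · -- the rest of the set lies in `(a, m − 1]`
      obtain ⟨x, hx⟩ := hs
      have hxm : x < m := hlt x hx
      have hax : a < x := (hmem x (mem_insert_of_mem hx)).1
      have hxle : (x : ℝ) ≤ (m : ℝ) - 1 := by
        have : x + 1 ≤ m := hxm
        have h' : ((x + 1 : ℕ) : ℝ) ≤ m := by exact_mod_cast this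
        push_cast at h'
        linarith
      have hab' : a ≤ (m : ℝ) - 1 := by linarith
      have hmem' : ∀ y ∈ s, a < (y : ℝ) ∧ (y : ℝ) ≤ (m : ℝ) - 1 := by
        intro y hy
        refine ⟨(hmem y (mem_insert_of_mem hy)).1, ?_⟩
        have : y + 1 ≤ m := hlt y hy
        have h' : ((y + 1 : ℕ) : ℝ) ≤ m := by exact_mod_cast this
        push_cast at h'
        linarith
      have h1 := ih ha hab' hmem'
      -- `1/m ≤ log(m/(m-1))`
      have hm1 : (1 : ℝ) < m := by linarith
      have hkey : (m : ℝ)⁻¹ + Real.log (((m : ℝ) - 1) / a) ≤ Real.log ((m : ℝ) / a) := by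
        have hpos : (0 : ℝ) < ((m : ℝ) - 1) / m := div_pos (by linarith) hm0
        have h2 := Real.log_le_sub_one_of_pos hpos
        have h3 : Real.log (((m : ℝ) - 1) / m) =
            Real.log (((m : ℝ) - 1) / a) - Real.log ((m : ℝ) / a) := by
          rw [Real.log_div (by linarith) hm0.ne', Real.log_div (by linarith) ha.ne',
            Real.log_div hm0.ne' ha.ne']
          ring
        have h4 : ((m : ℝ) - 1) / m - 1 = -(m : ℝ)⁻¹ := by field_simp; ring
        rw [h3, h4] at h2
        linarith
      linarith

/-- Window harmonic sum along the multiples of `d`: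
`Σ_{n < N, d ∣ n, A < n ≤ B} 1/n ≤ (1 + log(B/A))/d`. [cite: Zhang2022LandauSiegel, §10 p. 58] -/
theorem sum_inv_filter_dvd_window_le {d : ℕ} (hd : 0 < d) (N : ℕ) {A B : ℝ} (hA : 0 < A)
    (hAB : A ≤ B) :
    ∑ n ∈ (Ico 1 N).filter (fun n : ℕ => d ∣ n ∧ A < (n : ℝ) ∧ (n : ℝ) ≤ B), (n : ℝ)⁻¹ ≤
      (1 + Real.log (B / A)) / d := by
  set M : Finset ℕ := (Ico 1 N).filter (fun m => A < ((d * m : ℕ) : ℝ) ∧ ((d * m : ℕ) : ℝ) ≤ B)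
    with hM
  have hsub : (Ico 1 N).filter (fun n : ℕ => d ∣ n ∧ A < (n : ℝ) ∧ (n : ℝ) ≤ B) ⊆
      M.image (fun m => d * m) := by
    intro n hn
    rw [mem_filter, mem_Ico] at hn
    obtain ⟨⟨h1, hN⟩, ⟨m, rfl⟩, hA', hB'⟩ := hn
    rw [mem_image]
    refine ⟨m, ?_, rfl⟩
    rw [hM, mem_filter, mem_Ico]
    refine ⟨⟨?_, ?_⟩, hA', hB'⟩
    · rcases Nat.eq_zero_or_pos m with h0 | h0
      · simp [h0] at h1
      · exact h0
    · exact lt_of_le_of_lt (Nat.le_mul_of_pos_left m hd) hN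
  have hinj : Set.InjOn (fun m => d * m) (M : Set ℕ) := by
    intro a _ b _ hab
    exact Nat.eq_of_mul_eq_mul_left hd hab
  have hdR : (0 : ℝ) < d := by exact_mod_cast hd
  have hwin : ∀ m ∈ M, A / d < (m : ℝ) ∧ (m : ℝ) ≤ B / d := by
    intro m hm
    rw [hM, mem_filter] at hm
    obtain ⟨-, h1, h2⟩ := hm
    push_cast at h1 h2
    constructor
    · rw [div_lt_iff₀ hdR]; linarith
    · rw [le_div_iff₀ hdR]; linarith
  have hharm : ∑ m ∈ M, (m : ℝ)⁻¹ ≤ 1 + Real.log (B / A) := by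
    have h := harmonic_window_le M (div_pos hA hdR) (div_le_div_of_nonneg_right hAB hdR.le) hwin
    rwa [div_div_div_cancel_right₀ hdR.ne'] at h
  calc ∑ n ∈ (Ico 1 N).filter (fun n : ℕ => d ∣ n ∧ A < (n : ℝ) ∧ (n : ℝ) ≤ B), (n : ℝ)⁻¹
      ≤ ∑ n ∈ M.image (fun m => d * m), (n : ℝ)⁻¹ :=
        sum_le_sum_of_subset_of_nonneg hsub fun n _ _ => by positivity
    _ = ∑ m ∈ M, ((d * m : ℕ) : ℝ)⁻¹ := sum_image hinj
    _ = (d : ℝ)⁻¹ * ∑ m ∈ M, ((m : ℕ) : ℝ)⁻¹ := by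
        rw [mul_sum]
        refine sum_congr rfl fun m _ => ?_
        push_cast
        rw [mul_inv]
    _ ≤ (d : ℝ)⁻¹ * (1 + Real.log (B / A)) := by gcongr
    _ = (1 + Real.log (B / A)) / d := by ring

/-- `Σ_{q < N prime} 1/q² ≤ 1`. [folklore] -/
private theorem sum_primes_inv_sq_le_one (N : ℕ) :
    ∑ q ∈ (range N).filter Nat.Prime, ((q : ℝ) ^ 2)⁻¹ ≤ 1 := by
  have hsub : (range N).filter Nat.Prime ⊆ Ioo 1 N := by
    intro q hq
    rw [mem_filter, mem_range] at hq
    exact mem_Ioo.mpr ⟨hq.2.one_lt, hq.1⟩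
  rcases Nat.eq_zero_or_pos N with rfl | hN
  · simp
  calc ∑ q ∈ (range N).filter Nat.Prime, ((q : ℝ) ^ 2)⁻¹
      ≤ ∑ q ∈ Ioo 1 N, ((q : ℝ) ^ 2)⁻¹ :=
        sum_le_sum_of_subset_of_nonneg hsub fun q _ _ => by positivity
    _ ≤ 2 / (1 + 1) := by exact_mod_cast sum_Ioo_inv_sq_le (α := ℝ) 1 N
    _ = 1 := by norm_num

/-- **Window mean value of the majorant**: for `c ≥ 0` and `0 < A ≤ B`,
`Σ_{n < N, A < n ≤ B} n⁻¹∏_{q∣n}(1 + c/q) ≤ eᶜ(1 + log(B/A))` — expand the product over subsets of the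
prime factors, bound the harmonic sum along the multiples of their product inside the window, and
`∏_{q}(1 + c/q²) ≤ eᶜ`. [cite: Zhang2022LandauSiegel, §10 p. 58] -/
theorem sum_prod_window_le {c : ℝ} (hc : 0 ≤ c) (N : ℕ) {A B : ℝ} (hA : 0 < A) (hAB : A ≤ B) :
    ∑ n ∈ (Ico 1 N).filter (fun n : ℕ => A < (n : ℝ) ∧ (n : ℝ) ≤ B),
        (∏ q ∈ n.primeFactors, (1 + c / (q : ℝ))) / (n : ℝ) ≤
      Real.exp c * (1 + Real.log (B / A)) := by
  classical
  set P : Finset ℕ := (range N).filter Nat.Prime with hP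
  set S : Finset ℕ := (Ico 1 N).filter (fun n : ℕ => A < (n : ℝ) ∧ (n : ℝ) ≤ B) with hS
  have hlog : 0 ≤ 1 + Real.log (B / A) := by
    have : 0 ≤ Real.log (B / A) := Real.log_nonneg (by rw [le_div_iff₀ hA]; linarith)
    linarith
  have hexp : ∀ n : ℕ, (∏ q ∈ n.primeFactors, (1 + c / (q : ℝ))) / (n : ℝ) =
      ∑ T ∈ n.primeFactors.powerset, (∏ q ∈ T, (c / (q : ℝ))) / (n : ℝ) := by
    intro n
    rw [prod_one_add, sum_div]
  rw [sum_congr rfl fun n _ => hexp n]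
  have hswap : ∑ n ∈ S, ∑ T ∈ n.primeFactors.powerset, (∏ q ∈ T, (c / (q : ℝ))) / (n : ℝ) =
      ∑ T ∈ P.powerset, ∑ n ∈ S.filter (fun n => T ⊆ n.primeFactors),
        (∏ q ∈ T, (c / (q : ℝ))) / (n : ℝ) := by
    refine sum_comm' fun n T => ?_
    simp only [mem_powerset, mem_filter]
    constructor
    · rintro ⟨hn, hT⟩
      refine ⟨⟨hn, hT⟩, hT.trans fun q hq => ?_⟩
      rw [hP, mem_filter, mem_range]
      rw [hS, mem_filter, mem_Ico] at hn
      have hq' := Nat.mem_primeFactors.mp hq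
      exact ⟨lt_of_le_of_lt (Nat.le_of_dvd hn.1.1 hq'.2.1) hn.1.2, hq'.1⟩
    · rintro ⟨⟨hn, hT⟩, _⟩
      exact ⟨hn, hT⟩
  rw [hswap]
  have hinner : ∀ T ∈ P.powerset,
      ∑ n ∈ S.filter (fun n => T ⊆ n.primeFactors), (∏ q ∈ T, (c / (q : ℝ))) / (n : ℝ) ≤
        (∏ q ∈ T, (c / (q : ℝ) ^ 2)) * (1 + Real.log (B / A)) := by
    intro T hT
    rw [mem_powerset] at hT
    have hTprime : ∀ q ∈ T, q.Prime := fun q hq => by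
      have := hT hq
      rw [hP, mem_filter] at this
      exact this.2
    set d : ℕ := ∏ q ∈ T, q with hd
    have hdpos : 0 < d := prod_pos fun q hq => (hTprime q hq).pos
    have hcT : 0 ≤ ∏ q ∈ T, (c / (q : ℝ)) := prod_nonneg fun q _ => by positivity
    have hsub : S.filter (fun n => T ⊆ n.primeFactors) ⊆
        (Ico 1 N).filter (fun n : ℕ => d ∣ n ∧ A < (n : ℝ) ∧ (n : ℝ) ≤ B) := by
      intro n hn
      rw [mem_filter, hS, mem_filter] at hn
      rw [mem_filter]
      refine ⟨hn.1.1, ?_, hn.1.2.1, hn.1.2.2⟩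
      rw [hd]
      exact Finset.prod_primes_dvd n (fun q hq => (hTprime q hq).prime)
        fun q hq => (Nat.mem_primeFactors.mp (hn.2 hq)).2.1
    have hdR : (d : ℝ) = ∏ q ∈ T, (q : ℝ) := by rw [hd]; push_cast; rfl
    calc ∑ n ∈ S.filter (fun n => T ⊆ n.primeFactors), (∏ q ∈ T, (c / (q : ℝ))) / (n : ℝ)
        = (∏ q ∈ T, (c / (q : ℝ))) *
            ∑ n ∈ S.filter (fun n => T ⊆ n.primeFactors), (n : ℝ)⁻¹ := by
          rw [mul_sum]
          refine sum_congr rfl fun n _ => ?_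
          rw [div_eq_mul_inv]
      _ ≤ (∏ q ∈ T, (c / (q : ℝ))) *
            ∑ n ∈ (Ico 1 N).filter (fun n : ℕ => d ∣ n ∧ A < (n : ℝ) ∧ (n : ℝ) ≤ B), (n : ℝ)⁻¹ :=
          mul_le_mul_of_nonneg_left
            (sum_le_sum_of_subset_of_nonneg hsub fun n _ _ => by positivity) hcT
      _ ≤ (∏ q ∈ T, (c / (q : ℝ))) * ((1 + Real.log (B / A)) / d) := by
          gcongr
          exact sum_inv_filter_dvd_window_le hdpos N hA hAB
      _ = (∏ q ∈ T, (c / (q : ℝ))) / (∏ q ∈ T, (q : ℝ)) * (1 + Real.log (B / A)) := by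
          rw [hdR]; ring
      _ = (∏ q ∈ T, (c / (q : ℝ) ^ 2)) * (1 + Real.log (B / A)) := by
          rw [← prod_div_distrib]
          congr 1
          refine prod_congr rfl fun q _ => ?_
          rw [div_div, sq]
  calc ∑ T ∈ P.powerset, ∑ n ∈ S.filter (fun n => T ⊆ n.primeFactors),
          (∏ q ∈ T, (c / (q : ℝ))) / (n : ℝ)
      ≤ ∑ T ∈ P.powerset, (∏ q ∈ T, (c / (q : ℝ) ^ 2)) * (1 + Real.log (B / A)) :=
        sum_le_sum hinner
    _ = (∏ q ∈ P, (1 + c / (q : ℝ) ^ 2)) * (1 + Real.log (B / A)) := by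
        rw [← sum_mul, prod_one_add]
    _ ≤ Real.exp (∑ q ∈ P, c / (q : ℝ) ^ 2) * (1 + Real.log (B / A)) := by
        gcongr
        exact Real.prod_one_add_le_exp_sum P fun q => by positivity
    _ ≤ Real.exp c * (1 + Real.log (B / A)) := by
        gcongr
        calc ∑ q ∈ P, c / (q : ℝ) ^ 2 = c * ∑ q ∈ P, ((q : ℝ) ^ 2)⁻¹ := by
              rw [mul_sum]
              refine sum_congr rfl fun q _ => ?_
              rw [div_eq_mul_inv]
          _ ≤ c * 1 := by gcongr; exact sum_primes_inv_sq_le_one N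
          _ = c := mul_one c

/-- `Σ_{1 ≤ m < N} 1/m² ≤ 2`. [folklore] -/
private theorem sum_Ico_inv_sq_le_two (N : ℕ) : ∑ m ∈ Ico 1 N, ((m : ℝ) ^ 2)⁻¹ ≤ 2 := by
  rcases Nat.lt_or_ge N 2 with hN | hN
  · interval_cases N
    · simp
    · simp
  have h1 : (1 : ℕ) ∈ Ico 1 N := mem_Ico.mpr ⟨le_refl 1, by omega⟩
  rw [← add_sum_erase _ _ h1]
  have hsub : (Ico 1 N).erase 1 ⊆ Ioo 1 N := by
    intro m hm
    rw [mem_erase, mem_Ico] at hm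
    exact mem_Ioo.mpr ⟨by omega, hm.2.2⟩
  have h2 : ∑ m ∈ (Ico 1 N).erase 1, ((m : ℝ) ^ 2)⁻¹ ≤ 1 :=
    calc ∑ m ∈ (Ico 1 N).erase 1, ((m : ℝ) ^ 2)⁻¹ ≤ ∑ m ∈ Ioo 1 N, ((m : ℝ) ^ 2)⁻¹ :=
          sum_le_sum_of_subset_of_nonneg hsub fun q _ _ => by positivity
      _ ≤ 2 / (1 + 1) := by exact_mod_cast sum_Ioo_inv_sq_le (α := ℝ) 1 N
      _ = 1 := by norm_num
  calc (((1 : ℕ) : ℝ) ^ 2)⁻¹ + ∑ m ∈ (Ico 1 N).erase 1, ((m : ℝ) ^ 2)⁻¹ ≤ 1 + 1 :=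
        add_le_add (by norm_num) h2
    _ = 2 := by norm_num

/-- **Second moment of the majorant**: `Σ_{1 ≤ n < N} n⁻²∏_{q∣n}(1 + c/q) ≤ 2eᶜ` for `c ≥ 0`.
[cite: Zhang2022LandauSiegel, §10 p. 58] -/
theorem sum_prod_div_sq_le {c : ℝ} (hc : 0 ≤ c) (N : ℕ) :
    ∑ n ∈ Ico 1 N, (∏ q ∈ n.primeFactors, (1 + c / (q : ℝ))) / (n : ℝ) ^ 2 ≤
      2 * Real.exp c := by
  classical
  set P : Finset ℕ := (range N).filter Nat.Prime with hP
  have hexp : ∀ n : ℕ, (∏ q ∈ n.primeFactors, (1 + c / (q : ℝ))) / (n : ℝ) ^ 2 =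
      ∑ T ∈ n.primeFactors.powerset, (∏ q ∈ T, (c / (q : ℝ))) / (n : ℝ) ^ 2 := by
    intro n
    rw [prod_one_add, sum_div]
  rw [sum_congr rfl fun n _ => hexp n]
  have hswap : ∑ n ∈ Ico 1 N, ∑ T ∈ n.primeFactors.powerset,
      (∏ q ∈ T, (c / (q : ℝ))) / (n : ℝ) ^ 2 =
      ∑ T ∈ P.powerset, ∑ n ∈ (Ico 1 N).filter (fun n => T ⊆ n.primeFactors),
        (∏ q ∈ T, (c / (q : ℝ))) / (n : ℝ) ^ 2 := by
    refine sum_comm' fun n T => ?_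
    simp only [mem_powerset, mem_filter, mem_Ico]
    constructor
    · rintro ⟨⟨h1, hN⟩, hT⟩
      refine ⟨⟨⟨h1, hN⟩, hT⟩, hT.trans fun q hq => ?_⟩
      rw [hP, mem_filter, mem_range]
      have hq' := Nat.mem_primeFactors.mp hq
      exact ⟨lt_of_le_of_lt (Nat.le_of_dvd h1 hq'.2.1) hN, hq'.1⟩
    · rintro ⟨⟨⟨h1, hN⟩, hT⟩, _⟩
      exact ⟨⟨h1, hN⟩, hT⟩
  rw [hswap]
  have hinner : ∀ T ∈ P.powerset,
      ∑ n ∈ (Ico 1 N).filter (fun n => T ⊆ n.primeFactors),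
          (∏ q ∈ T, (c / (q : ℝ))) / (n : ℝ) ^ 2 ≤
        2 * ∏ q ∈ T, (c / (q : ℝ) ^ 3) := by
    intro T hT
    rw [mem_powerset] at hT
    have hTprime : ∀ q ∈ T, q.Prime := fun q hq => by
      have := hT hq
      rw [hP, mem_filter] at this
      exact this.2
    set d : ℕ := ∏ q ∈ T, q with hd
    have hdpos : 0 < d := prod_pos fun q hq => (hTprime q hq).pos
    have hdR0 : (0 : ℝ) < d := by exact_mod_cast hdpos
    have hcT : 0 ≤ ∏ q ∈ T, (c / (q : ℝ)) := prod_nonneg fun q _ => by positivity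
    -- multiples of `d`
    have hsub : (Ico 1 N).filter (fun n => T ⊆ n.primeFactors) ⊆
        (Ico 1 N).image (fun m => d * m) := by
      intro n hn
      rw [mem_filter, mem_Ico] at hn
      have hdvd : d ∣ n := by
        rw [hd]
        exact Finset.prod_primes_dvd n (fun q hq => (hTprime q hq).prime)
          fun q hq => (Nat.mem_primeFactors.mp (hn.2 hq)).2.1
      obtain ⟨m, rfl⟩ := hdvd
      rw [mem_image]
      refine ⟨m, mem_Ico.mpr ⟨?_, ?_⟩, rfl⟩
      · rcases Nat.eq_zero_or_pos m with h0 | h0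
        · simp [h0] at hn
        · exact h0
      · exact lt_of_le_of_lt (Nat.le_mul_of_pos_left m hdpos) hn.1.2
    have hinj : Set.InjOn (fun m => d * m) ((Ico 1 N : Finset ℕ) : Set ℕ) := by
      intro a _ b _ hab
      exact Nat.eq_of_mul_eq_mul_left hdpos hab
    have hdR : (d : ℝ) = ∏ q ∈ T, (q : ℝ) := by rw [hd]; push_cast; rfl
    calc ∑ n ∈ (Ico 1 N).filter (fun n => T ⊆ n.primeFactors),
          (∏ q ∈ T, (c / (q : ℝ))) / (n : ℝ) ^ 2
        = (∏ q ∈ T, (c / (q : ℝ))) *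
            ∑ n ∈ (Ico 1 N).filter (fun n => T ⊆ n.primeFactors), ((n : ℝ) ^ 2)⁻¹ := by
          rw [mul_sum]
          refine sum_congr rfl fun n _ => ?_
          rw [div_eq_mul_inv]
      _ ≤ (∏ q ∈ T, (c / (q : ℝ))) * ∑ n ∈ (Ico 1 N).image (fun m => d * m), ((n : ℝ) ^ 2)⁻¹ :=
          mul_le_mul_of_nonneg_left
            (sum_le_sum_of_subset_of_nonneg hsub fun n _ _ => by positivity) hcT
      _ = (∏ q ∈ T, (c / (q : ℝ))) * ∑ m ∈ Ico 1 N, (((d * m : ℕ) : ℝ) ^ 2)⁻¹ := by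
          rw [sum_image hinj]
      _ = (∏ q ∈ T, (c / (q : ℝ))) * ((d : ℝ) ^ 2)⁻¹ * ∑ m ∈ Ico 1 N, ((m : ℝ) ^ 2)⁻¹ := by
          rw [mul_assoc, mul_sum (Ico 1 N) (fun m : ℕ => ((m : ℝ) ^ 2)⁻¹)]
          congr 1
          refine sum_congr rfl fun m _ => ?_
          push_cast
          rw [mul_pow, mul_inv]
      _ ≤ (∏ q ∈ T, (c / (q : ℝ))) * ((d : ℝ) ^ 2)⁻¹ * 2 := by
          gcongr
          exact sum_Ico_inv_sq_le_two N
      _ = 2 * ((∏ q ∈ T, (c / (q : ℝ))) / (∏ q ∈ T, (q : ℝ)) ^ 2) := by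
          rw [hdR]; ring
      _ = 2 * ∏ q ∈ T, (c / (q : ℝ) ^ 3) := by
          rw [← prod_pow, ← prod_div_distrib]
          congr 1
          refine prod_congr rfl fun q _ => ?_
          rw [div_div]; ring
  have hP3 : ∑ q ∈ P, c / (q : ℝ) ^ 3 ≤ c := by
    calc ∑ q ∈ P, c / (q : ℝ) ^ 3 ≤ ∑ q ∈ P, c * ((q : ℝ) ^ 2)⁻¹ := by
          refine sum_le_sum fun q hq => ?_
          rw [hP, mem_filter] at hq
          have hq1 : (1 : ℝ) ≤ q := by exact_mod_cast hq.2.one_lt.le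
          rw [div_eq_mul_inv]
          refine mul_le_mul_of_nonneg_left ?_ hc
          exact inv_anti₀ (by positivity) (by nlinarith)
      _ = c * ∑ q ∈ P, ((q : ℝ) ^ 2)⁻¹ := by rw [mul_sum]
      _ ≤ c * 1 := by gcongr; exact sum_primes_inv_sq_le_one N
      _ = c := mul_one c
  calc ∑ T ∈ P.powerset, ∑ n ∈ (Ico 1 N).filter (fun n => T ⊆ n.primeFactors),
          (∏ q ∈ T, (c / (q : ℝ))) / (n : ℝ) ^ 2
      ≤ ∑ T ∈ P.powerset, 2 * ∏ q ∈ T, (c / (q : ℝ) ^ 3) := sum_le_sum hinner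
    _ = 2 * ∏ q ∈ P, (1 + c / (q : ℝ) ^ 3) := by
        rw [← mul_sum, prod_one_add]
    _ ≤ 2 * Real.exp (∑ q ∈ P, c / (q : ℝ) ^ 3) := by
        gcongr
        exact Real.prod_one_add_le_exp_sum P fun q => by positivity
    _ ≤ 2 * Real.exp c := by gcongr

/-! ## Part A′. The weight `|λ₀ⱼ(dr)|(1 + |Π(d,r)|)/(drφ(r))` of the `(d,r)`-sums of §10 -/

/-- `n/φ(n) ≤ ∏_{q∣n}(1 + 2/q)` (`(1 − 1/q)⁻¹ ≤ 1 + 2/q` for `q ≥ 2`). [cite: Zhang2022LandauSiegel, §10 p. 58] -/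
theorem self_div_totient_le {n : ℕ} (hn : n ≠ 0) :
    (n : ℝ) / (Nat.totient n : ℝ) ≤ ∏ q ∈ n.primeFactors, (1 + 2 / (q : ℝ)) := by
  have hnR : (0 : ℝ) < n := by exact_mod_cast Nat.pos_of_ne_zero hn
  have hpos : ∀ q ∈ n.primeFactors, (0 : ℝ) < 1 - 1 / (q : ℝ) := fun q hq => by
    have hq2 : (2 : ℝ) ≤ q := by exact_mod_cast (Nat.prime_of_mem_primeFactors hq).two_le
    have : 1 / (q : ℝ) ≤ 1 / 2 := by
      rw [div_le_div_iff₀ (by linarith) (by norm_num)]; linarith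
    linarith
  rw [MertensBound.totient_eq_mul_prod_one_sub_inv n, div_mul_eq_div_div, div_self hnR.ne',
    one_div, ← prod_inv_distrib]
  refine prod_le_prod (fun q hq => (inv_pos.mpr (hpos q hq)).le) fun q hq => ?_
  have hq2 : (2 : ℝ) ≤ q := by exact_mod_cast (Nat.prime_of_mem_primeFactors hq).two_le
  have hq0 : (0 : ℝ) < q := by linarith
  have ht0 : 0 ≤ 1 / (q : ℝ) := by positivity
  have ht : 1 / (q : ℝ) ≤ 1 / 2 := by
    rw [div_le_div_iff₀ hq0 (by norm_num)]; linarith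
  have key : 1 ≤ (1 + 2 / (q : ℝ)) * (1 - 1 / q) := by
    have e : (1 + 2 / (q : ℝ)) * (1 - 1 / q) = 1 + (1 / q) * (1 - 2 * (1 / q)) := by ring
    rw [e]
    nlinarith [mul_nonneg ht0 (by linarith : (0 : ℝ) ≤ 1 - 2 * (1 / q))]
  have hp := hpos q hq
  calc (1 - 1 / (q : ℝ))⁻¹ = 1 / (1 - 1 / q) := inv_eq_one_div _
    _ ≤ (1 + 2 / (q : ℝ)) * (1 - 1 / q) / (1 - 1 / q) := div_le_div_of_nonneg_right key hp.le
    _ = 1 + 2 / (q : ℝ) := mul_div_cancel_right₀ _ hp.ne'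

/-- `1 ≤ ∏_{q ∈ s}(1 + c/q)` for `c ≥ 0`. [folklore] -/
private theorem one_le_prod_one_add_div {c : ℝ} (hc : 0 ≤ c) (s : Finset ℕ) :
    1 ≤ ∏ q ∈ s, (1 + c / (q : ℝ)) := by
  calc (1 : ℝ) = ∏ _q ∈ s, (1 : ℝ) := prod_const_one.symm
    _ ≤ ∏ q ∈ s, (1 + c / (q : ℝ)) :=
        prod_le_prod (fun _ _ => zero_le_one) fun q _ => by
          have : 0 ≤ c / (q : ℝ) := by positivity
          linarith

/-- `∏_{q∣mn}(1 + c/q) ≤ ∏_{q∣m}(1 + c/q)·∏_{q∣n}(1 + c/q)` for `c ≥ 0`. [cite: Zhang2022LandauSiegel, §10 p. 58] -/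
theorem prod_primeFactors_mul_le {c : ℝ} (hc : 0 ≤ c) {m n : ℕ} (hm : m ≠ 0) (hn : n ≠ 0) :
    ∏ q ∈ (m * n).primeFactors, (1 + c / (q : ℝ)) ≤
      (∏ q ∈ m.primeFactors, (1 + c / (q : ℝ))) * ∏ q ∈ n.primeFactors, (1 + c / (q : ℝ)) := by
  rw [Nat.primeFactors_mul hm hn, ← prod_union_inter]
  have h0 : 0 ≤ ∏ q ∈ m.primeFactors ∪ n.primeFactors, (1 + c / (q : ℝ)) :=
    prod_nonneg fun q _ => by positivity
  exact le_mul_of_one_le_right h0 (one_le_prod_one_add_div hc _)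

/-- For `q ≥ 2` and `‖z‖ ≤ 1`: `‖(1 − z/q)⁻¹‖ ≤ (1 − 1/q)⁻¹`-type bounds: the two local factors of
`Π(d,r)` have norm at most `(1 − 1/q)⁻¹`. [cite: Zhang2022LandauSiegel, §8 Lemma 8.3] -/
theorem norm_PiW_le {D : ℕ} (χ : DirichletCharacter ℂ D) {d r : ℕ} (hd : d ≠ 0) (hr : r ≠ 0) :
    ‖PiW χ d r‖ ≤ ((d * r : ℕ) : ℝ) / (Nat.totient (d * r) : ℝ) * ((d : ℝ) / (Nat.totient d : ℝ)) := by
  have hdr : d * r ≠ 0 := mul_ne_zero hd hr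
  -- facts about a prime `q`
  have hq_facts : ∀ q : ℕ, q.Prime → (0 : ℝ) < q ∧ 0 < 1 - 1 / (q : ℝ) ∧
      ‖χ (q : ZMod D) * (q : ℂ)⁻¹‖ ≤ 1 / q ∧ ‖(1 : ℂ) - (q : ℂ)⁻¹‖ = 1 - 1 / (q : ℝ) := by
    intro q hq
    have hq2 : (2 : ℝ) ≤ q := by exact_mod_cast hq.two_le
    have hq0 : (0 : ℝ) < q := by linarith
    have h1 : 1 / (q : ℝ) ≤ 1 / 2 := by
      rw [div_le_div_iff₀ hq0 (by norm_num)]; linarith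
    refine ⟨hq0, by linarith, ?_, ?_⟩
    · rw [norm_mul, norm_inv, Complex.norm_natCast]
      calc ‖χ (q : ZMod D)‖ * (q : ℝ)⁻¹ ≤ 1 * (q : ℝ)⁻¹ := by
            gcongr; exact χ.norm_le_one _
        _ = 1 / q := by rw [one_mul, one_div]
    · have e : (1 : ℂ) - (q : ℂ)⁻¹ = ((1 - 1 / (q : ℝ) : ℝ) : ℂ) := by push_cast; ring
      rw [e, Complex.norm_real, Real.norm_eq_abs, abs_of_pos (by linarith)]
  -- the first factor
  have hA : ∏ q ∈ (d * r).primeFactors, ‖(1 - χ (q : ZMod D) * (q : ℂ)⁻¹)⁻¹‖ ≤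
      ∏ q ∈ (d * r).primeFactors, (1 - 1 / (q : ℝ))⁻¹ := by
    refine prod_le_prod (fun _ _ => norm_nonneg _) fun q hq => ?_
    obtain ⟨hq0, hpos, hz, -⟩ := hq_facts q (Nat.prime_of_mem_primeFactors hq)
    have hlow : 1 - 1 / (q : ℝ) ≤ ‖1 - χ (q : ZMod D) * (q : ℂ)⁻¹‖ := by
      calc 1 - 1 / (q : ℝ) ≤ ‖(1 : ℂ)‖ - ‖χ (q : ZMod D) * (q : ℂ)⁻¹‖ := by rw [norm_one]; linarith
        _ ≤ ‖1 - χ (q : ZMod D) * (q : ℂ)⁻¹‖ := norm_sub_norm_le _ _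
    rw [norm_inv]
    exact inv_anti₀ hpos hlow
  have hA' : ∏ q ∈ (d * r).primeFactors, (1 - 1 / (q : ℝ))⁻¹ =
      ((d * r : ℕ) : ℝ) / (Nat.totient (d * r) : ℝ) := by
    have h0 : ((d * r : ℕ) : ℝ) ≠ 0 := by exact_mod_cast hdr
    rw [prod_inv_distrib, MertensBound.totient_eq_mul_prod_one_sub_inv (d * r), div_mul_eq_div_div,
      div_self h0, one_div]
  -- the second factor
  have hB : ∏ q ∈ d.primeFactors.filter (fun q => Nat.Coprime q r),
        ‖(1 - (q : ℂ)⁻¹ - χ (q : ZMod D) * (q : ℂ)⁻¹) / (1 - (q : ℂ)⁻¹)‖ ≤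
      ∏ q ∈ d.primeFactors, (1 - 1 / (q : ℝ))⁻¹ := by
    calc ∏ q ∈ d.primeFactors.filter (fun q => Nat.Coprime q r),
          ‖(1 - (q : ℂ)⁻¹ - χ (q : ZMod D) * (q : ℂ)⁻¹) / (1 - (q : ℂ)⁻¹)‖
        ≤ ∏ q ∈ d.primeFactors.filter (fun q => Nat.Coprime q r), (1 - 1 / (q : ℝ))⁻¹ := by
          refine prod_le_prod (fun _ _ => norm_nonneg _) fun q hq => ?_
          have hqp := Nat.prime_of_mem_primeFactors (mem_filter.mp hq).1
          obtain ⟨hq0, hpos, hz, hone⟩ := hq_facts q hqp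
          rw [norm_div, hone, div_le_iff₀ hpos, inv_mul_cancel₀ hpos.ne']
          calc ‖1 - (q : ℂ)⁻¹ - χ (q : ZMod D) * (q : ℂ)⁻¹‖
              ≤ ‖(1 : ℂ) - (q : ℂ)⁻¹‖ + ‖χ (q : ZMod D) * (q : ℂ)⁻¹‖ := norm_sub_le _ _
            _ ≤ (1 - 1 / (q : ℝ)) + 1 / q := by rw [hone]; linarith
            _ = 1 := by ring
      _ ≤ ∏ q ∈ d.primeFactors, (1 - 1 / (q : ℝ))⁻¹ := by
          rw [← prod_filter_mul_prod_filter_not d.primeFactors (fun q => Nat.Coprime q r)]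
          refine le_mul_of_one_le_right (prod_nonneg fun q hq => ?_) ?_
          · obtain ⟨-, hpos, -, -⟩ :=
              hq_facts q (Nat.prime_of_mem_primeFactors (mem_filter.mp hq).1)
            exact (inv_pos.mpr hpos).le
          · calc (1 : ℝ) = ∏ _q ∈ d.primeFactors.filter (fun q => ¬Nat.Coprime q r), (1 : ℝ) :=
                prod_const_one.symm
              _ ≤ _ := prod_le_prod (fun _ _ => zero_le_one) fun q hq => by
                  obtain ⟨hq0, hpos, -, -⟩ :=
                    hq_facts q (Nat.prime_of_mem_primeFactors (mem_filter.mp hq).1)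
                  have : 1 - 1 / (q : ℝ) ≤ 1 := by
                    have : 0 ≤ 1 / (q : ℝ) := by positivity
                    linarith
                  exact one_le_inv_iff₀.mpr ⟨hpos, this⟩
  have hB' : ∏ q ∈ d.primeFactors, (1 - 1 / (q : ℝ))⁻¹ = (d : ℝ) / (Nat.totient d : ℝ) := by
    have h0 : (d : ℝ) ≠ 0 := by exact_mod_cast hd
    rw [prod_inv_distrib, MertensBound.totient_eq_mul_prod_one_sub_inv d, div_mul_eq_div_div,
      div_self h0, one_div]
  rw [PiW, norm_mul, norm_prod, norm_prod, ← hA', ← hB']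
  exact mul_le_mul hA hB (prod_nonneg fun _ _ => norm_nonneg _)
    (prod_nonneg fun q hq => (inv_pos.mpr (hq_facts q (Nat.prime_of_mem_primeFactors hq)).2.1).le)

/-- `∏_{q∣n}(1 + 25/q)·∏_{q∣n}(1 + 2/q) ≤ ∏_{q∣n}(1 + 52/q)`. [folklore] -/
private theorem prod25_mul_prod2_le (n : ℕ) :
    (∏ q ∈ n.primeFactors, (1 + 25 / (q : ℝ))) * ∏ q ∈ n.primeFactors, (1 + 2 / (q : ℝ)) ≤
      ∏ q ∈ n.primeFactors, (1 + 52 / (q : ℝ)) := by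
  rw [← prod_mul_distrib]
  refine prod_le_prod (fun q _ => by positivity) fun q hq => ?_
  have hq2 : (2 : ℝ) ≤ q := by exact_mod_cast (Nat.prime_of_mem_primeFactors hq).two_le
  have hq0 : (0 : ℝ) < q := by linarith
  have ht0 : 0 ≤ 1 / (q : ℝ) := by positivity
  have ht : 1 / (q : ℝ) ≤ 1 / 2 := by
    rw [div_le_div_iff₀ hq0 (by norm_num)]; linarith
  have e1 : (1 + 25 / (q : ℝ)) * (1 + 2 / q) = 1 + 27 * (1 / q) + 50 * (1 / q) * (1 / q) := by ring
  have e2 : (1 + 52 / (q : ℝ)) = 1 + 52 * (1 / q) := by ring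
  rw [e1, e2]
  nlinarith [mul_nonneg ht0 (by linarith : (0 : ℝ) ≤ 1 / 2 - 1 / q)]

/-- **The pointwise weight bound**: for `d, r ≥ 1`,
`|λ₀ⱼ(dr)|(1 + |Π(d,r)|)/(drφ(r)) ≤ 2·G(d)/d·G(r)/r²`, `G(n) = ∏_{q∣n}(1 + 52/q)`
(`|λ₀ⱼ(n)| ≤ (φ(n)/n)∏(1+25/q)`, `|Π(d,r)| ≤ (dr/φ(dr))(d/φ(d))`, `n/φ(n) ≤ ∏(1+2/q)`).
[cite: Zhang2022LandauSiegel, §7 p.34; §8 Lemma 8.3] -/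
theorem pairWeight_le (c' : ℝ) (D : ℕ) (χ : DirichletCharacter ℂ D) (j : ℕ) {d r : ℕ}
    (hd : d ≠ 0) (hr : r ≠ 0) :
    ‖lamZero c' D j (d * r)‖ * (1 + ‖PiW χ d r‖) / ((d : ℝ) * r * (Nat.totient r : ℝ)) ≤
      2 * ((∏ q ∈ d.primeFactors, (1 + 52 / (q : ℝ))) / d) *
        ((∏ q ∈ r.primeFactors, (1 + 52 / (q : ℝ))) / (r : ℝ) ^ 2) := by
  have hdr : d * r ≠ 0 := mul_ne_zero hd hr
  have hdR : (0 : ℝ) < d := by exact_mod_cast Nat.pos_of_ne_zero hd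
  have hrR : (0 : ℝ) < r := by exact_mod_cast Nat.pos_of_ne_zero hr
  have hdrR : (0 : ℝ) < ((d * r : ℕ) : ℝ) := by exact_mod_cast Nat.pos_of_ne_zero hdr
  have hφd : (0 : ℝ) < Nat.totient d := by exact_mod_cast Nat.totient_pos.mpr (Nat.pos_of_ne_zero hd)
  have hφr : (0 : ℝ) < Nat.totient r := by exact_mod_cast Nat.totient_pos.mpr (Nat.pos_of_ne_zero hr)
  have hφdr : (0 : ℝ) < Nat.totient (d * r) := by
    exact_mod_cast Nat.totient_pos.mpr (Nat.pos_of_ne_zero hdr)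
  -- names for the local products
  set Fd : ℝ := ∏ q ∈ d.primeFactors, (1 + 25 / (q : ℝ)) with hFd
  set Fr : ℝ := ∏ q ∈ r.primeFactors, (1 + 25 / (q : ℝ)) with hFr
  set Ed : ℝ := ∏ q ∈ d.primeFactors, (1 + 2 / (q : ℝ)) with hEd
  set Er : ℝ := ∏ q ∈ r.primeFactors, (1 + 2 / (q : ℝ)) with hEr
  set Gd : ℝ := ∏ q ∈ d.primeFactors, (1 + 52 / (q : ℝ)) with hGd
  set Gr : ℝ := ∏ q ∈ r.primeFactors, (1 + 52 / (q : ℝ)) with hGr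
  have hFd0 : 0 ≤ Fd := prod_nonneg fun q _ => by positivity
  have hFr0 : 0 ≤ Fr := prod_nonneg fun q _ => by positivity
  have hEr0 : 0 ≤ Er := prod_nonneg fun q _ => by positivity
  -- the ingredients
  have hlam : ‖lamZero c' D j (d * r)‖ ≤
      (∏ q ∈ (d * r).primeFactors, (1 + 25 / (q : ℝ))) * ((Nat.totient (d * r) : ℝ) / ((d * r : ℕ) : ℝ)) :=
    Sec18SjNorm.norm_lamZero_le c' D j hdr
  have hF : ∏ q ∈ (d * r).primeFactors, (1 + 25 / (q : ℝ)) ≤ Fd * Fr :=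
    prod_primeFactors_mul_le (by norm_num) hd hr
  have hPi := norm_PiW_le χ hd hr
  have hu1 : (Nat.totient (d * r) : ℝ) / ((d * r : ℕ) : ℝ) ≤ 1 := by
    rw [div_le_one hdrR]; exact_mod_cast Nat.totient_le (d * r)
  have hv : (d : ℝ) / (Nat.totient d : ℝ) ≤ Ed := self_div_totient_le hd
  have hv1 : 1 ≤ (d : ℝ) / (Nat.totient d : ℝ) := by
    rw [le_div_iff₀ hφd, one_mul]; exact_mod_cast Nat.totient_le d
  have hEr' : (r : ℝ) / (Nat.totient r : ℝ) ≤ Er := self_div_totient_le hr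
  -- numerator: `|λ₀|(1 + |Π|) ≤ 2 F(d)F(r)E(d)`
  have hnum : ‖lamZero c' D j (d * r)‖ * (1 + ‖PiW χ d r‖) ≤ 2 * (Fd * Ed) * Fr := by
    set u : ℝ := (Nat.totient (d * r) : ℝ) / ((d * r : ℕ) : ℝ) with hu
    set v : ℝ := (d : ℝ) / (Nat.totient d : ℝ) with hvdef
    have hu0 : 0 < u := div_pos hφdr hdrR
    have huinv : ((d * r : ℕ) : ℝ) / (Nat.totient (d * r) : ℝ) = u⁻¹ := by rw [hu, inv_div]
    have h1 : ‖lamZero c' D j (d * r)‖ * (1 + ‖PiW χ d r‖) ≤ (Fd * Fr * u) * (1 + u⁻¹ * v) := by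
      refine mul_le_mul (hlam.trans (mul_le_mul_of_nonneg_right hF hu0.le)) ?_
        (by positivity) (by positivity)
      rw [← huinv]; linarith
    have h2 : (Fd * Fr * u) * (1 + u⁻¹ * v) = Fd * Fr * (u + v) := by
      field_simp
    have h3 : u + v ≤ 2 * Ed := by linarith
    calc ‖lamZero c' D j (d * r)‖ * (1 + ‖PiW χ d r‖) ≤ Fd * Fr * (u + v) := by rw [← h2]; exact h1
      _ ≤ Fd * Fr * (2 * Ed) := by gcongr
      _ = 2 * (Fd * Ed) * Fr := by ring
  -- denominator: `1/(drφ(r)) ≤ E(r)/(d r²)`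
  have hden : (1 : ℝ) / ((d : ℝ) * r * (Nat.totient r : ℝ)) ≤ Er / ((d : ℝ) * (r : ℝ) ^ 2) := by
    rw [div_le_div_iff₀ (by positivity) (by positivity)]
    have : (r : ℝ) ≤ Er * (Nat.totient r : ℝ) := by
      rw [div_le_iff₀ hφr] at hEr'; exact hEr'
    have h' : (d : ℝ) * r * r ≤ (d : ℝ) * r * (Er * (Nat.totient r : ℝ)) :=
      mul_le_mul_of_nonneg_left this (by positivity)
    calc 1 * ((d : ℝ) * (r : ℝ) ^ 2) = (d : ℝ) * r * r := by ring
      _ ≤ (d : ℝ) * r * (Er * (Nat.totient r : ℝ)) := h'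
      _ = Er * ((d : ℝ) * r * (Nat.totient r : ℝ)) := by ring
  have hG1 : Fd * Ed ≤ Gd := prod25_mul_prod2_le d
  have hG2 : Fr * Er ≤ Gr := prod25_mul_prod2_le r
  calc ‖lamZero c' D j (d * r)‖ * (1 + ‖PiW χ d r‖) / ((d : ℝ) * r * (Nat.totient r : ℝ))
      = ‖lamZero c' D j (d * r)‖ * (1 + ‖PiW χ d r‖) * (1 / ((d : ℝ) * r * (Nat.totient r : ℝ))) := by
        rw [mul_one_div]
    _ ≤ (2 * (Fd * Ed) * Fr) * (Er / ((d : ℝ) * (r : ℝ) ^ 2)) :=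
        mul_le_mul hnum hden (by positivity) (by positivity)
    _ = 2 * ((Fd * Ed) / d) * ((Fr * Er) / (r : ℝ) ^ 2) := by
        field_simp
    _ ≤ 2 * (Gd / d) * (Gr / (r : ℝ) ^ 2) := by
        gcongr

/-- **Window sum of the `(d,r)`-weights** (the `× log T` step of the §10 range lines): for
`0 < A ≤ B`,
`Σ_{d,r < N, A < dr ≤ B} |λ₀ⱼ(dr)|(1 + |Π(d,r)|)/(drφ(r)) ≤ 4e¹⁰⁴(1 + log(B/A))`.
[cite: Zhang2022LandauSiegel, §10 p. 58] -/
theorem pairSum_window_le (c' : ℝ) (D : ℕ) (χ : DirichletCharacter ℂ D) (j N : ℕ) {A B : ℝ}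
    (hA : 0 < A) (hAB : A ≤ B) :
    ∑ d ∈ Ico 1 N, ∑ r ∈ Ico 1 N,
      (if A < ((d * r : ℕ) : ℝ) ∧ ((d * r : ℕ) : ℝ) ≤ B then
        ‖lamZero c' D j (d * r)‖ * (1 + ‖PiW χ d r‖) / ((d : ℝ) * r * (Nat.totient r : ℝ))
      else 0) ≤ 4 * Real.exp 104 * (1 + Real.log (B / A)) := by
  set G : ℕ → ℝ := fun n => ∏ q ∈ n.primeFactors, (1 + 52 / (q : ℝ)) with hG
  have hG0 : ∀ n, 0 ≤ G n := fun n => prod_nonneg fun q _ => by positivity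
  have hlog : 0 ≤ 1 + Real.log (B / A) := by
    have : 0 ≤ Real.log (B / A) := Real.log_nonneg (by rw [le_div_iff₀ hA]; linarith)
    linarith
  -- pointwise
  have step1 : ∑ d ∈ Ico 1 N, ∑ r ∈ Ico 1 N,
      (if A < ((d * r : ℕ) : ℝ) ∧ ((d * r : ℕ) : ℝ) ≤ B then
        ‖lamZero c' D j (d * r)‖ * (1 + ‖PiW χ d r‖) / ((d : ℝ) * r * (Nat.totient r : ℝ))
      else 0) ≤
      ∑ d ∈ Ico 1 N, ∑ r ∈ Ico 1 N,
        (if A < ((d * r : ℕ) : ℝ) ∧ ((d * r : ℕ) : ℝ) ≤ B then 2 * (G d / d) * (G r / (r : ℝ) ^ 2)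
        else 0) := by
    refine sum_le_sum fun d hd => sum_le_sum fun r hr => ?_
    have hd0 : d ≠ 0 := by have := (mem_Ico.mp hd).1; omega
    have hr0 : r ≠ 0 := by have := (mem_Ico.mp hr).1; omega
    split_ifs
    · exact pairWeight_le c' D χ j hd0 hr0
    · exact le_refl _
  -- swap and factor
  have step2 : ∑ d ∈ Ico 1 N, ∑ r ∈ Ico 1 N,
        (if A < ((d * r : ℕ) : ℝ) ∧ ((d * r : ℕ) : ℝ) ≤ B then 2 * (G d / d) * (G r / (r : ℝ) ^ 2)
        else 0) =
      ∑ r ∈ Ico 1 N, (2 * (G r / (r : ℝ) ^ 2)) *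
        ∑ d ∈ Ico 1 N, (if A < ((d * r : ℕ) : ℝ) ∧ ((d * r : ℕ) : ℝ) ≤ B then G d / d else 0) := by
    rw [sum_comm]
    refine sum_congr rfl fun r _ => ?_
    rw [mul_sum]
    refine sum_congr rfl fun d _ => ?_
    split_ifs <;> ring
  -- the inner window sums
  have step3 : ∀ r ∈ Ico 1 N,
      ∑ d ∈ Ico 1 N, (if A < ((d * r : ℕ) : ℝ) ∧ ((d * r : ℕ) : ℝ) ≤ B then G d / d else 0) ≤
        Real.exp 52 * (1 + Real.log (B / A)) := by
    intro r hr
    have hr0 : (0 : ℝ) < r := by exact_mod_cast (mem_Ico.mp hr).1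
    rw [← sum_filter]
    have hflt : (Ico 1 N).filter (fun d => A < ((d * r : ℕ) : ℝ) ∧ ((d * r : ℕ) : ℝ) ≤ B) =
        (Ico 1 N).filter (fun d : ℕ => A / r < (d : ℝ) ∧ (d : ℝ) ≤ B / r) := by
      refine filter_congr fun d _ => ?_
      push_cast
      rw [div_lt_iff₀ hr0, le_div_iff₀ hr0]
    rw [hflt]
    have h := sum_prod_window_le (c := 52) (by norm_num) N (div_pos hA hr0)
      (div_le_div_of_nonneg_right hAB hr0.le)
    rwa [div_div_div_cancel_right₀ hr0.ne'] at h
  calc _ ≤ _ := step1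
    _ = _ := step2
    _ ≤ ∑ r ∈ Ico 1 N, (2 * (G r / (r : ℝ) ^ 2)) * (Real.exp 52 * (1 + Real.log (B / A))) :=
        sum_le_sum fun r hr => mul_le_mul_of_nonneg_left (step3 r hr)
          (mul_nonneg zero_le_two (div_nonneg (hG0 r) (sq_nonneg _)))
    _ = 2 * (Real.exp 52 * (1 + Real.log (B / A))) * ∑ r ∈ Ico 1 N, G r / (r : ℝ) ^ 2 := by
        rw [mul_sum]
        refine sum_congr rfl fun r _ => ?_
        ring
    _ ≤ 2 * (Real.exp 52 * (1 + Real.log (B / A))) * (2 * Real.exp 52) := by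
        gcongr
        exact sum_prod_div_sq_le (by norm_num) N
    _ = 4 * Real.exp 104 * (1 + Real.log (B / A)) := by
        rw [show (104 : ℝ) = 52 + 52 by norm_num, Real.exp_add]; ring


/-! ## Part B. The `m`- and `n`-sums of `S_j(𝐚₁₃,𝐚₂₁)` as `𝔳₁ⱼ` and as Lemma 8.4 sums -/

/-- `f̃(z) = 0` for `z > 0.504` ((2.28)). [cite: Zhang2022LandauSiegel, §2 (2.28)] -/
theorem ftilde_eq_zero_of_gt {z : ℝ} (hz : 0.504 < z) : ftilde z = 0 := by
  unfold ftilde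
  split_ifs with h1 h2
  · exfalso; linarith [h1.2]
  · exfalso; linarith [h2.2]
  · rfl

/-- `P^{0.504}·e < PT⁻²` once `𝓛 ≥ 2` (`2𝓛^{1.1} + 1 ≤ 0.496𝓛⁹`). [cite: Zhang2022LandauSiegel, §7 (7.2)] -/
theorem exp_lt_bigP_div_T_sq {D : ℕ} (hL : 2 ≤ ell D) :
    Real.exp (0.504 * ell D ^ 9 + 1) ≤ bigP D / bigT D ^ 2 := by
  have hL1 : 1 ≤ ell D := by linarith
  have h11 : ell D ^ (1.1 : ℝ) ≤ ell D ^ 2 := by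
    have h := Real.rpow_le_rpow_of_exponent_le hL1 (show (1.1 : ℝ) ≤ 2 by norm_num)
    rwa [show ((2 : ℝ)) = ((2 : ℕ) : ℝ) by norm_num, Real.rpow_natCast] at h
  have h7 : (2 : ℝ) ^ 7 ≤ ell D ^ 7 := pow_le_pow_left₀ (by norm_num) hL 7
  have hkey : 2 * ell D ^ (1.1 : ℝ) + 1 ≤ 0.496 * ell D ^ 9 := by
    have e : ell D ^ 9 = ell D ^ 2 * ell D ^ 7 := by ring
    rw [e]
    nlinarith [sq_nonneg (ell D), mul_le_mul_of_nonneg_left h7 (sq_nonneg (ell D))]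
  have hT : bigT D ^ 2 = Real.exp (2 * ell D ^ (1.1 : ℝ)) := by
    rw [bigT, sq, ← Real.exp_add]; ring_nf
  rw [bigP, hT, ← Real.exp_sub, Real.exp_le_exp]
  linarith

/-- **The `m`-sum of `S_j(𝐚₁₃,𝐚₂₁)` is `𝔳₁ⱼ(y)`** (node §10.u042 vs Lemma 10.1): both truncations
(`m < PT⁻²` in `S_j`, `m < P` in `𝔳₁ⱼ`) lie beyond the support `ym < P^{0.504}` of `f̃` (`y ≥ 1`).
[cite: Zhang2022LandauSiegel, §10 p. 58] -/
theorem mSum13_eq_frakv1 (c' : ℝ) {D : ℕ} (χ : DirichletCharacter ℂ D) (hL : 2 ≤ ell D) (j : ℕ)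
    {y : ℕ} (hy : 1 ≤ y) : mSum13 c' χ j y = frakv1 c' χ j (y : ℝ) := by
  have hL0 : 0 < ell D := by linarith
  have hP : 0 < bigP D := Real.exp_pos _
  have hT1 : 1 ≤ bigT D ^ 2 := one_le_pow₀ (Real.one_le_exp (by positivity))
  have hNle : Nsupp D ≤ ⌈bigP D⌉₊ := by
    unfold Nsupp
    exact Nat.ceil_mono (div_le_self hP.le hT1)
  have hPT := exp_lt_bigP_div_T_sq hL
  have hyR : (1 : ℝ) ≤ y := by exact_mod_cast hy
  have hbig : ∀ m : ℕ, Nsupp D ≤ m → 0.504 < Real.log ((y : ℝ) * m) / Real.log (bigP D) := by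
    intro m hm
    have hm' : bigP D / bigT D ^ 2 ≤ m := le_trans (Nat.le_ceil _) (by exact_mod_cast hm)
    have hm0 : 0 < (m : ℝ) := lt_of_lt_of_le (lt_of_lt_of_le (Real.exp_pos _) hPT) hm'
    have hlogm : 0.504 * ell D ^ 9 + 1 ≤ Real.log m := by
      rw [← Real.log_exp (0.504 * ell D ^ 9 + 1)]
      exact Real.log_le_log (Real.exp_pos _) (hPT.trans hm')
    have hlogym : Real.log m ≤ Real.log ((y : ℝ) * m) := by
      rw [Real.log_mul (by linarith) hm0.ne']
      have : 0 ≤ Real.log y := Real.log_nonneg hyR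
      linarith
    rw [bigP, Real.log_exp, lt_div_iff₀ (by positivity)]
    linarith
  unfold mSum13 frakv1
  calc ∑ m ∈ Ico 1 (Nsupp D), χ (m : ZMod D) *
          (ftilde (Real.log ((y * m : ℕ) : ℝ) / Real.log (bigP D)) : ℂ) / (m : ℂ) ^ (1 - betaJ c' D j)
      = ∑ m ∈ Ico 1 (Nsupp D), χ (m : ZMod D) *
          (ftilde (Real.log ((y : ℝ) * m) / Real.log (bigP D)) : ℂ) / (m : ℂ) ^ (1 - betaJ c' D j) := by
        refine sum_congr rfl fun m _ => ?_
        push_cast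
        rfl
    _ = ∑ m ∈ Ico 1 ⌈bigP D⌉₊, χ (m : ZMod D) *
          (ftilde (Real.log ((y : ℝ) * m) / Real.log (bigP D)) : ℂ) / (m : ℂ) ^ (1 - betaJ c' D j) := by
        refine sum_subset (Ico_subset_Ico_right hNle) fun m hm hnot => ?_
        have hm1 : 1 ≤ m := (mem_Ico.mp hm).1
        have hmN : Nsupp D ≤ m := by
          by_contra h
          exact hnot (mem_Ico.mpr ⟨hm1, not_le.mp h⟩)
        rw [ftilde_eq_zero_of_gt (hbig m hmN)]
        simp

/-- `conj β₆ = −β₆`, `conj β₇ = −β₇` (`β₆, β₇ ∈ iℝ`, (2.22)). [cite: Zhang2022LandauSiegel, §2 (2.22)] -/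
private theorem conj_beta6 (D : ℕ) : conj (beta6 D) = -beta6 D := by
  have e : beta6 D = ((3 / 2 * alpha D : ℝ) : ℂ) * I := by rw [beta6]; push_cast; ring
  rw [e, map_mul, Complex.conj_ofReal, Complex.conj_I]
  ring

/-- `conj β₇ = −β₇`. [cite: Zhang2022LandauSiegel, §2 (2.22)] -/
private theorem conj_beta7 (D : ℕ) : conj (beta7 D) = -beta7 D := by
  have e : beta7 D = ((5 / 2 * alpha D : ℝ) : ℂ) * I := by rw [beta7]; push_cast; ring
  rw [e, map_mul, Complex.conj_ofReal, Complex.conj_I]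
  ring

/-- `conj(tˢ) = t^{conj s}` for real `t ≥ 0`. [folklore] -/
private theorem conj_ofReal_cpow {t : ℝ} (ht : 0 ≤ t) (s : ℂ) :
    conj ((t : ℂ) ^ s) = (t : ℂ) ^ conj s := by
  have harg : (t : ℂ).arg ≠ π := by
    rw [Complex.arg_ofReal_of_nonneg ht]; exact Real.pi_ne_zero.symm
  rw [Complex.cpow_conj _ _ harg, Complex.conj_ofReal]

/-- **`conj ϰ₁(N) = (log(P₁/N)/log P₁)(P₁/N)^{−β₆}`** for `0 < N < P₁` ((8.6), `β₆ ∈ iℝ`).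
[cite: Zhang2022LandauSiegel, §8 (8.6)] -/
theorem conj_vk1_eq (D : ℕ) {N : ℕ} (hN0 : 0 < N) (hN : (N : ℝ) < Skeleton.P1 D) (hP1 : 1 < Skeleton.P1 D) :
    conj (vk1 D N) =
      ((Real.log (Skeleton.P1 D / N) / Real.log (Skeleton.P1 D) : ℝ) : ℂ) * ((Skeleton.P1 D / N : ℝ) : ℂ) ^ (-beta6 D) := by
  have hP0 : 0 < Skeleton.P1 D := by linarith
  have hlogP : Real.log (Skeleton.P1 D) ≠ 0 := (Real.log_pos hP1).ne'
  have hNR : (0 : ℝ) < N := by exact_mod_cast hN0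
  rw [vk1, if_pos hN, map_mul, Complex.conj_ofReal, conj_ofReal_cpow (div_pos hP0 hNR).le,
    conj_beta6]
  congr 2
  rw [Real.log_div hP0.ne' hNR.ne']
  field_simp

/-- **`conj ϰ₂(N) = (log(P₂/N)/log P₂)(P₂/N)^{−β₇}`** for `0 < N < P₂` ((8.6)).
[cite: Zhang2022LandauSiegel, §8 (8.6)] -/
theorem conj_vk2_eq (D : ℕ) {N : ℕ} (hN0 : 0 < N) (hN : (N : ℝ) < Skeleton.P2 D) (hP2 : 1 < Skeleton.P2 D) :
    conj (vk2 D N) =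
      ((Real.log (Skeleton.P2 D / N) / Real.log (Skeleton.P2 D) : ℝ) : ℂ) * ((Skeleton.P2 D / N : ℝ) : ℂ) ^ (-beta7 D) := by
  have hP0 : 0 < Skeleton.P2 D := by linarith
  have hlogP : Real.log (Skeleton.P2 D) ≠ 0 := (Real.log_pos hP2).ne'
  have hNR : (0 : ℝ) < N := by exact_mod_cast hN0
  rw [vk2, if_pos hN, map_mul, Complex.conj_ofReal, conj_ofReal_cpow (div_pos hP0 hNR).le,
    conj_beta7]
  congr 2
  rw [Real.log_div hP0.ne' hNR.ne']
  field_simp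

/-- **The `conj ϰ₁`-part of the `n`-sum of `S_j(𝐚₁₃,𝐚₂₁)` is `(log P₁)⁻¹ ×` the sum of Lemma 8.4
at `x = P₁/(dr)`, `μ = 6`**: `conj ϰ₁(drn) = [n < x]·(x/n)^{−β₆}log(x/n)/log P₁`.
[cite: Zhang2022LandauSiegel, §10 p. 58; §8 Lemma 8.4] -/
theorem conjVk1Sum_eq (c' : ℝ) {D : ℕ} (χ : DirichletCharacter ℂ D) (j : ℕ) {d r : ℕ}
    (hd : 1 ≤ d) (hr : 1 ≤ r) (hP1 : 1 < Skeleton.P1 D) (hN : ⌈Skeleton.P1 D / ((d * r : ℕ) : ℝ)⌉₊ ≤ Nsupp D) :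
    ∑ n ∈ Ico 1 (Nsupp D),
        χ (n : ZMod D) * conj (vk1 D (d * r * n)) * xiZero c' D j n d r / (n : ℂ) =
      (1 / (Real.log (Skeleton.P1 D) : ℂ)) *
        ∑ n ∈ Ico 1 ⌈Skeleton.P1 D / ((d * r : ℕ) : ℝ)⌉₊,
          χ (n : ZMod D) * xiZero c' D j n d r / (n : ℂ) *
            (((Skeleton.P1 D / ((d * r : ℕ) : ℝ)) / n : ℝ) : ℂ) ^ (-betaMu D 6) *
              (Real.log ((Skeleton.P1 D / ((d * r : ℕ) : ℝ)) / n) : ℂ) := by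
  set x : ℝ := Skeleton.P1 D / ((d * r : ℕ) : ℝ) with hx
  have hdr : (0 : ℝ) < ((d * r : ℕ) : ℝ) := by exact_mod_cast Nat.mul_pos hd hr
  have hβ : betaMu D 6 = beta6 D := by simp [betaMu]
  rw [hβ]
  have step1 : ∑ n ∈ Ico 1 (Nsupp D),
        χ (n : ZMod D) * conj (vk1 D (d * r * n)) * xiZero c' D j n d r / (n : ℂ) =
      ∑ n ∈ Ico 1 ⌈x⌉₊,
        χ (n : ZMod D) * conj (vk1 D (d * r * n)) * xiZero c' D j n d r / (n : ℂ) := by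
    symm
    refine sum_subset (Ico_subset_Ico_right hN) fun n hn hnot => ?_
    have hn1 : 1 ≤ n := (mem_Ico.mp hn).1
    have hnx : ⌈x⌉₊ ≤ n := by
      by_contra h
      exact hnot (mem_Ico.mpr ⟨hn1, not_le.mp h⟩)
    have hxn : x ≤ n := le_trans (Nat.le_ceil x) (by exact_mod_cast hnx)
    have hge : Skeleton.P1 D ≤ ((d * r * n : ℕ) : ℝ) := by
      rw [hx, div_le_iff₀ hdr] at hxn
      push_cast at hxn ⊢
      linarith
    rw [vk1, if_neg (not_lt.mpr hge), map_zero]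
    simp
  rw [step1, mul_sum]
  refine sum_congr rfl fun n hn => ?_
  have hn1 : 1 ≤ n := (mem_Ico.mp hn).1
  have hnR : (0 : ℝ) < n := by exact_mod_cast hn1
  have hnx : (n : ℝ) < x := Nat.lt_ceil.mp (mem_Ico.mp hn).2
  have hlt : ((d * r * n : ℕ) : ℝ) < Skeleton.P1 D := by
    rw [hx, lt_div_iff₀ hdr] at hnx
    push_cast at hnx ⊢
    linarith
  have hpos : 0 < d * r * n := Nat.mul_pos (Nat.mul_pos hd hr) hn1
  rw [conj_vk1_eq D hpos hlt hP1]
  have e : Skeleton.P1 D / ((d * r * n : ℕ) : ℝ) = x / n := by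
    rw [hx]; push_cast; rw [div_div]
  rw [e]
  push_cast
  ring

/-- **The `conj ϰ₂`-part of the `n`-sum of `S_j(𝐚₁₃,𝐚₂₁)` is `(log P₂)⁻¹ ×` the sum of Lemma 8.4
at `x = P₂/(dr)`, `μ = 7`.** [cite: Zhang2022LandauSiegel, §10 p. 58; §8 Lemma 8.4] -/
theorem conjVk2Sum_eq (c' : ℝ) {D : ℕ} (χ : DirichletCharacter ℂ D) (j : ℕ) {d r : ℕ}
    (hd : 1 ≤ d) (hr : 1 ≤ r) (hP2 : 1 < Skeleton.P2 D) (hN : ⌈Skeleton.P2 D / ((d * r : ℕ) : ℝ)⌉₊ ≤ Nsupp D) :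
    ∑ n ∈ Ico 1 (Nsupp D),
        χ (n : ZMod D) * conj (vk2 D (d * r * n)) * xiZero c' D j n d r / (n : ℂ) =
      (1 / (Real.log (Skeleton.P2 D) : ℂ)) *
        ∑ n ∈ Ico 1 ⌈Skeleton.P2 D / ((d * r : ℕ) : ℝ)⌉₊,
          χ (n : ZMod D) * xiZero c' D j n d r / (n : ℂ) *
            (((Skeleton.P2 D / ((d * r : ℕ) : ℝ)) / n : ℝ) : ℂ) ^ (-betaMu D 7) *
              (Real.log ((Skeleton.P2 D / ((d * r : ℕ) : ℝ)) / n) : ℂ) := by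
  set x : ℝ := Skeleton.P2 D / ((d * r : ℕ) : ℝ) with hx
  have hdr : (0 : ℝ) < ((d * r : ℕ) : ℝ) := by exact_mod_cast Nat.mul_pos hd hr
  have hβ : betaMu D 7 = beta7 D := by simp [betaMu]
  rw [hβ]
  have step1 : ∑ n ∈ Ico 1 (Nsupp D),
        χ (n : ZMod D) * conj (vk2 D (d * r * n)) * xiZero c' D j n d r / (n : ℂ) =
      ∑ n ∈ Ico 1 ⌈x⌉₊,
        χ (n : ZMod D) * conj (vk2 D (d * r * n)) * xiZero c' D j n d r / (n : ℂ) := by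
    symm
    refine sum_subset (Ico_subset_Ico_right hN) fun n hn hnot => ?_
    have hn1 : 1 ≤ n := (mem_Ico.mp hn).1
    have hnx : ⌈x⌉₊ ≤ n := by
      by_contra h
      exact hnot (mem_Ico.mpr ⟨hn1, not_le.mp h⟩)
    have hxn : x ≤ n := le_trans (Nat.le_ceil x) (by exact_mod_cast hnx)
    have hge : Skeleton.P2 D ≤ ((d * r * n : ℕ) : ℝ) := by
      rw [hx, div_le_iff₀ hdr] at hxn
      push_cast at hxn ⊢
      linarith
    rw [vk2, if_neg (not_lt.mpr hge), map_zero]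
    simp
  rw [step1, mul_sum]
  refine sum_congr rfl fun n hn => ?_
  have hn1 : 1 ≤ n := (mem_Ico.mp hn).1
  have hnR : (0 : ℝ) < n := by exact_mod_cast hn1
  have hnx : (n : ℝ) < x := Nat.lt_ceil.mp (mem_Ico.mp hn).2
  have hlt : ((d * r * n : ℕ) : ℝ) < Skeleton.P2 D := by
    rw [hx, lt_div_iff₀ hdr] at hnx
    push_cast at hnx ⊢
    linarith
  have hpos : 0 < d * r * n := Nat.mul_pos (Nat.mul_pos hd hr) hn1
  rw [conj_vk2_eq D hpos hlt hP2]
  have e : Skeleton.P2 D / ((d * r * n : ℕ) : ℝ) = x / n := by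
    rw [hx]; push_cast; rw [div_div]
  rw [e]
  push_cast
  ring

/-- The `n`-sum of `S_j(𝐚₁₃,𝐚₂₁)` split into its `conj ϰ₁` and `conj ι₂ · conj ϰ₂` parts.
[cite: Zhang2022LandauSiegel, §10 p. 58] -/
theorem nSum21_eq (c' : ℝ) {D : ℕ} (χ : DirichletCharacter ℂ D) (j d r : ℕ) :
    nSum21 c' χ j d r =
      (∑ n ∈ Ico 1 (Nsupp D),
          χ (n : ZMod D) * conj (vk1 D (d * r * n)) * xiZero c' D j n d r / (n : ℂ)) +
        conj iota2 * ∑ n ∈ Ico 1 (Nsupp D),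
          χ (n : ZMod D) * conj (vk2 D (d * r * n)) * xiZero c' D j n d r / (n : ℂ) := by
  unfold nSum21
  rw [mul_sum, ← sum_add_distrib]
  refine sum_congr rfl fun n _ => ?_
  ring

/-- `‖ι₂‖ ≤ 2` (`ι₂ = 0.94977 − 1.38995i`, (8.4)). [cite: Zhang2022LandauSiegel, §8 (8.4)] -/
private theorem norm_iota2_le : ‖iota2‖ ≤ 2 := by
  have h : ‖iota2‖ ^ 2 ≤ 4 := by
    rw [Complex.sq_norm, Complex.normSq_apply, iota2]
    simp
    norm_num
  nlinarith [norm_nonneg iota2]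


/-! ## Part C. Sizes of the parameters (`𝓛 = log D ≥ 3`) -/

section Facts

variable {D : ℕ}

/-- `𝓛 = log D ≥ 0`. [cite: Zhang2022LandauSiegel, §2 (2.6)–(2.13)] -/
private theorem ell_nonneg : 0 ≤ ell D := Real.log_natCast_nonneg D

/-- `𝓛^{1.1} ≤ 𝓛²` for `𝓛 ≥ 1`. [cite: Zhang2022LandauSiegel, §2 (2.6)–(2.13)] -/
theorem rpow11_le_sq (hL : 1 ≤ ell D) : ell D ^ (1.1 : ℝ) ≤ ell D ^ 2 := by
  have h := Real.rpow_le_rpow_of_exponent_le hL (show (1.1 : ℝ) ≤ 2 by norm_num)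
  rwa [show ((2 : ℝ)) = ((2 : ℕ) : ℝ) by norm_num, Real.rpow_natCast] at h

/-- `𝓛 ≤ 𝓛^{1.1}` for `𝓛 ≥ 1`. [cite: Zhang2022LandauSiegel, §2 (2.6)–(2.13)] -/
theorem self_le_rpow11 (hL : 1 ≤ ell D) : ell D ≤ ell D ^ (1.1 : ℝ) := by
  have h := Real.rpow_le_rpow_of_exponent_le hL (show (1 : ℝ) ≤ 1.1 by norm_num)
  rwa [Real.rpow_one] at h

/-- `0 ≤ 𝓛^{1.1}`. [cite: Zhang2022LandauSiegel, §2 (2.6)–(2.13)] -/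
theorem rpow11_nonneg : 0 ≤ ell D ^ (1.1 : ℝ) := Real.rpow_nonneg ell_nonneg _

/-- `log P = 𝓛⁹`. [cite: Zhang2022LandauSiegel, §2 (2.6)–(2.13)] -/
private theorem log_bigP : Real.log (bigP D) = ell D ^ 9 := by rw [bigP, Real.log_exp]

/-- `log T = 𝓛^{1.1}`. [cite: Zhang2022LandauSiegel, §2 (2.6)–(2.13)] -/
theorem log_bigT : Real.log (bigT D) = ell D ^ (1.1 : ℝ) := by rw [bigT, Real.log_exp]

/-- `T ≥ 1`. [cite: Zhang2022LandauSiegel, §2 (2.6)–(2.13)] -/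
theorem one_le_bigT : 1 ≤ bigT D := Real.one_le_exp rpow11_nonneg

/-- `P^{1/2} = exp(𝓛⁹/2)`. [cite: Zhang2022LandauSiegel, §2 (2.6)–(2.13)] -/
theorem sqrtP_eq : bigP D ^ (0.5 : ℝ) = Real.exp (0.5 * ell D ^ 9) := by
  rw [bigP, ← Real.exp_mul]; ring_nf

/-- `P₁ = exp(0.504𝓛⁹)`. [cite: Zhang2022LandauSiegel, §2 (2.6)–(2.13)] -/
theorem P1_eq : Skeleton.P1 D = Real.exp (0.504 * ell D ^ 9) := by
  rw [Skeleton.P1, bigP, ← Real.exp_mul]; ring_nf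

/-- `log P₁ = 0.504𝓛⁹`. [cite: Zhang2022LandauSiegel, §2 (2.6)–(2.13)] -/
theorem log_P1 : Real.log (Skeleton.P1 D) = 0.504 * ell D ^ 9 := by rw [P1_eq, Real.log_exp]

/-- `P₂ = exp(𝓛⁹/2 − 10𝓛^{1.1})`. [cite: Zhang2022LandauSiegel, §2 (2.6)–(2.13)] -/
theorem P2_eq : Skeleton.P2 D = Real.exp (0.5 * ell D ^ 9 - 10 * ell D ^ (1.1 : ℝ)) := by
  have hT : bigT D ^ 10 = Real.exp (10 * ell D ^ (1.1 : ℝ)) := by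
    rw [bigT, ← Real.exp_nat_mul]; norm_num
  rw [Skeleton.P2, sqrtP_eq, hT, ← Real.exp_sub]

/-- `log P₂ = 𝓛⁹/2 − 10𝓛^{1.1}`. [cite: Zhang2022LandauSiegel, §2 (2.6)–(2.13)] -/
private theorem log_P2 : Real.log (Skeleton.P2 D) = 0.5 * ell D ^ 9 - 10 * ell D ^ (1.1 : ℝ) := by
  rw [P2_eq, Real.log_exp]

/-- `log P₂ ≥ 𝓛⁹/4` for `𝓛 ≥ 2`. [cite: Zhang2022LandauSiegel, §2 (2.6)–(2.13)] -/
theorem log_P2_ge (hL : 2 ≤ ell D) : 0.25 * ell D ^ 9 ≤ Real.log (Skeleton.P2 D) := by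
  rw [log_P2]
  have h11 := rpow11_le_sq (D := D) (by linarith)
  have h7 : (2 : ℝ) ^ 7 ≤ ell D ^ 7 := pow_le_pow_left₀ (by norm_num) hL 7
  have e : ell D ^ 9 = ell D ^ 2 * ell D ^ 7 := by ring
  nlinarith [sq_nonneg (ell D), mul_le_mul_of_nonneg_left h7 (sq_nonneg (ell D))]

/-- `P₁ > 1`. [cite: Zhang2022LandauSiegel, §2 (2.6)–(2.13)] -/
theorem one_lt_P1 (hL : 0 < ell D) : 1 < Skeleton.P1 D := by
  rw [P1_eq]; exact Real.one_lt_exp_iff.mpr (by positivity)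

/-- `P₂ > 1` for `𝓛 ≥ 2`. [cite: Zhang2022LandauSiegel, §2 (2.6)–(2.13)] -/
theorem one_lt_P2 (hL : 2 ≤ ell D) : 1 < Skeleton.P2 D := by
  have h := log_P2_ge hL
  have h9 : 0 < ell D ^ 9 := by positivity
  rw [P2_eq]
  rw [log_P2] at h
  exact Real.one_lt_exp_iff.mpr (by linarith)

/-- `P₁ < P`. [cite: Zhang2022LandauSiegel, §2 (2.6)–(2.13)] -/
theorem P1_lt_bigP (hL : 0 < ell D) : Skeleton.P1 D < bigP D := by
  rw [P1_eq, bigP, Real.exp_lt_exp]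
  have h9 : 0 < ell D ^ 9 := by positivity
  linarith

/-- `P₁ ≤ PT⁻²` for `𝓛 ≥ 2`. [cite: Zhang2022LandauSiegel, §2 (2.6)–(2.13)] -/
theorem P1_le_PT2 (hL : 2 ≤ ell D) : Skeleton.P1 D ≤ bigP D / bigT D ^ 2 :=
  le_trans (by rw [P1_eq, Real.exp_le_exp]; linarith) (exp_lt_bigP_div_T_sq hL)

/-- `P^{1/2} ≤ P₁`. [cite: Zhang2022LandauSiegel, §2 (2.6)–(2.13)] -/
theorem sqrtP_le_P1 : bigP D ^ (0.5 : ℝ) ≤ Skeleton.P1 D := by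
  rw [sqrtP_eq, P1_eq, Real.exp_le_exp]
  have h9 : 0 ≤ ell D ^ 9 := pow_nonneg ell_nonneg 9
  nlinarith

/-- `0 ≤ P^{1/2}`. [cite: Zhang2022LandauSiegel, §2 (2.6)–(2.13)] -/
theorem sqrtP_nonneg : 0 ≤ bigP D ^ (0.5 : ℝ) := Real.rpow_nonneg (Real.exp_pos _).le _

/-- `P₂ ≤ P^{1/2}/T`. [cite: Zhang2022LandauSiegel, §2 (2.6)–(2.13)] -/
theorem P2_le_sqrtP_div_T : Skeleton.P2 D ≤ bigP D ^ (0.5 : ℝ) / bigT D := by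
  rw [Skeleton.P2]
  have hT := one_le_bigT (D := D)
  exact div_le_div_of_nonneg_left sqrtP_nonneg (by linarith) (le_self_pow₀ hT (by norm_num))

/-- `P₂ ≤ P₁`. [cite: Zhang2022LandauSiegel, §2 (2.6)–(2.13)] -/
theorem P2_le_P1 : Skeleton.P2 D ≤ Skeleton.P1 D :=
  (P2_le_sqrtP_div_T.trans (div_le_self sqrtP_nonneg one_le_bigT)).trans sqrtP_le_P1

/-- `T ≤ P^{0.004}` for `𝓛 ≥ 3`. [cite: Zhang2022LandauSiegel, §2 (2.6)–(2.13)] -/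
theorem bigT_le_exp004 (hL : 3 ≤ ell D) : bigT D ≤ Real.exp (0.004 * ell D ^ 9) := by
  rw [bigT, Real.exp_le_exp]
  have h11 := rpow11_le_sq (D := D) (by linarith)
  have h7 : (3 : ℝ) ^ 7 ≤ ell D ^ 7 := pow_le_pow_left₀ (by norm_num) hL 7
  have e : ell D ^ 9 = ell D ^ 2 * ell D ^ 7 := by ring
  nlinarith [sq_nonneg (ell D), mul_le_mul_of_nonneg_left h7 (sq_nonneg (ell D))]

/-- `T < P₁/y` for `y < P^{1/2}` (`𝓛 ≥ 3`): `P₁/P^{1/2} = P^{0.004} ≥ T`. [cite: Zhang2022LandauSiegel, §2 (2.6)–(2.13)] -/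
theorem bigT_lt_P1_div (hL : 3 ≤ ell D) {y : ℝ} (hy0 : 0 < y) (hy : y < bigP D ^ (0.5 : ℝ)) :
    bigT D < Skeleton.P1 D / y := by
  rw [lt_div_iff₀ hy0]
  have hT0 : 0 < bigT D := Real.exp_pos _
  calc bigT D * y < bigT D * bigP D ^ (0.5 : ℝ) := mul_lt_mul_of_pos_left hy hT0
    _ ≤ Real.exp (0.004 * ell D ^ 9) * Real.exp (0.5 * ell D ^ 9) :=
        mul_le_mul (bigT_le_exp004 hL) (le_of_eq sqrtP_eq) sqrtP_nonneg (by positivity)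
    _ = Skeleton.P1 D := by rw [← Real.exp_add, P1_eq]; ring_nf

/-- `|log y| ≤ 𝓛⁹` for `1 ≤ y ≤ P`. [folklore] -/
private theorem abs_log_le_of {y : ℝ} (hy1 : 1 ≤ y) (hyP : y ≤ bigP D) : |Real.log y| ≤ ell D ^ 9 := by
  rw [abs_of_nonneg (Real.log_nonneg hy1), ← log_bigP]
  exact Real.log_le_log (by linarith) hyP

/-- `D ≥ ⌈e^M⌉₊ ⇒ 𝓛 ≥ M`. [folklore] -/
private theorem le_ell_of_ceil_exp_le {M : ℝ} (hD : ⌈Real.exp M⌉₊ ≤ D) : M ≤ ell D := by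
  have h1 : Real.exp M ≤ D := le_trans (Nat.le_ceil _) (by exact_mod_cast hD)
  rw [ell, ← Real.log_exp M]
  exact Real.log_le_log (Real.exp_pos M) h1

/-- `e^{−cL}L¹⁸ ≤ 19!/(c¹⁹L)` for `c, L > 0` (from `x¹⁹/19! ≤ eˣ`). [folklore] -/
private theorem exp_neg_mul_pow_le {c L : ℝ} (hc : 0 < c) (hL : 0 < L) :
    Real.exp (-(c * L)) * L ^ 18 ≤ (Nat.factorial 19 : ℝ) / (c ^ 19 * L) := by
  have h := Real.pow_div_factorial_le_exp (c * L) (by positivity) 19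
  have hf : (0 : ℝ) < Nat.factorial 19 := by positivity
  have hcL : 0 < c * L := mul_pos hc hL
  rw [div_le_iff₀ hf] at h
  rw [Real.exp_neg, le_div_iff₀ (by positivity)]
  have hexp : 0 < Real.exp (c * L) := Real.exp_pos _
  -- `e^{-cL} L^18 (c^19 L) = (cL)^19 e^{-cL} / c^0 ...`
  have e : (Real.exp (c * L))⁻¹ * L ^ 18 * (c ^ 19 * L) = (c * L) ^ 19 * (Real.exp (c * L))⁻¹ := by
    ring
  rw [e]
  calc (c * L) ^ 19 * (Real.exp (c * L))⁻¹ ≤ (Real.exp (c * L) * Nat.factorial 19) * (Real.exp (c * L))⁻¹ :=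
        mul_le_mul_of_nonneg_right h (by positivity)
    _ = Nat.factorial 19 := by field_simp

end Facts

/-! ## Part D. The `n`-sum of `S_j(𝐚₁₃,𝐚₂₁)`: Lemma 8.4 above `T`, the `ξ₀`-tail mean below `T` -/

section NSum

variable (c' : ℝ) {D : ℕ} [NeZero D] (χ : DirichletCharacter ℂ D)

/-- `(β_μ).re = 0`. [cite: Zhang2022LandauSiegel, §2 (2.22)] -/
private theorem betaMu_re_eq_zero (D μ : ℕ) : (betaMu D μ).re = 0 := by
  unfold betaMu beta6 beta7
  split_ifs <;> simp

omit [NeZero D] in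
/-- The crude bound for the Lemma 8.4 sum at `1 ≤ x`: each term has norm `≤ log x · |ξ₀ⱼ(n;d,r)|/n`.
[cite: Zhang2022LandauSiegel, §8 Lemma 8.4] -/
theorem norm_sum84_le_log_mul (j μ d r : ℕ) {x : ℝ} (hx : 1 ≤ x) :
    ‖∑ n ∈ Ico 1 ⌈x⌉₊, χ (n : ZMod D) * xiZero c' D j n d r / (n : ℂ) *
        ((x / n : ℝ) : ℂ) ^ (-betaMu D μ) * (Real.log (x / n) : ℂ)‖ ≤
      Real.log x * ∑ n ∈ Ico 1 ⌈x⌉₊, ‖xiZero c' D j n d r‖ / n := by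
  rw [mul_sum]
  refine (norm_sum_le _ _).trans (sum_le_sum fun n hn => ?_)
  have hn1 : 1 ≤ n := (mem_Ico.mp hn).1
  have hnR : (1 : ℝ) ≤ n := by exact_mod_cast hn1
  have hnx : (n : ℝ) < x := Nat.lt_ceil.mp (mem_Ico.mp hn).2
  have ht0 : 0 < x / n := by positivity
  have ht : 1 ≤ x / n := by rw [le_div_iff₀ (by linarith)]; linarith
  have hlog0 : 0 ≤ Real.log (x / n) := Real.log_nonneg ht
  have hlogle : Real.log (x / n) ≤ Real.log x :=
    Real.log_le_log ht0 (div_le_self (by linarith) hnR)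
  have hβ : (-betaMu D μ).re = 0 := by rw [Complex.neg_re, betaMu_re_eq_zero, neg_zero]
  rw [norm_mul, norm_mul, norm_div, norm_mul, Complex.norm_natCast,
    Complex.norm_cpow_eq_rpow_re_of_pos ht0, hβ, Real.rpow_zero, mul_one, Complex.norm_real,
    Real.norm_of_nonneg hlog0]
  calc ‖χ (n : ZMod D)‖ * ‖xiZero c' D j n d r‖ / n * Real.log (x / n)
      ≤ 1 * ‖xiZero c' D j n d r‖ / n * Real.log x := by
        gcongr
        exact χ.norm_le_one _
    _ = Real.log x * (‖xiZero c' D j n d r‖ / n) := by ring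

/-- From `‖Σ − L′Π𝔤‖ ≤ E` and `‖𝔤‖ ≤ K`: `‖Σ‖ ≤ (‖L′‖K + E)(1 + ‖Π‖)` (`E ≥ 0`, `K ≥ 0`).
[cite: Zhang2022LandauSiegel, §8 Lemma 8.4] -/
private theorem norm_le_of_lemma84 {S Lp Pi g : ℂ} {E K : ℝ} (hE : 0 ≤ E) (hK : 0 ≤ K)
    (h : ‖S - Lp * Pi * g‖ ≤ E) (hg : ‖g‖ ≤ K) : ‖S‖ ≤ (‖Lp‖ * K + E) * (1 + ‖Pi‖) := by
  have h1 : ‖S‖ ≤ ‖Lp‖ * ‖Pi‖ * K + E := by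
    calc ‖S‖ = ‖(S - Lp * Pi * g) + Lp * Pi * g‖ := by rw [sub_add_cancel]
      _ ≤ ‖S - Lp * Pi * g‖ + ‖Lp * Pi * g‖ := norm_add_le _ _
      _ ≤ E + ‖Lp‖ * ‖Pi‖ * K := by
          rw [norm_mul, norm_mul]
          gcongr
      _ = ‖Lp‖ * ‖Pi‖ * K + E := by ring
  have hLp := norm_nonneg Lp
  have hPi := norm_nonneg Pi
  nlinarith [mul_nonneg hLp hK, mul_nonneg (mul_nonneg hLp hK) hPi]

/-- **The `conj ϰ₁`-part**: for `1 ≤ d, r`, `dr < P^{1/2}` (so `T < x = P₁/(dr) < P`), Lemma 8.4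
(`μ = 6`) gives `‖Σ_n χ(n)conj ϰ₁(drn)ξ₀ⱼ(n;d,r)/n‖ ≤ (log P₁)⁻¹(|L′(1,χ)|K_g + C₄𝓛⁻⁶... ≤ C₄)(1 + |Π(d,r)|)`.
[cite: Zhang2022LandauSiegel, §10 p. 58; §8 Lemma 8.4] -/
theorem norm_S1_le (hL : 3 ≤ ell D) {j : ℕ} {C₄ Kg : ℝ} (hC₄ : 0 ≤ C₄) (hKg : 0 ≤ Kg)
    (h84 : ∀ μ ∈ ({6, 7} : Finset ℕ), ∀ d r : ℕ, 1 ≤ d → 1 ≤ r →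
      ((d * r : ℕ) : ℝ) < bigP D / bigT D ^ 2 → ∀ y : ℝ, bigT D < y → y < bigP D →
        ‖(∑ n ∈ Ico 1 ⌈y⌉₊, χ (n : ZMod D) * xiZero c' D j n d r / (n : ℂ) *
              ((y / n : ℝ) : ℂ) ^ (-betaMu D μ) * (Real.log (y / n) : ℂ)) -
            deriv χ.LFunction 1 * PiW χ d r * frakgW c' D j μ y‖ ≤ C₄ * (ell D ^ 6)⁻¹)
    (hg : ∀ (μ : ℕ) (y : ℝ), |Real.log y| ≤ ell D ^ 9 → ‖frakgW c' D j μ y‖ ≤ Kg)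
    {d r : ℕ} (hd : 1 ≤ d) (hr : 1 ≤ r) (hdr : ((d * r : ℕ) : ℝ) < bigP D ^ (0.5 : ℝ)) :
    ‖∑ n ∈ Ico 1 (Nsupp D),
        χ (n : ZMod D) * conj (vk1 D (d * r * n)) * xiZero c' D j n d r / (n : ℂ)‖ ≤
      1 / Real.log (Skeleton.P1 D) * ((‖deriv χ.LFunction 1‖ * Kg + C₄) * (1 + ‖PiW χ d r‖)) := by
  have hL0 : 0 < ell D := by linarith
  have hL1 : 1 ≤ ell D := by linarith
  have hL2 : 2 ≤ ell D := by linarith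
  have hP1 : 1 < Skeleton.P1 D := one_lt_P1 hL0
  have hlogP1 : 0 < Real.log (Skeleton.P1 D) := Real.log_pos hP1
  have hdr0 : (0 : ℝ) < ((d * r : ℕ) : ℝ) := by exact_mod_cast Nat.mul_pos hd hr
  have hdr1 : (1 : ℝ) ≤ ((d * r : ℕ) : ℝ) := by exact_mod_cast Nat.mul_pos hd hr
  set x : ℝ := Skeleton.P1 D / ((d * r : ℕ) : ℝ) with hx
  have hxle : x ≤ Skeleton.P1 D := div_le_self (by linarith) hdr1
  have hN : ⌈x⌉₊ ≤ Nsupp D := by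
    unfold Nsupp
    exact Nat.ceil_mono (hxle.trans (P1_le_PT2 hL2))
  have hdrPT : ((d * r : ℕ) : ℝ) < bigP D / bigT D ^ 2 :=
    lt_of_lt_of_le hdr (sqrtP_le_P1.trans (P1_le_PT2 hL2))
  have hTx : bigT D < x := bigT_lt_P1_div hL hdr0 hdr
  have hxP : x < bigP D := lt_of_le_of_lt hxle (P1_lt_bigP hL0)
  have hx1 : 1 ≤ x := le_trans one_le_bigT hTx.le
  have h := h84 6 (by simp) d r hd hr hdrPT x hTx hxP
  have hgx : ‖frakgW c' D j 6 x‖ ≤ Kg := hg 6 x (abs_log_le_of hx1 hxP.le)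
  have hE : 0 ≤ C₄ * (ell D ^ 6)⁻¹ := by positivity
  have hS := norm_le_of_lemma84 hE hKg h hgx
  rw [conjVk1Sum_eq c' χ j hd hr hP1 hN, norm_mul, norm_div, norm_one, Complex.norm_real,
    Real.norm_of_nonneg hlogP1.le]
  refine mul_le_mul_of_nonneg_left (hS.trans ?_) (by positivity)
  have hPi := norm_nonneg (PiW χ d r)
  have h6 : (ell D ^ 6)⁻¹ ≤ 1 := inv_le_one_of_one_le₀ (one_le_pow₀ hL1)
  have : C₄ * (ell D ^ 6)⁻¹ ≤ C₄ := by nlinarith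
  gcongr

/-- **The `conj ϰ₂`-part**, all `dr < P^{1/2}`: with `x = P₂/(dr)`, either `x ≤ 1` (empty sum),
or `T < x` (Lemma 8.4, `μ = 7`), or `1 < x ≤ T` (the crude bound and the `ξ₀`-tail mean).
[cite: Zhang2022LandauSiegel, §10 p. 58; §8 Lemma 8.4] -/
theorem norm_S2_le (hL : 3 ≤ ell D) {j : ℕ} {C₄ Cξ Kg : ℝ} (hC₄ : 0 ≤ C₄) (hCξ : 0 ≤ Cξ)
    (hKg : 0 ≤ Kg)
    (h84 : ∀ μ ∈ ({6, 7} : Finset ℕ), ∀ d r : ℕ, 1 ≤ d → 1 ≤ r →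
      ((d * r : ℕ) : ℝ) < bigP D / bigT D ^ 2 → ∀ y : ℝ, bigT D < y → y < bigP D →
        ‖(∑ n ∈ Ico 1 ⌈y⌉₊, χ (n : ZMod D) * xiZero c' D j n d r / (n : ℂ) *
              ((y / n : ℝ) : ℂ) ^ (-betaMu D μ) * (Real.log (y / n) : ℂ)) -
            deriv χ.LFunction 1 * PiW χ d r * frakgW c' D j μ y‖ ≤ C₄ * (ell D ^ 6)⁻¹)
    (hξ : ∀ d r : ℕ, 1 ≤ d → 1 ≤ r → ((d * r : ℕ) : ℝ) < Skeleton.P1 D → ∀ x : ℝ, 1 ≤ x →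
      x ≤ bigT D → ∑ n ∈ Ico 1 ⌈x⌉₊, ‖xiZero c' D j n d r‖ / n ≤
        Cξ * ell D * (1 + Real.log x) ^ 3)
    (hg : ∀ (μ : ℕ) (y : ℝ), |Real.log y| ≤ ell D ^ 9 → ‖frakgW c' D j μ y‖ ≤ Kg)
    {d r : ℕ} (hd : 1 ≤ d) (hr : 1 ≤ r) (hdr : ((d * r : ℕ) : ℝ) < bigP D ^ (0.5 : ℝ)) :
    ‖∑ n ∈ Ico 1 (Nsupp D),
        χ (n : ZMod D) * conj (vk2 D (d * r * n)) * xiZero c' D j n d r / (n : ℂ)‖ ≤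
      1 / Real.log (Skeleton.P2 D) *
        ((‖deriv χ.LFunction 1‖ * Kg + C₄ + Cξ * ell D * (1 + Real.log (bigT D)) ^ 4) *
          (1 + ‖PiW χ d r‖)) := by
  have hL0 : 0 < ell D := by linarith
  have hL1 : 1 ≤ ell D := by linarith
  have hL2 : 2 ≤ ell D := by linarith
  have hP2 : 1 < Skeleton.P2 D := one_lt_P2 hL2
  have hlogP2 : 0 < Real.log (Skeleton.P2 D) := Real.log_pos hP2
  have hdr0 : (0 : ℝ) < ((d * r : ℕ) : ℝ) := by exact_mod_cast Nat.mul_pos hd hr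
  have hdr1 : (1 : ℝ) ≤ ((d * r : ℕ) : ℝ) := by exact_mod_cast Nat.mul_pos hd hr
  set x : ℝ := Skeleton.P2 D / ((d * r : ℕ) : ℝ) with hx
  have hxle : x ≤ Skeleton.P2 D := div_le_self (by linarith) hdr1
  have hN : ⌈x⌉₊ ≤ Nsupp D := by
    unfold Nsupp
    exact Nat.ceil_mono (hxle.trans (P2_le_P1.trans (P1_le_PT2 hL2)))
  have hdrPT : ((d * r : ℕ) : ℝ) < bigP D / bigT D ^ 2 :=
    lt_of_lt_of_le hdr (sqrtP_le_P1.trans (P1_le_PT2 hL2))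
  have hdrP1 : ((d * r : ℕ) : ℝ) < Skeleton.P1 D := lt_of_lt_of_le hdr sqrtP_le_P1
  have hxP : x < bigP D := lt_of_le_of_lt hxle (lt_of_le_of_lt P2_le_P1 (P1_lt_bigP hL0))
  have hPi := norm_nonneg (PiW χ d r)
  have hLp := norm_nonneg (deriv χ.LFunction 1)
  have hlogT : 0 ≤ Real.log (bigT D) := Real.log_nonneg one_le_bigT
  have hQ0 : 0 ≤ ‖deriv χ.LFunction 1‖ * Kg + C₄ := by positivity
  have hX0 : 0 ≤ Cξ * ell D * (1 + Real.log (bigT D)) ^ 4 := by positivity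
  rw [conjVk2Sum_eq c' χ j hd hr hP2 hN, norm_mul, norm_div, norm_one, Complex.norm_real,
    Real.norm_of_nonneg hlogP2.le]
  refine mul_le_mul_of_nonneg_left ?_ (by positivity)
  -- the three cases
  rcases le_or_gt x 1 with hx1 | hx1
  · have hc : ⌈x⌉₊ ≤ 1 := Nat.ceil_le.mpr (by simpa using hx1)
    rw [Finset.Ico_eq_empty_of_le hc, sum_empty, norm_zero]
    positivity
  rcases lt_or_ge (bigT D) x with hTx | hxT
  · have h := h84 7 (by simp) d r hd hr hdrPT x hTx hxP
    have hgx : ‖frakgW c' D j 7 x‖ ≤ Kg := hg 7 x (abs_log_le_of hx1.le hxP.le)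
    have hE : 0 ≤ C₄ * (ell D ^ 6)⁻¹ := by positivity
    have hS := norm_le_of_lemma84 hE hKg h hgx
    refine hS.trans ?_
    have h6 : (ell D ^ 6)⁻¹ ≤ 1 := inv_le_one_of_one_le₀ (one_le_pow₀ hL1)
    have : C₄ * (ell D ^ 6)⁻¹ ≤ C₄ := by nlinarith
    have : ‖deriv χ.LFunction 1‖ * Kg + C₄ * (ell D ^ 6)⁻¹ ≤
        ‖deriv χ.LFunction 1‖ * Kg + C₄ + Cξ * ell D * (1 + Real.log (bigT D)) ^ 4 := by linarith
    gcongr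
  · have hξx := hξ d r hd hr hdrP1 x hx1.le hxT
    have hcr := norm_sum84_le_log_mul c' χ j 7 d r hx1.le
    have hlogx : Real.log x ≤ Real.log (bigT D) := Real.log_le_log (by linarith) hxT
    have hlogx0 : 0 ≤ Real.log x := Real.log_nonneg hx1.le
    calc _ ≤ Real.log x * ∑ n ∈ Ico 1 ⌈x⌉₊, ‖xiZero c' D j n d r‖ / n := hcr
      _ ≤ Real.log (bigT D) * (Cξ * ell D * (1 + Real.log x) ^ 3) :=
          mul_le_mul hlogx hξx (sum_nonneg fun n _ => by positivity) hlogT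
      _ ≤ (1 + Real.log (bigT D)) * (Cξ * ell D * (1 + Real.log (bigT D)) ^ 3) := by
          gcongr
          · linarith
      _ = Cξ * ell D * (1 + Real.log (bigT D)) ^ 4 := by ring
      _ ≤ (‖deriv χ.LFunction 1‖ * Kg + C₄ + Cξ * ell D * (1 + Real.log (bigT D)) ^ 4) * 1 := by
          linarith
      _ ≤ (‖deriv χ.LFunction 1‖ * Kg + C₄ + Cξ * ell D * (1 + Real.log (bigT D)) ^ 4) *
            (1 + ‖PiW χ d r‖) :=
          mul_le_mul_of_nonneg_left (by linarith) (by positivity)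

omit [NeZero D] in
/-- On the window `P^{1/2}/T < dr`, the `conj ϰ₂`-part VANISHES (`drn ≥ dr > P^{1/2}/T ≥ P₂`).
[cite: Zhang2022LandauSiegel, §8 (8.6)] -/
theorem S2_eq_zero (j : ℕ) {d r : ℕ} (hdr : bigP D ^ (0.5 : ℝ) / bigT D < ((d * r : ℕ) : ℝ)) :
    ∑ n ∈ Ico 1 (Nsupp D),
        χ (n : ZMod D) * conj (vk2 D (d * r * n)) * xiZero c' D j n d r / (n : ℂ) = 0 := by
  refine sum_eq_zero fun n hn => ?_
  have hn1 : (1 : ℝ) ≤ n := by exact_mod_cast (mem_Ico.mp hn).1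
  have hdr0 : 0 ≤ ((d * r : ℕ) : ℝ) := by positivity
  have hge : ¬ (((d * r * n : ℕ) : ℝ) < Skeleton.P2 D) := by
    rw [not_lt]
    calc Skeleton.P2 D ≤ bigP D ^ (0.5 : ℝ) / bigT D := P2_le_sqrtP_div_T
      _ ≤ ((d * r : ℕ) : ℝ) := hdr.le
      _ ≤ ((d * r : ℕ) : ℝ) * n := le_mul_of_one_le_right hdr0 hn1
      _ = ((d * r * n : ℕ) : ℝ) := by push_cast; ring
  rw [vk2, if_neg hge, map_zero]
  simp

/-- **The `n`-sum, low zone** (`1 ≤ dr < P^{1/2}`):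
`‖nSum21‖ ≤ ((log P₁)⁻¹ + 2(log P₂)⁻¹)(|L′|K_g + C₄ + C_ξ𝓛(1 + log T)⁴)(1 + |Π(d,r)|)`.
[cite: Zhang2022LandauSiegel, §10 p. 58] -/
theorem norm_nSum21_le (hL : 3 ≤ ell D) {j : ℕ} {C₄ Cξ Kg : ℝ} (hC₄ : 0 ≤ C₄) (hCξ : 0 ≤ Cξ)
    (hKg : 0 ≤ Kg)
    (h84 : ∀ μ ∈ ({6, 7} : Finset ℕ), ∀ d r : ℕ, 1 ≤ d → 1 ≤ r →
      ((d * r : ℕ) : ℝ) < bigP D / bigT D ^ 2 → ∀ y : ℝ, bigT D < y → y < bigP D →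
        ‖(∑ n ∈ Ico 1 ⌈y⌉₊, χ (n : ZMod D) * xiZero c' D j n d r / (n : ℂ) *
              ((y / n : ℝ) : ℂ) ^ (-betaMu D μ) * (Real.log (y / n) : ℂ)) -
            deriv χ.LFunction 1 * PiW χ d r * frakgW c' D j μ y‖ ≤ C₄ * (ell D ^ 6)⁻¹)
    (hξ : ∀ d r : ℕ, 1 ≤ d → 1 ≤ r → ((d * r : ℕ) : ℝ) < Skeleton.P1 D → ∀ x : ℝ, 1 ≤ x →
      x ≤ bigT D → ∑ n ∈ Ico 1 ⌈x⌉₊, ‖xiZero c' D j n d r‖ / n ≤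
        Cξ * ell D * (1 + Real.log x) ^ 3)
    (hg : ∀ (μ : ℕ) (y : ℝ), |Real.log y| ≤ ell D ^ 9 → ‖frakgW c' D j μ y‖ ≤ Kg)
    {d r : ℕ} (hd : 1 ≤ d) (hr : 1 ≤ r) (hdr : ((d * r : ℕ) : ℝ) < bigP D ^ (0.5 : ℝ)) :
    ‖nSum21 c' χ j d r‖ ≤
      (1 / Real.log (Skeleton.P1 D) + 2 / Real.log (Skeleton.P2 D)) *
        (‖deriv χ.LFunction 1‖ * Kg + C₄ + Cξ * ell D * (1 + Real.log (bigT D)) ^ 4) *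
          (1 + ‖PiW χ d r‖) := by
  have hL2 : 2 ≤ ell D := by linarith
  have hlogP1 : 0 < Real.log (Skeleton.P1 D) := Real.log_pos (one_lt_P1 (by linarith))
  have hlogP2 : 0 < Real.log (Skeleton.P2 D) := Real.log_pos (one_lt_P2 hL2)
  have h1 := norm_S1_le c' χ hL hC₄ hKg h84 hg hd hr hdr
  have h2 := norm_S2_le c' χ hL hC₄ hCξ hKg h84 hξ hg hd hr hdr
  have hPi := norm_nonneg (PiW χ d r)
  have hlogT : 0 ≤ Real.log (bigT D) := Real.log_nonneg one_le_bigT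
  have hQ0 : 0 ≤ ‖deriv χ.LFunction 1‖ * Kg + C₄ := by positivity
  have hX0 : 0 ≤ Cξ * ell D * (1 + Real.log (bigT D)) ^ 4 := by positivity
  rw [nSum21_eq]
  calc _ ≤ ‖∑ n ∈ Ico 1 (Nsupp D),
            χ (n : ZMod D) * conj (vk1 D (d * r * n)) * xiZero c' D j n d r / (n : ℂ)‖ +
          ‖conj iota2 * ∑ n ∈ Ico 1 (Nsupp D),
            χ (n : ZMod D) * conj (vk2 D (d * r * n)) * xiZero c' D j n d r / (n : ℂ)‖ :=
        norm_add_le _ _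
    _ ≤ 1 / Real.log (Skeleton.P1 D) * ((‖deriv χ.LFunction 1‖ * Kg + C₄) * (1 + ‖PiW χ d r‖)) +
          2 * (1 / Real.log (Skeleton.P2 D) *
            ((‖deriv χ.LFunction 1‖ * Kg + C₄ + Cξ * ell D * (1 + Real.log (bigT D)) ^ 4) *
              (1 + ‖PiW χ d r‖))) := by
        rw [norm_mul, Complex.norm_conj]
        exact add_le_add h1 (mul_le_mul norm_iota2_le h2 (norm_nonneg _) zero_le_two)
    _ ≤ 1 / Real.log (Skeleton.P1 D) *
            ((‖deriv χ.LFunction 1‖ * Kg + C₄ + Cξ * ell D * (1 + Real.log (bigT D)) ^ 4) *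
              (1 + ‖PiW χ d r‖)) +
          2 * (1 / Real.log (Skeleton.P2 D) *
            ((‖deriv χ.LFunction 1‖ * Kg + C₄ + Cξ * ell D * (1 + Real.log (bigT D)) ^ 4) *
              (1 + ‖PiW χ d r‖))) := by
        have hle : (‖deriv χ.LFunction 1‖ * Kg + C₄) * (1 + ‖PiW χ d r‖) ≤
            (‖deriv χ.LFunction 1‖ * Kg + C₄ + Cξ * ell D * (1 + Real.log (bigT D)) ^ 4) *
              (1 + ‖PiW χ d r‖) :=
          mul_le_mul_of_nonneg_right (by linarith) (by positivity)
        exact add_le_add (mul_le_mul_of_nonneg_left hle (by positivity)) le_rfl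
    _ = _ := by ring

/-- **The `n`-sum, window zone** (`P^{1/2}/T < dr < P^{1/2}`): only the `conj ϰ₁`-part survives.
[cite: Zhang2022LandauSiegel, §10 p. 58] -/
theorem norm_nSum21_le_window (hL : 3 ≤ ell D) {j : ℕ} {C₄ Kg : ℝ} (hC₄ : 0 ≤ C₄) (hKg : 0 ≤ Kg)
    (h84 : ∀ μ ∈ ({6, 7} : Finset ℕ), ∀ d r : ℕ, 1 ≤ d → 1 ≤ r →
      ((d * r : ℕ) : ℝ) < bigP D / bigT D ^ 2 → ∀ y : ℝ, bigT D < y → y < bigP D →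
        ‖(∑ n ∈ Ico 1 ⌈y⌉₊, χ (n : ZMod D) * xiZero c' D j n d r / (n : ℂ) *
              ((y / n : ℝ) : ℂ) ^ (-betaMu D μ) * (Real.log (y / n) : ℂ)) -
            deriv χ.LFunction 1 * PiW χ d r * frakgW c' D j μ y‖ ≤ C₄ * (ell D ^ 6)⁻¹)
    (hg : ∀ (μ : ℕ) (y : ℝ), |Real.log y| ≤ ell D ^ 9 → ‖frakgW c' D j μ y‖ ≤ Kg)
    {d r : ℕ} (hd : 1 ≤ d) (hr : 1 ≤ r) (hlo : bigP D ^ (0.5 : ℝ) / bigT D < ((d * r : ℕ) : ℝ))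
    (hdr : ((d * r : ℕ) : ℝ) < bigP D ^ (0.5 : ℝ)) :
    ‖nSum21 c' χ j d r‖ ≤
      1 / Real.log (Skeleton.P1 D) * ((‖deriv χ.LFunction 1‖ * Kg + C₄) * (1 + ‖PiW χ d r‖)) := by
  rw [nSum21_eq, S2_eq_zero c' χ j hlo, mul_zero, add_zero]
  exact norm_S1_le c' χ hL hC₄ hKg h84 hg hd hr hdr

end NSum

/-! ## Part E. The `(d,r)`-sum over `dr < P^{1/2}`: zone split and assembly -/

section Assembly

variable (c' : ℝ) {D : ℕ} [NeZero D] (χ : DirichletCharacter ℂ D)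

omit [NeZero D] in
/-- `‖ |χ(d)||μχ(r)|λ₀ⱼ(dr)/(drφ(r)) ‖ ≤ |λ₀ⱼ(dr)|/(drφ(r))`. [cite: Zhang2022LandauSiegel, §10 p. 57] -/
theorem norm_drWeight_le (j : ℕ) {d r : ℕ} (hd : 1 ≤ d) (hr : 1 ≤ r) :
    ‖drWeight c' χ j d r‖ ≤ ‖lamZero c' D j (d * r)‖ / ((d : ℝ) * r * (Nat.totient r : ℝ)) := by
  have hdR : (0 : ℝ) < d := by exact_mod_cast hd
  have hrR : (0 : ℝ) < r := by exact_mod_cast hr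
  have hφ : (0 : ℝ) < Nat.totient r := by exact_mod_cast Nat.totient_pos.mpr hr
  have h1 : ‖χ (d : ZMod D)‖ ≤ 1 := χ.norm_le_one _
  have h2 : ‖((ArithmeticFunction.moebius r : ℤ) : ℂ)‖ * ‖χ (r : ZMod D)‖ ≤ 1 := by
    rw [Complex.norm_intCast]
    have hμ : |((ArithmeticFunction.moebius r : ℤ) : ℝ)| ≤ 1 := by
      rw [← Int.cast_abs]; exact_mod_cast ArithmeticFunction.abs_moebius_le_one
    calc _ ≤ 1 * 1 := mul_le_mul hμ (χ.norm_le_one _) (norm_nonneg _) zero_le_one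
      _ = 1 := one_mul 1
  unfold drWeight
  simp only [norm_div, norm_mul, Complex.norm_real, Complex.norm_natCast, Real.norm_eq_abs,
    abs_norm]
  push_cast
  refine div_le_div_of_nonneg_right ?_ (by positivity)
  calc ‖χ (d : ZMod D)‖ * (‖((ArithmeticFunction.moebius r : ℤ) : ℂ)‖ * ‖χ (r : ZMod D)‖) *
        ‖lamZero c' D j (d * r)‖ ≤ 1 * 1 * ‖lamZero c' D j (d * r)‖ := by
        gcongr
    _ = ‖lamZero c' D j (d * r)‖ := by ring

omit [NeZero D] in
/-- `1 ≤ P^{1/2}/T` (`𝓛 ≥ 2`). [cite: Zhang2022LandauSiegel, §2 (2.6)–(2.13)] -/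
theorem one_le_sqrtP_div_T (hL : 2 ≤ ell D) : 1 ≤ bigP D ^ (0.5 : ℝ) / bigT D := by
  rw [sqrtP_eq, bigT, ← Real.exp_sub]
  have h11 := rpow11_le_sq (D := D) (by linarith)
  have h7 : (2 : ℝ) ^ 7 ≤ ell D ^ 7 := pow_le_pow_left₀ (by norm_num) hL 7
  have e : ell D ^ 9 = ell D ^ 2 * ell D ^ 7 := by ring
  apply Real.one_le_exp
  nlinarith [sq_nonneg (ell D), mul_le_mul_of_nonneg_left h7 (sq_nonneg (ell D))]

/-- **The `(d,r)`-sum of `S_j(𝐚₁₃,𝐚₂₁)` over `dr < P^{1/2}`, explicit bound** from the two zones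
`dr ≤ P^{1/2}/T` (`|𝔳₁ⱼ| ≤ C₁T^{−c}`) and `P^{1/2}/T < dr < P^{1/2}` (`|𝔳₁ⱼ| ≤ C₁𝓛⁻⁷`), the `n`-sum
bounds of Part D and the window weight sums of Part A′.
[cite: Zhang2022LandauSiegel, §10 p. 58] -/
theorem norm_drSum_low_le (hL : 3 ≤ ell D) {j : ℕ} {c C₁ C₄ Cξ Kg : ℝ} (hC₁ : 0 ≤ C₁)
    (hC₄ : 0 ≤ C₄) (hCξ : 0 ≤ Cξ) (hKg : 0 ≤ Kg)
    (hM1 : ∀ y : ℝ, 1 ≤ y → y ≤ bigP D ^ (0.5 : ℝ) / bigT D →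
      ‖frakv1 c' χ j y‖ ≤ C₁ * bigT D ^ (-c))
    (hM2 : ∀ y : ℝ, bigP D ^ (0.5 : ℝ) / bigT D < y → y ≤ bigP D ^ (0.5 : ℝ) →
      ‖frakv1 c' χ j y‖ ≤ C₁ * (ell D ^ 7)⁻¹)
    (h84 : ∀ μ ∈ ({6, 7} : Finset ℕ), ∀ d r : ℕ, 1 ≤ d → 1 ≤ r →
      ((d * r : ℕ) : ℝ) < bigP D / bigT D ^ 2 → ∀ y : ℝ, bigT D < y → y < bigP D →
        ‖(∑ n ∈ Ico 1 ⌈y⌉₊, χ (n : ZMod D) * xiZero c' D j n d r / (n : ℂ) *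
              ((y / n : ℝ) : ℂ) ^ (-betaMu D μ) * (Real.log (y / n) : ℂ)) -
            deriv χ.LFunction 1 * PiW χ d r * frakgW c' D j μ y‖ ≤ C₄ * (ell D ^ 6)⁻¹)
    (hξ : ∀ d r : ℕ, 1 ≤ d → 1 ≤ r → ((d * r : ℕ) : ℝ) < Skeleton.P1 D → ∀ x : ℝ, 1 ≤ x →
      x ≤ bigT D → ∑ n ∈ Ico 1 ⌈x⌉₊, ‖xiZero c' D j n d r‖ / n ≤
        Cξ * ell D * (1 + Real.log x) ^ 3)
    (hg : ∀ (μ : ℕ) (y : ℝ), |Real.log y| ≤ ell D ^ 9 → ‖frakgW c' D j μ y‖ ≤ Kg) :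
    ‖drSum c' χ j (mSum13 c' χ j) (nSum21 c' χ j) 0 (bigP D ^ (0.5 : ℝ))‖ ≤
      C₁ * bigT D ^ (-c) *
          ((1 / Real.log (Skeleton.P1 D) + 2 / Real.log (Skeleton.P2 D)) *
            (‖deriv χ.LFunction 1‖ * Kg + C₄ + Cξ * ell D * (1 + Real.log (bigT D)) ^ 4)) *
          (4 * Real.exp 104 * (1 + Real.log ((bigP D ^ (0.5 : ℝ) / bigT D) / (1 / 2)))) +
        C₁ * (ell D ^ 7)⁻¹ *
          (1 / Real.log (Skeleton.P1 D) * (‖deriv χ.LFunction 1‖ * Kg + C₄)) *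
          (4 * Real.exp 104 *
            (1 + Real.log (bigP D ^ (0.5 : ℝ) / (bigP D ^ (0.5 : ℝ) / bigT D)))) := by
  have hL2 : 2 ≤ ell D := by linarith
  have hlogP1 : 0 < Real.log (Skeleton.P1 D) := Real.log_pos (one_lt_P1 (by linarith))
  have hlogP2 : 0 < Real.log (Skeleton.P2 D) := Real.log_pos (one_lt_P2 hL2)
  have hT0 : 0 < bigT D := Real.exp_pos _
  have hTc : 0 < bigT D ^ (-c) := Real.rpow_pos_of_pos hT0 _
  have hlogT : 0 ≤ Real.log (bigT D) := Real.log_nonneg one_le_bigT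
  have hA1 : 1 ≤ bigP D ^ (0.5 : ℝ) / bigT D := one_le_sqrtP_div_T hL2
  have hA0 : 0 < bigP D ^ (0.5 : ℝ) / bigT D := by linarith
  have hhalfA : (1 / 2 : ℝ) ≤ bigP D ^ (0.5 : ℝ) / bigT D := by linarith
  have hAB : bigP D ^ (0.5 : ℝ) / bigT D ≤ bigP D ^ (0.5 : ℝ) := div_le_self sqrtP_nonneg one_le_bigT
  have hL7 : 0 < (ell D ^ 7)⁻¹ := by positivity
  -- the two `n`-sum constants
  set NB₁ : ℝ := (1 / Real.log (Skeleton.P1 D) + 2 / Real.log (Skeleton.P2 D)) *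
      (‖deriv χ.LFunction 1‖ * Kg + C₄ + Cξ * ell D * (1 + Real.log (bigT D)) ^ 4) with hNB₁
  set NB₂ : ℝ := 1 / Real.log (Skeleton.P1 D) * (‖deriv χ.LFunction 1‖ * Kg + C₄) with hNB₂
  have hNB₁0 : 0 ≤ NB₁ := by rw [hNB₁]; positivity
  have hNB₂0 : 0 ≤ NB₂ := by rw [hNB₂]; positivity
  have ha0 : 0 ≤ C₁ * bigT D ^ (-c) * NB₁ := by positivity
  have hb0 : 0 ≤ C₁ * (ell D ^ 7)⁻¹ * NB₂ := by positivity
  -- pointwise bound in the two zones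
  have hpt : ∀ d ∈ Ico 1 (Nsupp D), ∀ r ∈ Ico 1 (Nsupp D),
      ‖(if (0 : ℝ) ≤ ((d * r : ℕ) : ℝ) ∧ ((d * r : ℕ) : ℝ) < bigP D ^ (0.5 : ℝ) then
          drWeight c' χ j d r * mSum13 c' χ j (d * r) * nSum21 c' χ j d r else 0)‖ ≤
        C₁ * bigT D ^ (-c) * NB₁ *
            (if 1 / 2 < ((d * r : ℕ) : ℝ) ∧ ((d * r : ℕ) : ℝ) ≤ bigP D ^ (0.5 : ℝ) / bigT D then
              ‖lamZero c' D j (d * r)‖ * (1 + ‖PiW χ d r‖) / ((d : ℝ) * r * (Nat.totient r : ℝ))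
            else 0) +
          C₁ * (ell D ^ 7)⁻¹ * NB₂ *
            (if bigP D ^ (0.5 : ℝ) / bigT D < ((d * r : ℕ) : ℝ) ∧
                ((d * r : ℕ) : ℝ) ≤ bigP D ^ (0.5 : ℝ) then
              ‖lamZero c' D j (d * r)‖ * (1 + ‖PiW χ d r‖) / ((d : ℝ) * r * (Nat.totient r : ℝ))
            else 0) := by
    intro d hd r hr
    have hd1 : 1 ≤ d := (mem_Ico.mp hd).1
    have hr1 : 1 ≤ r := (mem_Ico.mp hr).1
    have hdr1 : (1 : ℝ) ≤ ((d * r : ℕ) : ℝ) := by exact_mod_cast Nat.mul_pos hd1 hr1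
    have hω0 : 0 ≤ ‖lamZero c' D j (d * r)‖ * (1 + ‖PiW χ d r‖) /
        ((d : ℝ) * r * (Nat.totient r : ℝ)) := by positivity
    have hw := norm_drWeight_le c' χ j hd1 hr1
    have hw0 : 0 ≤ ‖lamZero c' D j (d * r)‖ / ((d : ℝ) * r * (Nat.totient r : ℝ)) := by
      positivity
    have hMeq : mSum13 c' χ j (d * r) = frakv1 c' χ j ((d * r : ℕ) : ℝ) :=
      mSum13_eq_frakv1 c' χ hL2 j (Nat.mul_pos hd1 hr1)
    by_cases hcond : (0 : ℝ) ≤ ((d * r : ℕ) : ℝ) ∧ ((d * r : ℕ) : ℝ) < bigP D ^ (0.5 : ℝ)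
    · rw [if_pos hcond, norm_mul, norm_mul, hMeq]
      by_cases hz : ((d * r : ℕ) : ℝ) ≤ bigP D ^ (0.5 : ℝ) / bigT D
      · -- zone 1
        rw [if_pos ⟨by linarith, hz⟩, if_neg (fun h => absurd h.1 (not_lt.mpr hz)), mul_zero,
          add_zero]
        have hM := hM1 _ hdr1 hz
        have hN : ‖nSum21 c' χ j d r‖ ≤ NB₁ * (1 + ‖PiW χ d r‖) := by
          rw [hNB₁]
          exact norm_nSum21_le c' χ hL hC₄ hCξ hKg h84 hξ hg hd1 hr1 hcond.2
        calc ‖drWeight c' χ j d r‖ * ‖frakv1 c' χ j ((d * r : ℕ) : ℝ)‖ * ‖nSum21 c' χ j d r‖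
            ≤ (‖lamZero c' D j (d * r)‖ / ((d : ℝ) * r * (Nat.totient r : ℝ))) *
                (C₁ * bigT D ^ (-c)) * (NB₁ * (1 + ‖PiW χ d r‖)) :=
              mul_le_mul (mul_le_mul hw hM (norm_nonneg _) hw0) hN (norm_nonneg _)
                (mul_nonneg hw0 (by positivity))
          _ = C₁ * bigT D ^ (-c) * NB₁ * (‖lamZero c' D j (d * r)‖ * (1 + ‖PiW χ d r‖) /
                ((d : ℝ) * r * (Nat.totient r : ℝ))) := by ring
      · -- zone 2
        have hz' : bigP D ^ (0.5 : ℝ) / bigT D < ((d * r : ℕ) : ℝ) := not_le.mp hz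
        rw [if_neg (fun h => absurd h.2 hz), if_pos ⟨hz', hcond.2.le⟩, mul_zero, zero_add]
        have hM := hM2 _ hz' hcond.2.le
        have hN : ‖nSum21 c' χ j d r‖ ≤ NB₂ * (1 + ‖PiW χ d r‖) := by
          rw [hNB₂, mul_assoc]
          exact norm_nSum21_le_window c' χ hL hC₄ hKg h84 hg hd1 hr1 hz' hcond.2
        calc ‖drWeight c' χ j d r‖ * ‖frakv1 c' χ j ((d * r : ℕ) : ℝ)‖ * ‖nSum21 c' χ j d r‖
            ≤ (‖lamZero c' D j (d * r)‖ / ((d : ℝ) * r * (Nat.totient r : ℝ))) *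
                (C₁ * (ell D ^ 7)⁻¹) * (NB₂ * (1 + ‖PiW χ d r‖)) :=
              mul_le_mul (mul_le_mul hw hM (norm_nonneg _) hw0) hN (norm_nonneg _)
                (mul_nonneg hw0 (by positivity))
          _ = C₁ * (ell D ^ 7)⁻¹ * NB₂ * (‖lamZero c' D j (d * r)‖ * (1 + ‖PiW χ d r‖) /
                ((d : ℝ) * r * (Nat.totient r : ℝ))) := by ring
    · rw [if_neg hcond, norm_zero]
      have h1 : 0 ≤ C₁ * bigT D ^ (-c) * NB₁ *
          (if 1 / 2 < ((d * r : ℕ) : ℝ) ∧ ((d * r : ℕ) : ℝ) ≤ bigP D ^ (0.5 : ℝ) / bigT D then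
            ‖lamZero c' D j (d * r)‖ * (1 + ‖PiW χ d r‖) / ((d : ℝ) * r * (Nat.totient r : ℝ))
          else 0) := mul_nonneg ha0 (by split_ifs <;> positivity)
      have h2 : 0 ≤ C₁ * (ell D ^ 7)⁻¹ * NB₂ *
          (if bigP D ^ (0.5 : ℝ) / bigT D < ((d * r : ℕ) : ℝ) ∧
              ((d * r : ℕ) : ℝ) ≤ bigP D ^ (0.5 : ℝ) then
            ‖lamZero c' D j (d * r)‖ * (1 + ‖PiW χ d r‖) / ((d : ℝ) * r * (Nat.totient r : ℝ))
          else 0) := mul_nonneg hb0 (by split_ifs <;> positivity)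
      linarith
  -- the two window sums
  have hW1 := pairSum_window_le c' D χ j (Nsupp D) (by norm_num : (0 : ℝ) < 1 / 2) hhalfA
  have hW2 := pairSum_window_le c' D χ j (Nsupp D) hA0 hAB
  unfold drSum
  calc _ ≤ ∑ d ∈ Ico 1 (Nsupp D), ‖∑ r ∈ Ico 1 (Nsupp D),
          (if (0 : ℝ) ≤ ((d * r : ℕ) : ℝ) ∧ ((d * r : ℕ) : ℝ) < bigP D ^ (0.5 : ℝ) then
            drWeight c' χ j d r * mSum13 c' χ j (d * r) * nSum21 c' χ j d r else 0)‖ :=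
        norm_sum_le _ _
    _ ≤ ∑ d ∈ Ico 1 (Nsupp D), ∑ r ∈ Ico 1 (Nsupp D),
          ‖(if (0 : ℝ) ≤ ((d * r : ℕ) : ℝ) ∧ ((d * r : ℕ) : ℝ) < bigP D ^ (0.5 : ℝ) then
            drWeight c' χ j d r * mSum13 c' χ j (d * r) * nSum21 c' χ j d r else 0)‖ :=
        sum_le_sum fun d _ => norm_sum_le _ _
    _ ≤ ∑ d ∈ Ico 1 (Nsupp D), ∑ r ∈ Ico 1 (Nsupp D),
          (C₁ * bigT D ^ (-c) * NB₁ *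
              (if 1 / 2 < ((d * r : ℕ) : ℝ) ∧ ((d * r : ℕ) : ℝ) ≤ bigP D ^ (0.5 : ℝ) / bigT D then
                ‖lamZero c' D j (d * r)‖ * (1 + ‖PiW χ d r‖) / ((d : ℝ) * r * (Nat.totient r : ℝ))
              else 0) +
            C₁ * (ell D ^ 7)⁻¹ * NB₂ *
              (if bigP D ^ (0.5 : ℝ) / bigT D < ((d * r : ℕ) : ℝ) ∧
                  ((d * r : ℕ) : ℝ) ≤ bigP D ^ (0.5 : ℝ) then
                ‖lamZero c' D j (d * r)‖ * (1 + ‖PiW χ d r‖) / ((d : ℝ) * r * (Nat.totient r : ℝ))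
              else 0)) :=
        sum_le_sum fun d hd => sum_le_sum fun r hr => hpt d hd r hr
    _ = C₁ * bigT D ^ (-c) * NB₁ *
            ∑ d ∈ Ico 1 (Nsupp D), ∑ r ∈ Ico 1 (Nsupp D),
              (if 1 / 2 < ((d * r : ℕ) : ℝ) ∧ ((d * r : ℕ) : ℝ) ≤ bigP D ^ (0.5 : ℝ) / bigT D then
                ‖lamZero c' D j (d * r)‖ * (1 + ‖PiW χ d r‖) / ((d : ℝ) * r * (Nat.totient r : ℝ))
              else 0) +
          C₁ * (ell D ^ 7)⁻¹ * NB₂ *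
            ∑ d ∈ Ico 1 (Nsupp D), ∑ r ∈ Ico 1 (Nsupp D),
              (if bigP D ^ (0.5 : ℝ) / bigT D < ((d * r : ℕ) : ℝ) ∧
                  ((d * r : ℕ) : ℝ) ≤ bigP D ^ (0.5 : ℝ) then
                ‖lamZero c' D j (d * r)‖ * (1 + ‖PiW χ d r‖) / ((d : ℝ) * r * (Nat.totient r : ℝ))
              else 0) := by
        simp only [sum_add_distrib, mul_sum]
    _ ≤ C₁ * bigT D ^ (-c) * NB₁ *
            (4 * Real.exp 104 * (1 + Real.log ((bigP D ^ (0.5 : ℝ) / bigT D) / (1 / 2)))) +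
          C₁ * (ell D ^ 7)⁻¹ * NB₂ *
            (4 * Real.exp 104 *
              (1 + Real.log (bigP D ^ (0.5 : ℝ) / (bigP D ^ (0.5 : ℝ) / bigT D)))) :=
        add_le_add (mul_le_mul_of_nonneg_left hW1 ha0) (mul_le_mul_of_nonneg_left hW2 hb0)

end Assembly

/-! ## Part F. The numerical endgame and the deduction `Lemma 10.1 + Lemma 8.4 ⇒ Small1321` -/

section Endgame

/-- **The numerical endgame.** With `L = 𝓛 ≥ 3`, `log P₁ = 0.504L⁹`, `log P₂ ≥ 0.25L⁹`,
`0 ≤ log T ≤ L²`, `T^{−c} ≤ e^{−cL}`, `0 ≤ log(2P^{1/2}/T) ≤ 1 + 0.5L⁹`, `|L′(1,χ)| ≤ 2e^{9/2}(1+L)L`,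
the bound of `norm_drSum_low_le` is `≤ επ/L⁹ = εα` as soon as `L` exceeds two explicit thresholds.
[cite: Zhang2022LandauSiegel, §10 p. 58] -/
private theorem endgame {L c ε C₁ C₄ Cξ Kg Lp lP1 lP2 lT Tc lA : ℝ} (hL : 3 ≤ L) (hc : 0 < c)
    (hε : 0 < ε) (hC₁ : 0 ≤ C₁) (hC₄ : 0 ≤ C₄) (hCξ : 0 ≤ Cξ) (hKg : 0 ≤ Kg) (hLp0 : 0 ≤ Lp)
    (hLp : Lp ≤ 2 * Real.exp (9 / 2) * (1 + L) * L)
    (hlP1 : lP1 = 0.504 * L ^ 9) (hlP2 : 0.25 * L ^ 9 ≤ lP2) (hlT0 : 0 ≤ lT) (hlT : lT ≤ L ^ 2)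
    (hTc : Tc ≤ Real.exp (-(c * L))) (hlA0 : 0 ≤ lA) (hlA : lA ≤ 1 + 0.5 * L ^ 9)
    (hL1 : 2 * (4 * Real.exp 104 * C₁ * (40 * Real.exp (9 / 2) * Kg + 10 * C₄ + 160 * Cξ)) *
        (Nat.factorial 19) / (c ^ 19 * (ε * π)) ≤ L)
    (hL2 : 2 * (8 * Real.exp 104 * C₁ * (2 * (4 * Real.exp (9 / 2) * Kg + C₄))) / (ε * π) ≤ L) :
    C₁ * Tc * ((1 / lP1 + 2 / lP2) * (Lp * Kg + C₄ + Cξ * L * (1 + lT) ^ 4)) *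
          (4 * Real.exp 104 * (1 + lA)) +
        C₁ * (L ^ 7)⁻¹ * (1 / lP1 * (Lp * Kg + C₄)) * (4 * Real.exp 104 * (1 + lT)) ≤
      ε * (π / L ^ 9) := by
  have hL1' : 1 ≤ L := by linarith
  have hL0 : 0 < L := by linarith
  have hL9 : 1 ≤ L ^ 9 := one_le_pow₀ hL1'
  have hL2sq : 1 ≤ L ^ 2 := one_le_pow₀ hL1'
  have hπ : 0 < π := Real.pi_pos
  have hεπ : 0 < ε * π := mul_pos hε hπ
  have he : 0 < Real.exp (9 / 2) := Real.exp_pos _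
  have he104 : 0 < Real.exp 104 := Real.exp_pos _
  set K₁ : ℝ := 40 * Real.exp (9 / 2) * Kg + 10 * C₄ + 160 * Cξ with hK₁
  set K₂ : ℝ := 2 * (4 * Real.exp (9 / 2) * Kg + C₄) with hK₂
  set A₁ : ℝ := 4 * Real.exp 104 * C₁ * K₁ with hA₁
  set A₂ : ℝ := 8 * Real.exp 104 * C₁ * K₂ with hA₂
  have hK₁0 : 0 ≤ K₁ := by rw [hK₁]; positivity
  have hK₂0 : 0 ≤ K₂ := by rw [hK₂]; positivity
  have hA₁0 : 0 ≤ A₁ := by rw [hA₁]; positivity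
  have hA₂0 : 0 ≤ A₂ := by rw [hA₂]; positivity
  have hlP1pos : 0 < lP1 := by rw [hlP1]; positivity
  have hlP2pos : 0 < lP2 := lt_of_lt_of_le (by positivity) hlP2
  -- (i) the `1/log P` factors
  have h1lP1 : 1 / lP1 ≤ 2 / L ^ 9 := by
    rw [hlP1, div_le_div_iff₀ (by positivity) (by positivity)]
    linarith
  have hi : 1 / lP1 + 2 / lP2 ≤ 10 / L ^ 9 := by
    have h2 : 2 / lP2 ≤ 8 / L ^ 9 := by
      rw [div_le_div_iff₀ hlP2pos (by positivity)]
      linarith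
    calc 1 / lP1 + 2 / lP2 ≤ 2 / L ^ 9 + 8 / L ^ 9 := add_le_add h1lP1 h2
      _ = 10 / L ^ 9 := by ring
  -- (ii) the `n`-sum factors
  have hLp' : Lp ≤ 4 * Real.exp (9 / 2) * L ^ 2 := by
    have hLL : L ≤ L ^ 2 := le_self_pow₀ hL1' (by norm_num)
    have h : (1 + L) * L ≤ 2 * L ^ 2 := by
      have e : (1 + L) * L = L + L ^ 2 := by ring
      rw [e]; linarith
    calc Lp ≤ 2 * Real.exp (9 / 2) * (1 + L) * L := hLp
      _ = 2 * Real.exp (9 / 2) * ((1 + L) * L) := by ring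
      _ ≤ 2 * Real.exp (9 / 2) * (2 * L ^ 2) := by gcongr
      _ = 4 * Real.exp (9 / 2) * L ^ 2 := by ring
  have h1lT : 1 + lT ≤ 2 * L ^ 2 := by linarith
  have hlT4 : (1 + lT) ^ 4 ≤ 16 * L ^ 8 := by
    calc (1 + lT) ^ 4 ≤ (2 * L ^ 2) ^ 4 := pow_le_pow_left₀ (by linarith) h1lT 4
      _ = 16 * L ^ 8 := by ring
  have ha : Lp * Kg ≤ 4 * Real.exp (9 / 2) * L ^ 2 * Kg := mul_le_mul_of_nonneg_right hLp' hKg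
  have hb : Cξ * L * (1 + lT) ^ 4 ≤ Cξ * L * (16 * L ^ 8) :=
    mul_le_mul_of_nonneg_left hlT4 (by positivity)
  have hii : Lp * Kg + C₄ + Cξ * L * (1 + lT) ^ 4 ≤
      4 * Real.exp (9 / 2) * L ^ 2 * Kg + C₄ + Cξ * L * (16 * L ^ 8) := by linarith
  -- (iii) `NB₁ ≤ K₁`
  have hpos2 : 0 ≤ Lp * Kg + C₄ + Cξ * L * (1 + lT) ^ 4 := by positivity
  have hiii : (1 / lP1 + 2 / lP2) * (Lp * Kg + C₄ + Cξ * L * (1 + lT) ^ 4) ≤ K₁ := by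
    have hq1 : L ^ 2 / L ^ 9 ≤ 1 := by
      rw [div_le_one (by positivity)]
      exact pow_le_pow_right₀ hL1' (by norm_num)
    have hq2 : 1 / L ^ 9 ≤ 1 := by rw [div_le_one (by positivity)]; exact hL9
    calc (1 / lP1 + 2 / lP2) * (Lp * Kg + C₄ + Cξ * L * (1 + lT) ^ 4)
        ≤ (10 / L ^ 9) * (4 * Real.exp (9 / 2) * L ^ 2 * Kg + C₄ + Cξ * L * (16 * L ^ 8)) :=
          mul_le_mul hi hii hpos2 (by positivity)
      _ = 40 * Real.exp (9 / 2) * Kg * (L ^ 2 / L ^ 9) + 10 * C₄ * (1 / L ^ 9) + 160 * Cξ := by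
          field_simp
          ring
      _ ≤ 40 * Real.exp (9 / 2) * Kg * 1 + 10 * C₄ * 1 + 160 * Cξ := by gcongr
      _ = K₁ := by rw [hK₁]; ring
  -- (iv) the first window factor
  have h39 : (3 : ℝ) ^ 9 ≤ L ^ 9 := pow_le_pow_left₀ (by norm_num) hL 9
  have hiv : 4 * Real.exp 104 * (1 + lA) ≤ 4 * Real.exp 104 * L ^ 9 := by
    norm_num at h39
    have : 1 + lA ≤ L ^ 9 := by linarith
    exact mul_le_mul_of_nonneg_left this (by positivity)
  -- zone 1
  have hZ1 : C₁ * Tc * ((1 / lP1 + 2 / lP2) * (Lp * Kg + C₄ + Cξ * L * (1 + lT) ^ 4)) *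
      (4 * Real.exp 104 * (1 + lA)) ≤ A₁ * (Real.exp (-(c * L)) * L ^ 18) / L ^ 9 := by
    calc C₁ * Tc * ((1 / lP1 + 2 / lP2) * (Lp * Kg + C₄ + Cξ * L * (1 + lT) ^ 4)) *
          (4 * Real.exp 104 * (1 + lA))
        ≤ C₁ * Real.exp (-(c * L)) * K₁ * (4 * Real.exp 104 * L ^ 9) :=
          mul_le_mul (mul_le_mul (mul_le_mul_of_nonneg_left hTc hC₁) hiii
            (mul_nonneg (by positivity) hpos2) (by positivity)) hiv (by positivity) (by positivity)
      _ = A₁ * (Real.exp (-(c * L)) * L ^ 18) / L ^ 9 := by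
          rw [hA₁]; field_simp
  have hZ1' : A₁ * (Real.exp (-(c * L)) * L ^ 18) / L ^ 9 ≤ (ε * π / 2) / L ^ 9 := by
    apply div_le_div_of_nonneg_right _ (by positivity)
    have hf : (0 : ℝ) < Nat.factorial 19 := by positivity
    have h := hL1
    rw [div_le_iff₀ (by positivity)] at h
    calc A₁ * (Real.exp (-(c * L)) * L ^ 18) ≤ A₁ * ((Nat.factorial 19 : ℝ) / (c ^ 19 * L)) :=
          mul_le_mul_of_nonneg_left (exp_neg_mul_pow_le hc hL0) hA₁0
      _ = (A₁ * Nat.factorial 19) / (c ^ 19 * L) := by ring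
      _ ≤ ε * π / 2 := by
          rw [div_le_iff₀ (by positivity)]
          linear_combination (1 / 2 : ℝ) * h
  -- zone 2
  have hZ2 : C₁ * (L ^ 7)⁻¹ * (1 / lP1 * (Lp * Kg + C₄)) * (4 * Real.exp 104 * (1 + lT)) ≤
      A₂ / L ^ 12 := by
    have hC₄' : C₄ ≤ C₄ * L ^ 2 := le_mul_of_one_le_right hC₄ hL2sq
    have h1 : 1 / lP1 * (Lp * Kg + C₄) ≤ K₂ * L ^ 2 / L ^ 9 := by
      calc 1 / lP1 * (Lp * Kg + C₄) ≤ (2 / L ^ 9) * (4 * Real.exp (9 / 2) * L ^ 2 * Kg + C₄ * L ^ 2) :=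
            mul_le_mul h1lP1 (by linarith) (by positivity) (by positivity)
        _ = K₂ * L ^ 2 / L ^ 9 := by rw [hK₂]; field_simp
    have h2 : 4 * Real.exp 104 * (1 + lT) ≤ 8 * Real.exp 104 * L ^ 2 := by
      have := mul_le_mul_of_nonneg_left h1lT he104.le
      linarith
    calc C₁ * (L ^ 7)⁻¹ * (1 / lP1 * (Lp * Kg + C₄)) * (4 * Real.exp 104 * (1 + lT))
        ≤ C₁ * (L ^ 7)⁻¹ * (K₂ * L ^ 2 / L ^ 9) * (8 * Real.exp 104 * L ^ 2) :=
          mul_le_mul (mul_le_mul_of_nonneg_left h1 (by positivity)) h2 (by positivity)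
            (by positivity)
      _ = A₂ / L ^ 12 := by rw [hA₂]; field_simp
  have hZ2' : A₂ / L ^ 12 ≤ (ε * π / 2) / L ^ 9 := by
    rw [div_le_div_iff₀ (by positivity) (by positivity)]
    have h := hL2
    rw [div_le_iff₀ hεπ] at h
    have hL3' : L ≤ L ^ 3 := le_self_pow₀ hL1' (by norm_num)
    have k : A₂ ≤ ε * π / 2 * L := by linear_combination (1 / 2 : ℝ) * h
    have k2 : ε * π / 2 * L ≤ ε * π / 2 * L ^ 3 := mul_le_mul_of_nonneg_left hL3' (by positivity)
    calc A₂ * L ^ 9 ≤ (ε * π / 2 * L ^ 3) * L ^ 9 :=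
          mul_le_mul_of_nonneg_right (k.trans k2) (by positivity)
      _ = ε * π / 2 * L ^ 12 := by ring
  calc _ ≤ (ε * π / 2) / L ^ 9 + (ε * π / 2) / L ^ 9 :=
        add_le_add (hZ1.trans hZ1') (hZ2.trans hZ2')
    _ = ε * (π / L ^ 9) := by ring

end Endgame

section Main

/-- **DEDUCTION for node `Z22:§10.u042` (prose claim "By Lemma 10.1 and the results in Section 8, the
sum over `dr < P^{0.5}` is `o(α)`", p. 58 tex L2977): Lemma 10.1 ((10.2) below `P^{1/2}/T`, (10.5) on
the window) and Lemma 8.4 (the `conj ϰ₁`, `conj ϰ₂` sums), together with the tree's UNCONDITIONAL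
`ξ₀ⱼ`-tail mean (`XiZeroMajorant.xiZeroTailMean`, for the `ϰ₂`-range `P₂/T ≤ dr < P₂` that Lemma 8.4
does not cover), `|L′(1,χ)| ≪ 𝓛²` and `|𝔤_{jμ}| ≪ 1`, imply `Typed.Sec10B.Small1321 c′`.**
[cite: Zhang2022LandauSiegel, §10 p. 58] -/
theorem small1321_of (c' : ℝ) (h101 : Lemma101 c') (h84 : Lemma84 c') : Small1321 c' := by
  intro ε hε
  obtain ⟨c, hc, C₁, D₁, H101⟩ := h101
  obtain ⟨C₄, D₄, H84⟩ := h84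
  obtain ⟨Cξ, Dξ, Hξ⟩ := XiZeroMajorant.xiZeroTailMean c'
  obtain ⟨Kg, hKg1, HKg⟩ := Section9Discharge.exists_norm_frakgW_le c'
  have hKg0 : 0 ≤ Kg := by linarith
  -- nonnegative majorants of the constants
  set C₁p : ℝ := max C₁ 0 with hC₁p
  set C₄p : ℝ := max C₄ 0 with hC₄p
  set Cξp : ℝ := max Cξ 0 with hCξp
  have hC₁0 : 0 ≤ C₁p := le_max_right _ _
  have hC₄0 : 0 ≤ C₄p := le_max_right _ _
  have hCξ0 : 0 ≤ Cξp := le_max_right _ _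
  -- the threshold
  set Lε : ℝ := max 3 (max
    (2 * (4 * Real.exp 104 * C₁p * (40 * Real.exp (9 / 2) * Kg + 10 * C₄p + 160 * Cξp)) *
        (Nat.factorial 19) / (c ^ 19 * (ε * π)))
    (2 * (8 * Real.exp 104 * C₁p * (2 * (4 * Real.exp (9 / 2) * Kg + C₄p))) / (ε * π))) with hLε
  refine ⟨max (max D₁ D₄) (max Dξ ⌈Real.exp Lε⌉₊), fun D _ χ hD hq hp hA j hj => ?_⟩
  have hD₁ : D₁ ≤ D := le_trans (le_trans (le_max_left _ _) (le_max_left _ _)) hD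
  have hD₄ : D₄ ≤ D := le_trans (le_trans (le_max_right _ _) (le_max_left _ _)) hD
  have hDξ : Dξ ≤ D := le_trans (le_trans (le_max_left _ _) (le_max_right _ _)) hD
  have hLεD : Lε ≤ ell D :=
    le_ell_of_ceil_exp_le (le_trans (le_trans (le_max_right _ _) (le_max_right _ _)) hD)
  have hL3 : 3 ≤ ell D := le_trans (le_max_left _ _) hLεD
  have hT1 : (2 * (4 * Real.exp 104 * C₁p * (40 * Real.exp (9 / 2) * Kg + 10 * C₄p + 160 * Cξp)) *
        (Nat.factorial 19) / (c ^ 19 * (ε * π))) ≤ ell D :=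
    le_trans (le_trans (le_max_left _ _) (le_max_right _ _)) hLεD
  have hT2 : 2 * (8 * Real.exp 104 * C₁p * (2 * (4 * Real.exp (9 / 2) * Kg + C₄p))) / (ε * π) ≤
      ell D := le_trans (le_trans (le_max_right _ _) (le_max_right _ _)) hLεD
  have hL0 : 0 < ell D := by linarith
  have hL1 : 1 ≤ ell D := by linarith
  have hL2 : 2 ≤ ell D := by linarith
  have hT0 : 0 < bigT D := Real.exp_pos _
  have hTc0 : 0 < bigT D ^ (-c) := Real.rpow_pos_of_pos hT0 _
  -- the instantiated inputs
  have h101D := H101 D χ hD₁ hq hp hA j hj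
  have hM1 : ∀ y : ℝ, 1 ≤ y → y ≤ bigP D ^ (0.5 : ℝ) / bigT D →
      ‖frakv1 c' χ j y‖ ≤ C₁p * bigT D ^ (-c) := fun y h1 h2 =>
    ((h101D y).1 h1 h2).trans (mul_le_mul_of_nonneg_right (le_max_left _ _) hTc0.le)
  have hM2 : ∀ y : ℝ, bigP D ^ (0.5 : ℝ) / bigT D < y → y ≤ bigP D ^ (0.5 : ℝ) →
      ‖frakv1 c' χ j y‖ ≤ C₁p * (ell D ^ 7)⁻¹ := fun y h1 h2 =>
    ((h101D y).2.2.2 (Or.inl ⟨h1, h2⟩)).trans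
      (mul_le_mul_of_nonneg_right (le_max_left _ _) (by positivity))
  have h84D : ∀ μ ∈ ({6, 7} : Finset ℕ), ∀ d r : ℕ, 1 ≤ d → 1 ≤ r →
      ((d * r : ℕ) : ℝ) < bigP D / bigT D ^ 2 → ∀ y : ℝ, bigT D < y → y < bigP D →
        ‖(∑ n ∈ Ico 1 ⌈y⌉₊, χ (n : ZMod D) * xiZero c' D j n d r / (n : ℂ) *
              ((y / n : ℝ) : ℂ) ^ (-betaMu D μ) * (Real.log (y / n) : ℂ)) -
            deriv χ.LFunction 1 * PiW χ d r * frakgW c' D j μ y‖ ≤ C₄p * (ell D ^ 6)⁻¹ :=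
    fun μ hμ d r hd hr hdr y hy1 hy2 =>
      (H84 D χ hD₄ hq hp hA j hj μ hμ d r hd hr hdr y hy1 hy2).trans
        (mul_le_mul_of_nonneg_right (le_max_left _ _) (by positivity))
  have hξD : ∀ d r : ℕ, 1 ≤ d → 1 ≤ r → ((d * r : ℕ) : ℝ) < Skeleton.P1 D → ∀ x : ℝ, 1 ≤ x →
      x ≤ bigT D → ∑ n ∈ Ico 1 ⌈x⌉₊, ‖xiZero c' D j n d r‖ / n ≤
        Cξp * ell D * (1 + Real.log x) ^ 3 := fun d r hd hr hdr x hx1 hx2 => by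
    have hlog : 0 ≤ 1 + Real.log x := by
      have := Real.log_nonneg hx1; linarith
    exact (Hξ D χ hDξ hq hp j hj d r hd hr hdr x hx1 hx2).trans
      (mul_le_mul_of_nonneg_right (mul_le_mul_of_nonneg_right (le_max_left _ _) hL0.le)
        (by positivity))
  have hgD : ∀ (μ : ℕ) (y : ℝ), |Real.log y| ≤ ell D ^ 9 → ‖frakgW c' D j μ y‖ ≤ Kg :=
    fun μ y hy => HKg D j μ y hL1 hy
  have main := norm_drSum_low_le c' χ hL3 hC₁0 hC₄0 hCξ0 hKg0 hM1 hM2 h84D hξD hgD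
  -- the transcendental quantities of the bound
  have hB0 : bigP D ^ (0.5 : ℝ) ≠ 0 := (Real.rpow_pos_of_pos (Real.exp_pos _) _).ne'
  have hBA : Real.log (bigP D ^ (0.5 : ℝ) / (bigP D ^ (0.5 : ℝ) / bigT D)) = Real.log (bigT D) := by
    rw [div_div_eq_mul_div, mul_div_cancel_left₀ _ hB0]
  rw [hBA] at main
  have hLp := ResidueValues.norm_deriv_LFunction_one_le χ hL3 hp
  have hlT : Real.log (bigT D) ≤ ell D ^ 2 := by rw [log_bigT]; exact rpow11_le_sq hL1
  have hlT0 : 0 ≤ Real.log (bigT D) := Real.log_nonneg one_le_bigT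
  have hTc : bigT D ^ (-c) ≤ Real.exp (-(c * ell D)) := by
    rw [bigT, ← Real.exp_mul, Real.exp_le_exp]
    have := self_le_rpow11 hL1
    nlinarith
  have hA1 : 1 ≤ bigP D ^ (0.5 : ℝ) / bigT D := one_le_sqrtP_div_T hL2
  have hlA0 : 0 ≤ Real.log ((bigP D ^ (0.5 : ℝ) / bigT D) / (1 / 2)) :=
    Real.log_nonneg (by rw [le_div_iff₀ (by norm_num : (0:ℝ) < 1 / 2)]; linarith)
  have hlA : Real.log ((bigP D ^ (0.5 : ℝ) / bigT D) / (1 / 2)) ≤ 1 + 0.5 * ell D ^ 9 := by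
    have hA0 : 0 < bigP D ^ (0.5 : ℝ) / bigT D := by linarith
    rw [Real.log_div hA0.ne' (by norm_num), Real.log_div hB0 hT0.ne', sqrtP_eq,
      Real.log_exp, log_bigT]
    have h2 : Real.log (1 / 2 : ℝ) = -Real.log 2 := by
      rw [one_div, Real.log_inv]
    have hlog2 : Real.log 2 ≤ 1 := by
      have := Real.log_le_sub_one_of_pos (show (0:ℝ) < 2 by norm_num); linarith
    have := rpow11_nonneg (D := D)
    rw [h2]
    linarith
  refine main.trans (endgame hL3 hc hε hC₁0 hC₄0 hCξ0 hKg0 (norm_nonneg _) hLp log_P1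
    (log_P2_ge hL2) hlT0 hlT hTc hlA0 hlA hT1 hT2) |>.trans ?_
  rw [alpha, log_bigP]

end Main


/-! ## Part G. The same deduction from the RELATIVE Lemma 8.4 (`Skeleton.Lemma84Rel`) — ZHANG-L lane

The absolute Lemma 8.4 (`Skeleton.Lemma84`) is not in the cone of `Skeleton.theorem1_of_leaves_v19`
(GAP row G-adj1-1); what the cone carries is the relative form `Skeleton.Lemma84Rel` (error
`C𝓛⁻⁶·(∏_{q∣dr}(1−q⁻¹)⁻¹)² = C𝓛⁻⁶(dr/φ(dr))²`, `Skeleton.lemma84Rel_of_lemma83Rel`). Running Parts D–F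
with this error costs one factor `(dr/φ(dr))² ≤ E(d)²E(r)²` (`E(n) = ∏_{q∣n}(1 + 2/q)`) in the pair
weights, i.e. the multiplicative majorant `∏_{q∣n}(1 + 214/q)` instead of `∏_{q∣n}(1 + 52/q)` and the
constant `4e⁴²⁸` instead of `4e¹⁰⁴` in the window sums — nothing else changes (seat zl-w10-p2, WP10;
consumer: the v19 leaf `Typed.Sec10B.Concl1321` via `concl1321_of_ranges`, claimant zl-w10-p4). -/

section RelWeights

/-- `(1 + 52/q)(1 + 2/q)² ≤ 1 + 214/q` termwise (`q ≥ 2`), so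
`∏_{q∣n}(1 + 52/q)·(∏_{q∣n}(1 + 2/q))² ≤ ∏_{q∣n}(1 + 214/q)`. [folklore] -/
private theorem prod52_mul_prod2_sq_le (n : ℕ) :
    (∏ q ∈ n.primeFactors, (1 + 52 / (q : ℝ))) * (∏ q ∈ n.primeFactors, (1 + 2 / (q : ℝ))) ^ 2 ≤
      ∏ q ∈ n.primeFactors, (1 + 214 / (q : ℝ)) := by
  rw [sq, ← prod_mul_distrib, ← prod_mul_distrib]
  refine prod_le_prod (fun q _ => by positivity) fun q hq => ?_
  have hq2 : (2 : ℝ) ≤ q := by exact_mod_cast (Nat.prime_of_mem_primeFactors hq).two_le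
  have hq0 : (0 : ℝ) < q := by linarith
  have ht0 : 0 ≤ 1 / (q : ℝ) := by positivity
  have ht : 1 / (q : ℝ) ≤ 1 / 2 := by
    rw [div_le_div_iff₀ hq0 (by norm_num)]; linarith
  have e1 : (1 + 52 / (q : ℝ)) * ((1 + 2 / q) * (1 + 2 / q)) =
      1 + 56 * (1 / q) + 212 * ((1 / q) * (1 / q)) + 208 * ((1 / q) * (1 / q) * (1 / q)) := by ring
  have e2 : (1 + 214 / (q : ℝ)) = 1 + 214 * (1 / q) := by ring
  rw [e1, e2]
  have h1 : (1 / (q : ℝ)) * (1 / q) ≤ (1 / q) * (1 / 2) := mul_le_mul_of_nonneg_left ht ht0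
  have h2 : (1 / (q : ℝ)) * (1 / q) * (1 / q) ≤ (1 / q) * (1 / 2) * (1 / 2) :=
    mul_le_mul (mul_le_mul_of_nonneg_left ht ht0) ht ht0 (by positivity)
  linarith

/-- `∏_{q∣n}(1 − q⁻¹)⁻¹ = n/φ(n)` (`n ≠ 0`; Euler's product). [cite: Zhang2022LandauSiegel, §10 p. 58] -/
theorem prod_one_sub_inv_inv_eq_self_div_totient {n : ℕ} (hn : n ≠ 0) :
    ∏ q ∈ n.primeFactors, (1 - (q : ℝ)⁻¹)⁻¹ = (n : ℝ) / (Nat.totient n : ℝ) := by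
  have hnR : (0 : ℝ) < n := by exact_mod_cast Nat.pos_of_ne_zero hn
  symm
  rw [MertensBound.totient_eq_mul_prod_one_sub_inv n, div_mul_eq_div_div, div_self hnR.ne',
    one_div, ← prod_inv_distrib]
  refine prod_congr rfl fun q _ => ?_
  rw [one_div]

/-- **The pointwise weight bound with the relative factor**: for `d, r ≥ 1`,
`|λ₀ⱼ(dr)|(1 + |Π(d,r)|)/(drφ(r))·(dr/φ(dr))² ≤ 2·G′(d)/d·G′(r)/r²`, `G′(n) = ∏_{q∣n}(1 + 214/q)`
(`pairWeight_le`, `dr/φ(dr) ≤ E(d)E(r)` with `E(n) = ∏_{q∣n}(1 + 2/q)`, and `prod52_mul_prod2_sq_le`).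
[cite: Zhang2022LandauSiegel, §7 p.34; §8 Lemma 8.3] -/
theorem pairWeightRel_le (c' : ℝ) (D : ℕ) (χ : DirichletCharacter ℂ D) (j : ℕ) {d r : ℕ}
    (hd : d ≠ 0) (hr : r ≠ 0) :
    ‖lamZero c' D j (d * r)‖ * (1 + ‖PiW χ d r‖) / ((d : ℝ) * r * (Nat.totient r : ℝ)) *
        (((d * r : ℕ) : ℝ) / (Nat.totient (d * r) : ℝ)) ^ 2 ≤
      2 * ((∏ q ∈ d.primeFactors, (1 + 214 / (q : ℝ))) / d) *
        ((∏ q ∈ r.primeFactors, (1 + 214 / (q : ℝ))) / (r : ℝ) ^ 2) := by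
  have hdR : (0 : ℝ) < d := by exact_mod_cast Nat.pos_of_ne_zero hd
  have hrR : (0 : ℝ) < r := by exact_mod_cast Nat.pos_of_ne_zero hr
  set Gd : ℝ := ∏ q ∈ d.primeFactors, (1 + 52 / (q : ℝ)) with hGd
  set Gr : ℝ := ∏ q ∈ r.primeFactors, (1 + 52 / (q : ℝ)) with hGr
  set Ed : ℝ := ∏ q ∈ d.primeFactors, (1 + 2 / (q : ℝ)) with hEd
  set Er : ℝ := ∏ q ∈ r.primeFactors, (1 + 2 / (q : ℝ)) with hEr
  have hEd0 : 0 ≤ Ed := prod_nonneg fun q _ => by positivity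
  have hEr0 : 0 ≤ Er := prod_nonneg fun q _ => by positivity
  have hGd0 : 0 ≤ Gd := prod_nonneg fun q _ => by positivity
  have hGr0 : 0 ≤ Gr := prod_nonneg fun q _ => by positivity
  have h1 := pairWeight_le c' D χ j hd hr
  have hρ0 : 0 ≤ ((d * r : ℕ) : ℝ) / (Nat.totient (d * r) : ℝ) := by positivity
  have hρ : ((d * r : ℕ) : ℝ) / (Nat.totient (d * r) : ℝ) ≤ Ed * Er :=
    (self_div_totient_le (mul_ne_zero hd hr)).trans (prod_primeFactors_mul_le (by norm_num) hd hr)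
  have hw0 : 0 ≤ ‖lamZero c' D j (d * r)‖ * (1 + ‖PiW χ d r‖) /
      ((d : ℝ) * r * (Nat.totient r : ℝ)) := by positivity
  have hGd' : Gd * Ed ^ 2 ≤ ∏ q ∈ d.primeFactors, (1 + 214 / (q : ℝ)) := prod52_mul_prod2_sq_le d
  have hGr' : Gr * Er ^ 2 ≤ ∏ q ∈ r.primeFactors, (1 + 214 / (q : ℝ)) := prod52_mul_prod2_sq_le r
  calc ‖lamZero c' D j (d * r)‖ * (1 + ‖PiW χ d r‖) / ((d : ℝ) * r * (Nat.totient r : ℝ)) *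
        (((d * r : ℕ) : ℝ) / (Nat.totient (d * r) : ℝ)) ^ 2
      ≤ (2 * (Gd / d) * (Gr / (r : ℝ) ^ 2)) * (Ed * Er) ^ 2 :=
        mul_le_mul h1 (pow_le_pow_left₀ hρ0 hρ 2) (by positivity) (by positivity)
    _ = 2 * ((Gd * Ed ^ 2) / d) * ((Gr * Er ^ 2) / (r : ℝ) ^ 2) := by ring
    _ ≤ 2 * ((∏ q ∈ d.primeFactors, (1 + 214 / (q : ℝ))) / d) *
          ((∏ q ∈ r.primeFactors, (1 + 214 / (q : ℝ))) / (r : ℝ) ^ 2) := by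
        gcongr

/-- **Window sum of the relative `(d,r)`-weights**: for `0 < A ≤ B`,
`Σ_{d,r < N, A < dr ≤ B} |λ₀ⱼ(dr)|(1 + |Π(d,r)|)(dr/φ(dr))²/(drφ(r)) ≤ 4e⁴²⁸(1 + log(B/A))`.
[cite: Zhang2022LandauSiegel, §10 p. 58] -/
theorem pairSum_window_rel_le (c' : ℝ) (D : ℕ) (χ : DirichletCharacter ℂ D) (j N : ℕ) {A B : ℝ}
    (hA : 0 < A) (hAB : A ≤ B) :
    ∑ d ∈ Ico 1 N, ∑ r ∈ Ico 1 N,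
      (if A < ((d * r : ℕ) : ℝ) ∧ ((d * r : ℕ) : ℝ) ≤ B then
        ‖lamZero c' D j (d * r)‖ * (1 + ‖PiW χ d r‖) / ((d : ℝ) * r * (Nat.totient r : ℝ)) *
          (((d * r : ℕ) : ℝ) / (Nat.totient (d * r) : ℝ)) ^ 2
      else 0) ≤ 4 * Real.exp 428 * (1 + Real.log (B / A)) := by
  set G : ℕ → ℝ := fun n => ∏ q ∈ n.primeFactors, (1 + 214 / (q : ℝ)) with hG
  have hG0 : ∀ n, 0 ≤ G n := fun n => prod_nonneg fun q _ => by positivity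
  have hlog : 0 ≤ 1 + Real.log (B / A) := by
    have : 0 ≤ Real.log (B / A) := Real.log_nonneg (by rw [le_div_iff₀ hA]; linarith)
    linarith
  -- pointwise
  have step1 : ∑ d ∈ Ico 1 N, ∑ r ∈ Ico 1 N,
      (if A < ((d * r : ℕ) : ℝ) ∧ ((d * r : ℕ) : ℝ) ≤ B then
        ‖lamZero c' D j (d * r)‖ * (1 + ‖PiW χ d r‖) / ((d : ℝ) * r * (Nat.totient r : ℝ)) *
          (((d * r : ℕ) : ℝ) / (Nat.totient (d * r) : ℝ)) ^ 2
      else 0) ≤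
      ∑ d ∈ Ico 1 N, ∑ r ∈ Ico 1 N,
        (if A < ((d * r : ℕ) : ℝ) ∧ ((d * r : ℕ) : ℝ) ≤ B then 2 * (G d / d) * (G r / (r : ℝ) ^ 2)
        else 0) := by
    refine sum_le_sum fun d hd => sum_le_sum fun r hr => ?_
    have hd0 : d ≠ 0 := by have := (mem_Ico.mp hd).1; omega
    have hr0 : r ≠ 0 := by have := (mem_Ico.mp hr).1; omega
    split_ifs
    · exact pairWeightRel_le c' D χ j hd0 hr0
    · exact le_refl _
  -- swap and factor
  have step2 : ∑ d ∈ Ico 1 N, ∑ r ∈ Ico 1 N,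
        (if A < ((d * r : ℕ) : ℝ) ∧ ((d * r : ℕ) : ℝ) ≤ B then 2 * (G d / d) * (G r / (r : ℝ) ^ 2)
        else 0) =
      ∑ r ∈ Ico 1 N, (2 * (G r / (r : ℝ) ^ 2)) *
        ∑ d ∈ Ico 1 N, (if A < ((d * r : ℕ) : ℝ) ∧ ((d * r : ℕ) : ℝ) ≤ B then G d / d else 0) := by
    rw [sum_comm]
    refine sum_congr rfl fun r _ => ?_
    rw [mul_sum]
    refine sum_congr rfl fun d _ => ?_
    split_ifs <;> ring
  -- the inner window sums
  have step3 : ∀ r ∈ Ico 1 N,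
      ∑ d ∈ Ico 1 N, (if A < ((d * r : ℕ) : ℝ) ∧ ((d * r : ℕ) : ℝ) ≤ B then G d / d else 0) ≤
        Real.exp 214 * (1 + Real.log (B / A)) := by
    intro r hr
    have hr0 : (0 : ℝ) < r := by exact_mod_cast (mem_Ico.mp hr).1
    rw [← sum_filter]
    have hflt : (Ico 1 N).filter (fun d => A < ((d * r : ℕ) : ℝ) ∧ ((d * r : ℕ) : ℝ) ≤ B) =
        (Ico 1 N).filter (fun d : ℕ => A / r < (d : ℝ) ∧ (d : ℝ) ≤ B / r) := by
      refine filter_congr fun d _ => ?_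
      push_cast
      rw [div_lt_iff₀ hr0, le_div_iff₀ hr0]
    rw [hflt]
    have h := sum_prod_window_le (c := 214) (by norm_num) N (div_pos hA hr0)
      (div_le_div_of_nonneg_right hAB hr0.le)
    rwa [div_div_div_cancel_right₀ hr0.ne'] at h
  calc _ ≤ _ := step1
    _ = _ := step2
    _ ≤ ∑ r ∈ Ico 1 N, (2 * (G r / (r : ℝ) ^ 2)) * (Real.exp 214 * (1 + Real.log (B / A))) :=
        sum_le_sum fun r hr => mul_le_mul_of_nonneg_left (step3 r hr)
          (mul_nonneg zero_le_two (div_nonneg (hG0 r) (sq_nonneg _)))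
    _ = 2 * (Real.exp 214 * (1 + Real.log (B / A))) * ∑ r ∈ Ico 1 N, G r / (r : ℝ) ^ 2 := by
        rw [mul_sum]
        refine sum_congr rfl fun r _ => ?_
        ring
    _ ≤ 2 * (Real.exp 214 * (1 + Real.log (B / A))) * (2 * Real.exp 214) := by
        gcongr
        exact sum_prod_div_sq_le (by norm_num) N
    _ = 4 * Real.exp 428 * (1 + Real.log (B / A)) := by
        rw [show (428 : ℝ) = 214 + 214 by norm_num, Real.exp_add]; ring

end RelWeights

/-! ### Part G.D. The `n`-sum with a LOCAL Lemma-8.4 error `E` at the pair `(d,r)` -/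

section NSumRel

variable (c' : ℝ) {D : ℕ} [NeZero D] (χ : DirichletCharacter ℂ D)

/-- **The `conj ϰ₁`-part, local error**: for `1 ≤ d, r`, `dr < P^{1/2}`, if Lemma 8.4 (`μ = 6`) holds
AT `(d,r)` with error `E ≥ 0`, then `‖Σ_n χ(n)conj ϰ₁(drn)ξ₀ⱼ(n;d,r)/n‖ ≤ (log P₁)⁻¹(|L′(1,χ)|K_g + E)(1 + |Π(d,r)|)`.
[cite: Zhang2022LandauSiegel, §10 p. 58; §8 Lemma 8.4] -/
theorem norm_S1_le_loc (hL : 3 ≤ ell D) {j : ℕ} {E Kg : ℝ} (hE : 0 ≤ E) (hKg : 0 ≤ Kg) {d r : ℕ}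
    (h84 : ∀ μ ∈ ({6, 7} : Finset ℕ),
      ((d * r : ℕ) : ℝ) < bigP D / bigT D ^ 2 → ∀ y : ℝ, bigT D < y → y < bigP D →
        ‖(∑ n ∈ Ico 1 ⌈y⌉₊, χ (n : ZMod D) * xiZero c' D j n d r / (n : ℂ) *
              ((y / n : ℝ) : ℂ) ^ (-betaMu D μ) * (Real.log (y / n) : ℂ)) -
            deriv χ.LFunction 1 * PiW χ d r * frakgW c' D j μ y‖ ≤ E)
    (hg : ∀ (μ : ℕ) (y : ℝ), |Real.log y| ≤ ell D ^ 9 → ‖frakgW c' D j μ y‖ ≤ Kg)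
    (hd : 1 ≤ d) (hr : 1 ≤ r) (hdr : ((d * r : ℕ) : ℝ) < bigP D ^ (0.5 : ℝ)) :
    ‖∑ n ∈ Ico 1 (Nsupp D),
        χ (n : ZMod D) * conj (vk1 D (d * r * n)) * xiZero c' D j n d r / (n : ℂ)‖ ≤
      1 / Real.log (Skeleton.P1 D) * ((‖deriv χ.LFunction 1‖ * Kg + E) * (1 + ‖PiW χ d r‖)) := by
  have hL0 : 0 < ell D := by linarith
  have hL2 : 2 ≤ ell D := by linarith
  have hP1 : 1 < Skeleton.P1 D := one_lt_P1 hL0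
  have hlogP1 : 0 < Real.log (Skeleton.P1 D) := Real.log_pos hP1
  have hdr0 : (0 : ℝ) < ((d * r : ℕ) : ℝ) := by exact_mod_cast Nat.mul_pos hd hr
  have hdr1 : (1 : ℝ) ≤ ((d * r : ℕ) : ℝ) := by exact_mod_cast Nat.mul_pos hd hr
  set x : ℝ := Skeleton.P1 D / ((d * r : ℕ) : ℝ) with hx
  have hxle : x ≤ Skeleton.P1 D := div_le_self (by linarith) hdr1
  have hN : ⌈x⌉₊ ≤ Nsupp D := by
    unfold Nsupp
    exact Nat.ceil_mono (hxle.trans (P1_le_PT2 hL2))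
  have hdrPT : ((d * r : ℕ) : ℝ) < bigP D / bigT D ^ 2 :=
    lt_of_lt_of_le hdr (sqrtP_le_P1.trans (P1_le_PT2 hL2))
  have hTx : bigT D < x := bigT_lt_P1_div hL hdr0 hdr
  have hxP : x < bigP D := lt_of_le_of_lt hxle (P1_lt_bigP hL0)
  have hx1 : 1 ≤ x := le_trans one_le_bigT hTx.le
  have h := h84 6 (by simp) hdrPT x hTx hxP
  have hgx : ‖frakgW c' D j 6 x‖ ≤ Kg := hg 6 x (abs_log_le_of hx1 hxP.le)
  have hS := norm_le_of_lemma84 hE hKg h hgx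
  rw [conjVk1Sum_eq c' χ j hd hr hP1 hN, norm_mul, norm_div, norm_one, Complex.norm_real,
    Real.norm_of_nonneg hlogP1.le]
  exact mul_le_mul_of_nonneg_left hS (by positivity)

/-- **The `conj ϰ₂`-part, local error**, all `dr < P^{1/2}`: with `x = P₂/(dr)`, either `x ≤ 1`
(empty sum), or `T < x` (Lemma 8.4 at `(d,r)`, `μ = 7`, error `E`), or `1 < x ≤ T` (the crude bound and
the `ξ₀`-tail mean). [cite: Zhang2022LandauSiegel, §10 p. 58; §8 Lemma 8.4] -/
theorem norm_S2_le_loc (hL : 3 ≤ ell D) {j : ℕ} {E Cξ Kg : ℝ} (hE : 0 ≤ E) (hCξ : 0 ≤ Cξ)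
    (hKg : 0 ≤ Kg) {d r : ℕ}
    (h84 : ∀ μ ∈ ({6, 7} : Finset ℕ),
      ((d * r : ℕ) : ℝ) < bigP D / bigT D ^ 2 → ∀ y : ℝ, bigT D < y → y < bigP D →
        ‖(∑ n ∈ Ico 1 ⌈y⌉₊, χ (n : ZMod D) * xiZero c' D j n d r / (n : ℂ) *
              ((y / n : ℝ) : ℂ) ^ (-betaMu D μ) * (Real.log (y / n) : ℂ)) -
            deriv χ.LFunction 1 * PiW χ d r * frakgW c' D j μ y‖ ≤ E)
    (hξ : ((d * r : ℕ) : ℝ) < Skeleton.P1 D → ∀ x : ℝ, 1 ≤ x →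
      x ≤ bigT D → ∑ n ∈ Ico 1 ⌈x⌉₊, ‖xiZero c' D j n d r‖ / n ≤
        Cξ * ell D * (1 + Real.log x) ^ 3)
    (hg : ∀ (μ : ℕ) (y : ℝ), |Real.log y| ≤ ell D ^ 9 → ‖frakgW c' D j μ y‖ ≤ Kg)
    (hd : 1 ≤ d) (hr : 1 ≤ r) (hdr : ((d * r : ℕ) : ℝ) < bigP D ^ (0.5 : ℝ)) :
    ‖∑ n ∈ Ico 1 (Nsupp D),
        χ (n : ZMod D) * conj (vk2 D (d * r * n)) * xiZero c' D j n d r / (n : ℂ)‖ ≤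
      1 / Real.log (Skeleton.P2 D) *
        ((‖deriv χ.LFunction 1‖ * Kg + E + Cξ * ell D * (1 + Real.log (bigT D)) ^ 4) *
          (1 + ‖PiW χ d r‖)) := by
  have hL0 : 0 < ell D := by linarith
  have hL2 : 2 ≤ ell D := by linarith
  have hP2 : 1 < Skeleton.P2 D := one_lt_P2 hL2
  have hlogP2 : 0 < Real.log (Skeleton.P2 D) := Real.log_pos hP2
  have hdr0 : (0 : ℝ) < ((d * r : ℕ) : ℝ) := by exact_mod_cast Nat.mul_pos hd hr
  have hdr1 : (1 : ℝ) ≤ ((d * r : ℕ) : ℝ) := by exact_mod_cast Nat.mul_pos hd hr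
  set x : ℝ := Skeleton.P2 D / ((d * r : ℕ) : ℝ) with hx
  have hxle : x ≤ Skeleton.P2 D := div_le_self (by linarith) hdr1
  have hN : ⌈x⌉₊ ≤ Nsupp D := by
    unfold Nsupp
    exact Nat.ceil_mono (hxle.trans (P2_le_P1.trans (P1_le_PT2 hL2)))
  have hdrPT : ((d * r : ℕ) : ℝ) < bigP D / bigT D ^ 2 :=
    lt_of_lt_of_le hdr (sqrtP_le_P1.trans (P1_le_PT2 hL2))
  have hdrP1 : ((d * r : ℕ) : ℝ) < Skeleton.P1 D := lt_of_lt_of_le hdr sqrtP_le_P1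
  have hxP : x < bigP D := lt_of_le_of_lt hxle (lt_of_le_of_lt P2_le_P1 (P1_lt_bigP hL0))
  have hPi := norm_nonneg (PiW χ d r)
  have hLp := norm_nonneg (deriv χ.LFunction 1)
  have hlogT : 0 ≤ Real.log (bigT D) := Real.log_nonneg one_le_bigT
  have hQ0 : 0 ≤ ‖deriv χ.LFunction 1‖ * Kg + E := by positivity
  have hX0 : 0 ≤ Cξ * ell D * (1 + Real.log (bigT D)) ^ 4 := by positivity
  rw [conjVk2Sum_eq c' χ j hd hr hP2 hN, norm_mul, norm_div, norm_one, Complex.norm_real,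
    Real.norm_of_nonneg hlogP2.le]
  refine mul_le_mul_of_nonneg_left ?_ (by positivity)
  -- the three cases
  rcases le_or_gt x 1 with hx1 | hx1
  · have hc : ⌈x⌉₊ ≤ 1 := Nat.ceil_le.mpr (by simpa using hx1)
    rw [Finset.Ico_eq_empty_of_le hc, sum_empty, norm_zero]
    positivity
  rcases lt_or_ge (bigT D) x with hTx | hxT
  · have h := h84 7 (by simp) hdrPT x hTx hxP
    have hgx : ‖frakgW c' D j 7 x‖ ≤ Kg := hg 7 x (abs_log_le_of hx1.le hxP.le)
    have hS := norm_le_of_lemma84 hE hKg h hgx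
    refine hS.trans ?_
    have : ‖deriv χ.LFunction 1‖ * Kg + E ≤
        ‖deriv χ.LFunction 1‖ * Kg + E + Cξ * ell D * (1 + Real.log (bigT D)) ^ 4 := by linarith
    gcongr
  · have hξx := hξ hdrP1 x hx1.le hxT
    have hcr := norm_sum84_le_log_mul c' χ j 7 d r hx1.le
    have hlogx : Real.log x ≤ Real.log (bigT D) := Real.log_le_log (by linarith) hxT
    have hlogx0 : 0 ≤ Real.log x := Real.log_nonneg hx1.le
    calc _ ≤ Real.log x * ∑ n ∈ Ico 1 ⌈x⌉₊, ‖xiZero c' D j n d r‖ / n := hcr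
      _ ≤ Real.log (bigT D) * (Cξ * ell D * (1 + Real.log x) ^ 3) :=
          mul_le_mul hlogx hξx (sum_nonneg fun n _ => by positivity) hlogT
      _ ≤ (1 + Real.log (bigT D)) * (Cξ * ell D * (1 + Real.log (bigT D)) ^ 3) := by
          gcongr
          · linarith
      _ = Cξ * ell D * (1 + Real.log (bigT D)) ^ 4 := by ring
      _ ≤ (‖deriv χ.LFunction 1‖ * Kg + E + Cξ * ell D * (1 + Real.log (bigT D)) ^ 4) * 1 := by
          linarith
      _ ≤ (‖deriv χ.LFunction 1‖ * Kg + E + Cξ * ell D * (1 + Real.log (bigT D)) ^ 4) *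
            (1 + ‖PiW χ d r‖) :=
          mul_le_mul_of_nonneg_left (by linarith) (by positivity)

/-- **The `n`-sum, low zone, local error** (`1 ≤ dr < P^{1/2}`):
`‖nSum21‖ ≤ ((log P₁)⁻¹ + 2(log P₂)⁻¹)(|L′|K_g + E + C_ξ𝓛(1 + log T)⁴)(1 + |Π(d,r)|)`.
[cite: Zhang2022LandauSiegel, §10 p. 58] -/
theorem norm_nSum21_le_loc (hL : 3 ≤ ell D) {j : ℕ} {E Cξ Kg : ℝ} (hE : 0 ≤ E) (hCξ : 0 ≤ Cξ)
    (hKg : 0 ≤ Kg) {d r : ℕ}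
    (h84 : ∀ μ ∈ ({6, 7} : Finset ℕ),
      ((d * r : ℕ) : ℝ) < bigP D / bigT D ^ 2 → ∀ y : ℝ, bigT D < y → y < bigP D →
        ‖(∑ n ∈ Ico 1 ⌈y⌉₊, χ (n : ZMod D) * xiZero c' D j n d r / (n : ℂ) *
              ((y / n : ℝ) : ℂ) ^ (-betaMu D μ) * (Real.log (y / n) : ℂ)) -
            deriv χ.LFunction 1 * PiW χ d r * frakgW c' D j μ y‖ ≤ E)
    (hξ : ((d * r : ℕ) : ℝ) < Skeleton.P1 D → ∀ x : ℝ, 1 ≤ x →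
      x ≤ bigT D → ∑ n ∈ Ico 1 ⌈x⌉₊, ‖xiZero c' D j n d r‖ / n ≤
        Cξ * ell D * (1 + Real.log x) ^ 3)
    (hg : ∀ (μ : ℕ) (y : ℝ), |Real.log y| ≤ ell D ^ 9 → ‖frakgW c' D j μ y‖ ≤ Kg)
    (hd : 1 ≤ d) (hr : 1 ≤ r) (hdr : ((d * r : ℕ) : ℝ) < bigP D ^ (0.5 : ℝ)) :
    ‖nSum21 c' χ j d r‖ ≤
      (1 / Real.log (Skeleton.P1 D) + 2 / Real.log (Skeleton.P2 D)) *
        (‖deriv χ.LFunction 1‖ * Kg + E + Cξ * ell D * (1 + Real.log (bigT D)) ^ 4) *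
          (1 + ‖PiW χ d r‖) := by
  have hL2 : 2 ≤ ell D := by linarith
  have hlogP1 : 0 < Real.log (Skeleton.P1 D) := Real.log_pos (one_lt_P1 (by linarith))
  have hlogP2 : 0 < Real.log (Skeleton.P2 D) := Real.log_pos (one_lt_P2 hL2)
  have h1 := norm_S1_le_loc c' χ hL hE hKg h84 hg hd hr hdr
  have h2 := norm_S2_le_loc c' χ hL hE hCξ hKg h84 hξ hg hd hr hdr
  have hPi := norm_nonneg (PiW χ d r)
  have hlogT : 0 ≤ Real.log (bigT D) := Real.log_nonneg one_le_bigT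
  have hQ0 : 0 ≤ ‖deriv χ.LFunction 1‖ * Kg + E := by positivity
  have hX0 : 0 ≤ Cξ * ell D * (1 + Real.log (bigT D)) ^ 4 := by positivity
  rw [nSum21_eq]
  calc _ ≤ ‖∑ n ∈ Ico 1 (Nsupp D),
            χ (n : ZMod D) * conj (vk1 D (d * r * n)) * xiZero c' D j n d r / (n : ℂ)‖ +
          ‖conj iota2 * ∑ n ∈ Ico 1 (Nsupp D),
            χ (n : ZMod D) * conj (vk2 D (d * r * n)) * xiZero c' D j n d r / (n : ℂ)‖ :=
        norm_add_le _ _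
    _ ≤ 1 / Real.log (Skeleton.P1 D) * ((‖deriv χ.LFunction 1‖ * Kg + E) * (1 + ‖PiW χ d r‖)) +
          2 * (1 / Real.log (Skeleton.P2 D) *
            ((‖deriv χ.LFunction 1‖ * Kg + E + Cξ * ell D * (1 + Real.log (bigT D)) ^ 4) *
              (1 + ‖PiW χ d r‖))) := by
        rw [norm_mul, Complex.norm_conj]
        exact add_le_add h1 (mul_le_mul norm_iota2_le h2 (norm_nonneg _) zero_le_two)
    _ ≤ 1 / Real.log (Skeleton.P1 D) *
            ((‖deriv χ.LFunction 1‖ * Kg + E + Cξ * ell D * (1 + Real.log (bigT D)) ^ 4) *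
              (1 + ‖PiW χ d r‖)) +
          2 * (1 / Real.log (Skeleton.P2 D) *
            ((‖deriv χ.LFunction 1‖ * Kg + E + Cξ * ell D * (1 + Real.log (bigT D)) ^ 4) *
              (1 + ‖PiW χ d r‖))) := by
        have hle : (‖deriv χ.LFunction 1‖ * Kg + E) * (1 + ‖PiW χ d r‖) ≤
            (‖deriv χ.LFunction 1‖ * Kg + E + Cξ * ell D * (1 + Real.log (bigT D)) ^ 4) *
              (1 + ‖PiW χ d r‖) :=
          mul_le_mul_of_nonneg_right (by linarith) (by positivity)
        exact add_le_add (mul_le_mul_of_nonneg_left hle (by positivity)) le_rfl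
    _ = _ := by ring

/-- **The `n`-sum, window zone, local error** (`P^{1/2}/T < dr < P^{1/2}`): only the `conj ϰ₁`-part
survives. [cite: Zhang2022LandauSiegel, §10 p. 58] -/
theorem norm_nSum21_le_window_loc (hL : 3 ≤ ell D) {j : ℕ} {E Kg : ℝ} (hE : 0 ≤ E) (hKg : 0 ≤ Kg)
    {d r : ℕ}
    (h84 : ∀ μ ∈ ({6, 7} : Finset ℕ),
      ((d * r : ℕ) : ℝ) < bigP D / bigT D ^ 2 → ∀ y : ℝ, bigT D < y → y < bigP D →
        ‖(∑ n ∈ Ico 1 ⌈y⌉₊, χ (n : ZMod D) * xiZero c' D j n d r / (n : ℂ) *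
              ((y / n : ℝ) : ℂ) ^ (-betaMu D μ) * (Real.log (y / n) : ℂ)) -
            deriv χ.LFunction 1 * PiW χ d r * frakgW c' D j μ y‖ ≤ E)
    (hg : ∀ (μ : ℕ) (y : ℝ), |Real.log y| ≤ ell D ^ 9 → ‖frakgW c' D j μ y‖ ≤ Kg)
    (hd : 1 ≤ d) (hr : 1 ≤ r) (hlo : bigP D ^ (0.5 : ℝ) / bigT D < ((d * r : ℕ) : ℝ))
    (hdr : ((d * r : ℕ) : ℝ) < bigP D ^ (0.5 : ℝ)) :
    ‖nSum21 c' χ j d r‖ ≤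
      1 / Real.log (Skeleton.P1 D) * ((‖deriv χ.LFunction 1‖ * Kg + E) * (1 + ‖PiW χ d r‖)) := by
  rw [nSum21_eq, S2_eq_zero c' χ j hlo, mul_zero, add_zero]
  exact norm_S1_le_loc c' χ hL hE hKg h84 hg hd hr hdr

end NSumRel

/-! ### Part G.E. The `(d,r)`-sum over `dr < P^{1/2}` from the RELATIVE Lemma 8.4 -/

section AssemblyRel

variable (c' : ℝ) {D : ℕ} [NeZero D] (χ : DirichletCharacter ℂ D)

/-- **The `(d,r)`-sum of `S_j(𝐚₁₃,𝐚₂₁)` over `dr < P^{1/2}`, explicit bound from the RELATIVE Lemma 8.4**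
(error `C₄𝓛⁻⁶(∏_{q∣dr}(1−q⁻¹)⁻¹)² = C₄𝓛⁻⁶(dr/φ(dr))²`): the bound of `norm_drSum_low_le` with the window
constant `4e⁴²⁸` (`pairSum_window_rel_le`) in place of `4e¹⁰⁴`. [cite: Zhang2022LandauSiegel, §10 p. 58] -/
theorem norm_drSum_low_le_rel (hL : 3 ≤ ell D) {j : ℕ} {c C₁ C₄ Cξ Kg : ℝ} (hC₁ : 0 ≤ C₁)
    (hC₄ : 0 ≤ C₄) (hCξ : 0 ≤ Cξ) (hKg : 0 ≤ Kg)
    (hM1 : ∀ y : ℝ, 1 ≤ y → y ≤ bigP D ^ (0.5 : ℝ) / bigT D →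
      ‖frakv1 c' χ j y‖ ≤ C₁ * bigT D ^ (-c))
    (hM2 : ∀ y : ℝ, bigP D ^ (0.5 : ℝ) / bigT D < y → y ≤ bigP D ^ (0.5 : ℝ) →
      ‖frakv1 c' χ j y‖ ≤ C₁ * (ell D ^ 7)⁻¹)
    (h84 : ∀ μ ∈ ({6, 7} : Finset ℕ), ∀ d r : ℕ, 1 ≤ d → 1 ≤ r →
      ((d * r : ℕ) : ℝ) < bigP D / bigT D ^ 2 → ∀ y : ℝ, bigT D < y → y < bigP D →
        ‖(∑ n ∈ Ico 1 ⌈y⌉₊, χ (n : ZMod D) * xiZero c' D j n d r / (n : ℂ) *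
              ((y / n : ℝ) : ℂ) ^ (-betaMu D μ) * (Real.log (y / n) : ℂ)) -
            deriv χ.LFunction 1 * PiW χ d r * frakgW c' D j μ y‖ ≤
          C₄ * (ell D ^ 6)⁻¹ * (∏ q ∈ (d * r).primeFactors, (1 - (q : ℝ)⁻¹)⁻¹) ^ 2)
    (hξ : ∀ d r : ℕ, 1 ≤ d → 1 ≤ r → ((d * r : ℕ) : ℝ) < Skeleton.P1 D → ∀ x : ℝ, 1 ≤ x →
      x ≤ bigT D → ∑ n ∈ Ico 1 ⌈x⌉₊, ‖xiZero c' D j n d r‖ / n ≤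
        Cξ * ell D * (1 + Real.log x) ^ 3)
    (hg : ∀ (μ : ℕ) (y : ℝ), |Real.log y| ≤ ell D ^ 9 → ‖frakgW c' D j μ y‖ ≤ Kg) :
    ‖drSum c' χ j (mSum13 c' χ j) (nSum21 c' χ j) 0 (bigP D ^ (0.5 : ℝ))‖ ≤
      C₁ * bigT D ^ (-c) *
          ((1 / Real.log (Skeleton.P1 D) + 2 / Real.log (Skeleton.P2 D)) *
            (‖deriv χ.LFunction 1‖ * Kg + C₄ + Cξ * ell D * (1 + Real.log (bigT D)) ^ 4)) *
          (4 * Real.exp 428 * (1 + Real.log ((bigP D ^ (0.5 : ℝ) / bigT D) / (1 / 2)))) +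
        C₁ * (ell D ^ 7)⁻¹ *
          (1 / Real.log (Skeleton.P1 D) * (‖deriv χ.LFunction 1‖ * Kg + C₄)) *
          (4 * Real.exp 428 *
            (1 + Real.log (bigP D ^ (0.5 : ℝ) / (bigP D ^ (0.5 : ℝ) / bigT D)))) := by
  have hL1 : 1 ≤ ell D := by linarith
  have hL2 : 2 ≤ ell D := by linarith
  have hlogP1 : 0 < Real.log (Skeleton.P1 D) := Real.log_pos (one_lt_P1 (by linarith))
  have hlogP2 : 0 < Real.log (Skeleton.P2 D) := Real.log_pos (one_lt_P2 hL2)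
  have hT0 : 0 < bigT D := Real.exp_pos _
  have hTc : 0 < bigT D ^ (-c) := Real.rpow_pos_of_pos hT0 _
  have hlogT : 0 ≤ Real.log (bigT D) := Real.log_nonneg one_le_bigT
  have hA1 : 1 ≤ bigP D ^ (0.5 : ℝ) / bigT D := one_le_sqrtP_div_T hL2
  have hA0 : 0 < bigP D ^ (0.5 : ℝ) / bigT D := by linarith
  have hhalfA : (1 / 2 : ℝ) ≤ bigP D ^ (0.5 : ℝ) / bigT D := by linarith
  have hAB : bigP D ^ (0.5 : ℝ) / bigT D ≤ bigP D ^ (0.5 : ℝ) := div_le_self sqrtP_nonneg one_le_bigT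
  have hL7 : 0 < (ell D ^ 7)⁻¹ := by positivity
  have hl6 : (ell D ^ 6)⁻¹ ≤ 1 := inv_le_one_of_one_le₀ (one_le_pow₀ hL1)
  -- the two `n`-sum constants
  set NB₁ : ℝ := (1 / Real.log (Skeleton.P1 D) + 2 / Real.log (Skeleton.P2 D)) *
      (‖deriv χ.LFunction 1‖ * Kg + C₄ + Cξ * ell D * (1 + Real.log (bigT D)) ^ 4) with hNB₁
  set NB₂ : ℝ := 1 / Real.log (Skeleton.P1 D) * (‖deriv χ.LFunction 1‖ * Kg + C₄) with hNB₂
  have hNB₁0 : 0 ≤ NB₁ := by rw [hNB₁]; positivity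
  have hNB₂0 : 0 ≤ NB₂ := by rw [hNB₂]; positivity
  have ha0 : 0 ≤ C₁ * bigT D ^ (-c) * NB₁ := by positivity
  have hb0 : 0 ≤ C₁ * (ell D ^ 7)⁻¹ * NB₂ := by positivity
  -- pointwise bound in the two zones
  have hpt : ∀ d ∈ Ico 1 (Nsupp D), ∀ r ∈ Ico 1 (Nsupp D),
      ‖(if (0 : ℝ) ≤ ((d * r : ℕ) : ℝ) ∧ ((d * r : ℕ) : ℝ) < bigP D ^ (0.5 : ℝ) then
          drWeight c' χ j d r * mSum13 c' χ j (d * r) * nSum21 c' χ j d r else 0)‖ ≤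
        C₁ * bigT D ^ (-c) * NB₁ *
            (if 1 / 2 < ((d * r : ℕ) : ℝ) ∧ ((d * r : ℕ) : ℝ) ≤ bigP D ^ (0.5 : ℝ) / bigT D then
              ‖lamZero c' D j (d * r)‖ * (1 + ‖PiW χ d r‖) / ((d : ℝ) * r * (Nat.totient r : ℝ)) *
                (((d * r : ℕ) : ℝ) / (Nat.totient (d * r) : ℝ)) ^ 2
            else 0) +
          C₁ * (ell D ^ 7)⁻¹ * NB₂ *
            (if bigP D ^ (0.5 : ℝ) / bigT D < ((d * r : ℕ) : ℝ) ∧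
                ((d * r : ℕ) : ℝ) ≤ bigP D ^ (0.5 : ℝ) then
              ‖lamZero c' D j (d * r)‖ * (1 + ‖PiW χ d r‖) / ((d : ℝ) * r * (Nat.totient r : ℝ)) *
                (((d * r : ℕ) : ℝ) / (Nat.totient (d * r) : ℝ)) ^ 2
            else 0) := by
    intro d hd r hr
    have hd1 : 1 ≤ d := (mem_Ico.mp hd).1
    have hr1 : 1 ≤ r := (mem_Ico.mp hr).1
    have hdr0' : d * r ≠ 0 := (Nat.mul_pos hd1 hr1).ne'
    have hdr1 : (1 : ℝ) ≤ ((d * r : ℕ) : ℝ) := by exact_mod_cast Nat.mul_pos hd1 hr1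
    -- the relative factor
    set ρ : ℝ := ((d * r : ℕ) : ℝ) / (Nat.totient (d * r) : ℝ) with hρ
    have hρ1 : 1 ≤ ρ := by
      have hφ : (0 : ℝ) < Nat.totient (d * r) := by
        exact_mod_cast Nat.totient_pos.mpr (Nat.mul_pos hd1 hr1)
      rw [hρ, le_div_iff₀ hφ, one_mul]
      exact_mod_cast Nat.totient_le (d * r)
    have hρ2 : 1 ≤ ρ ^ 2 := one_le_pow₀ hρ1
    have hprod : (∏ q ∈ (d * r).primeFactors, (1 - (q : ℝ)⁻¹)⁻¹) ^ 2 = ρ ^ 2 := by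
      rw [prod_one_sub_inv_inv_eq_self_div_totient hdr0']
    have hE0 : 0 ≤ C₄ * ρ ^ 2 := by positivity
    -- Lemma 8.4 at `(d,r)` with the local error `C₄ρ²`
    have h84loc : ∀ μ ∈ ({6, 7} : Finset ℕ),
        ((d * r : ℕ) : ℝ) < bigP D / bigT D ^ 2 → ∀ y : ℝ, bigT D < y → y < bigP D →
          ‖(∑ n ∈ Ico 1 ⌈y⌉₊, χ (n : ZMod D) * xiZero c' D j n d r / (n : ℂ) *
                ((y / n : ℝ) : ℂ) ^ (-betaMu D μ) * (Real.log (y / n) : ℂ)) -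
              deriv χ.LFunction 1 * PiW χ d r * frakgW c' D j μ y‖ ≤ C₄ * ρ ^ 2 := by
      intro μ hμ hdrN y hy1 hy2
      refine (h84 μ hμ d r hd1 hr1 hdrN y hy1 hy2).trans ?_
      rw [hprod]
      calc C₄ * (ell D ^ 6)⁻¹ * ρ ^ 2 ≤ C₄ * 1 * ρ ^ 2 := by gcongr
        _ = C₄ * ρ ^ 2 := by ring
    have hξloc : ((d * r : ℕ) : ℝ) < Skeleton.P1 D → ∀ x : ℝ, 1 ≤ x →
        x ≤ bigT D → ∑ n ∈ Ico 1 ⌈x⌉₊, ‖xiZero c' D j n d r‖ / n ≤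
          Cξ * ell D * (1 + Real.log x) ^ 3 := hξ d r hd1 hr1
    have hω0 : 0 ≤ ‖lamZero c' D j (d * r)‖ * (1 + ‖PiW χ d r‖) /
        ((d : ℝ) * r * (Nat.totient r : ℝ)) * ρ ^ 2 := by positivity
    have hw := norm_drWeight_le c' χ j hd1 hr1
    have hw0 : 0 ≤ ‖lamZero c' D j (d * r)‖ / ((d : ℝ) * r * (Nat.totient r : ℝ)) := by
      positivity
    have hMeq : mSum13 c' χ j (d * r) = frakv1 c' χ j ((d * r : ℕ) : ℝ) :=
      mSum13_eq_frakv1 c' χ hL2 j (Nat.mul_pos hd1 hr1)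
    have hPi := norm_nonneg (PiW χ d r)
    -- `NB with C₄ρ²` ≤ `ρ²·NB`
    have hNB₁ρ : (1 / Real.log (Skeleton.P1 D) + 2 / Real.log (Skeleton.P2 D)) *
        (‖deriv χ.LFunction 1‖ * Kg + C₄ * ρ ^ 2 + Cξ * ell D * (1 + Real.log (bigT D)) ^ 4) ≤
        ρ ^ 2 * NB₁ := by
      rw [hNB₁]
      have h1 : ‖deriv χ.LFunction 1‖ * Kg ≤ ‖deriv χ.LFunction 1‖ * Kg * ρ ^ 2 :=
        le_mul_of_one_le_right (by positivity) hρ2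
      have h2 : Cξ * ell D * (1 + Real.log (bigT D)) ^ 4 ≤
          Cξ * ell D * (1 + Real.log (bigT D)) ^ 4 * ρ ^ 2 :=
        le_mul_of_one_le_right (by positivity) hρ2
      have h3 : ‖deriv χ.LFunction 1‖ * Kg + C₄ * ρ ^ 2 + Cξ * ell D * (1 + Real.log (bigT D)) ^ 4 ≤
          ρ ^ 2 * (‖deriv χ.LFunction 1‖ * Kg + C₄ + Cξ * ell D * (1 + Real.log (bigT D)) ^ 4) := by
        linarith
      calc _ ≤ (1 / Real.log (Skeleton.P1 D) + 2 / Real.log (Skeleton.P2 D)) *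
            (ρ ^ 2 * (‖deriv χ.LFunction 1‖ * Kg + C₄ +
              Cξ * ell D * (1 + Real.log (bigT D)) ^ 4)) :=
            mul_le_mul_of_nonneg_left h3 (by positivity)
        _ = _ := by ring
    have hNB₂ρ : 1 / Real.log (Skeleton.P1 D) * (‖deriv χ.LFunction 1‖ * Kg + C₄ * ρ ^ 2) ≤
        ρ ^ 2 * NB₂ := by
      rw [hNB₂]
      have h1 : ‖deriv χ.LFunction 1‖ * Kg ≤ ‖deriv χ.LFunction 1‖ * Kg * ρ ^ 2 :=
        le_mul_of_one_le_right (by positivity) hρ2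
      have h3 : ‖deriv χ.LFunction 1‖ * Kg + C₄ * ρ ^ 2 ≤
          ρ ^ 2 * (‖deriv χ.LFunction 1‖ * Kg + C₄) := by linarith
      calc _ ≤ 1 / Real.log (Skeleton.P1 D) * (ρ ^ 2 * (‖deriv χ.LFunction 1‖ * Kg + C₄)) :=
            mul_le_mul_of_nonneg_left h3 (by positivity)
        _ = _ := by ring
    by_cases hcond : (0 : ℝ) ≤ ((d * r : ℕ) : ℝ) ∧ ((d * r : ℕ) : ℝ) < bigP D ^ (0.5 : ℝ)
    · rw [if_pos hcond, norm_mul, norm_mul, hMeq]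
      by_cases hz : ((d * r : ℕ) : ℝ) ≤ bigP D ^ (0.5 : ℝ) / bigT D
      · -- zone 1
        rw [if_pos ⟨by linarith, hz⟩, if_neg (fun h => absurd h.1 (not_lt.mpr hz)), mul_zero,
          add_zero]
        have hM := hM1 _ hdr1 hz
        have hN : ‖nSum21 c' χ j d r‖ ≤ ρ ^ 2 * NB₁ * (1 + ‖PiW χ d r‖) :=
          (norm_nSum21_le_loc c' χ hL hE0 hCξ hKg h84loc hξloc hg hd1 hr1 hcond.2).trans
            (mul_le_mul_of_nonneg_right hNB₁ρ (by positivity))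
        calc ‖drWeight c' χ j d r‖ * ‖frakv1 c' χ j ((d * r : ℕ) : ℝ)‖ * ‖nSum21 c' χ j d r‖
            ≤ (‖lamZero c' D j (d * r)‖ / ((d : ℝ) * r * (Nat.totient r : ℝ))) *
                (C₁ * bigT D ^ (-c)) * (ρ ^ 2 * NB₁ * (1 + ‖PiW χ d r‖)) :=
              mul_le_mul (mul_le_mul hw hM (norm_nonneg _) hw0) hN (norm_nonneg _)
                (mul_nonneg hw0 (by positivity))
          _ = C₁ * bigT D ^ (-c) * NB₁ * (‖lamZero c' D j (d * r)‖ * (1 + ‖PiW χ d r‖) /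
                ((d : ℝ) * r * (Nat.totient r : ℝ)) * ρ ^ 2) := by ring
      · -- zone 2
        have hz' : bigP D ^ (0.5 : ℝ) / bigT D < ((d * r : ℕ) : ℝ) := not_le.mp hz
        rw [if_neg (fun h => absurd h.2 hz), if_pos ⟨hz', hcond.2.le⟩, mul_zero, zero_add]
        have hM := hM2 _ hz' hcond.2.le
        have hN : ‖nSum21 c' χ j d r‖ ≤ ρ ^ 2 * NB₂ * (1 + ‖PiW χ d r‖) := by
          have h := norm_nSum21_le_window_loc c' χ hL hE0 hKg h84loc hg hd1 hr1 hz' hcond.2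
          rw [← mul_assoc] at h
          exact h.trans (mul_le_mul_of_nonneg_right hNB₂ρ (by positivity))
        calc ‖drWeight c' χ j d r‖ * ‖frakv1 c' χ j ((d * r : ℕ) : ℝ)‖ * ‖nSum21 c' χ j d r‖
            ≤ (‖lamZero c' D j (d * r)‖ / ((d : ℝ) * r * (Nat.totient r : ℝ))) *
                (C₁ * (ell D ^ 7)⁻¹) * (ρ ^ 2 * NB₂ * (1 + ‖PiW χ d r‖)) :=
              mul_le_mul (mul_le_mul hw hM (norm_nonneg _) hw0) hN (norm_nonneg _)
                (mul_nonneg hw0 (by positivity))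
          _ = C₁ * (ell D ^ 7)⁻¹ * NB₂ * (‖lamZero c' D j (d * r)‖ * (1 + ‖PiW χ d r‖) /
                ((d : ℝ) * r * (Nat.totient r : ℝ)) * ρ ^ 2) := by ring
    · rw [if_neg hcond, norm_zero]
      have h1 : 0 ≤ C₁ * bigT D ^ (-c) * NB₁ *
          (if 1 / 2 < ((d * r : ℕ) : ℝ) ∧ ((d * r : ℕ) : ℝ) ≤ bigP D ^ (0.5 : ℝ) / bigT D then
            ‖lamZero c' D j (d * r)‖ * (1 + ‖PiW χ d r‖) / ((d : ℝ) * r * (Nat.totient r : ℝ)) *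
              ρ ^ 2
          else 0) := mul_nonneg ha0 (by split_ifs <;> positivity)
      have h2 : 0 ≤ C₁ * (ell D ^ 7)⁻¹ * NB₂ *
          (if bigP D ^ (0.5 : ℝ) / bigT D < ((d * r : ℕ) : ℝ) ∧
              ((d * r : ℕ) : ℝ) ≤ bigP D ^ (0.5 : ℝ) then
            ‖lamZero c' D j (d * r)‖ * (1 + ‖PiW χ d r‖) / ((d : ℝ) * r * (Nat.totient r : ℝ)) *
              ρ ^ 2
          else 0) := mul_nonneg hb0 (by split_ifs <;> positivity)
      linarith
  -- the two window sums
  have hW1 := pairSum_window_rel_le c' D χ j (Nsupp D) (by norm_num : (0 : ℝ) < 1 / 2) hhalfA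
  have hW2 := pairSum_window_rel_le c' D χ j (Nsupp D) hA0 hAB
  unfold drSum
  calc _ ≤ ∑ d ∈ Ico 1 (Nsupp D), ‖∑ r ∈ Ico 1 (Nsupp D),
          (if (0 : ℝ) ≤ ((d * r : ℕ) : ℝ) ∧ ((d * r : ℕ) : ℝ) < bigP D ^ (0.5 : ℝ) then
            drWeight c' χ j d r * mSum13 c' χ j (d * r) * nSum21 c' χ j d r else 0)‖ :=
        norm_sum_le _ _
    _ ≤ ∑ d ∈ Ico 1 (Nsupp D), ∑ r ∈ Ico 1 (Nsupp D),
          ‖(if (0 : ℝ) ≤ ((d * r : ℕ) : ℝ) ∧ ((d * r : ℕ) : ℝ) < bigP D ^ (0.5 : ℝ) then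
            drWeight c' χ j d r * mSum13 c' χ j (d * r) * nSum21 c' χ j d r else 0)‖ :=
        sum_le_sum fun d _ => norm_sum_le _ _
    _ ≤ ∑ d ∈ Ico 1 (Nsupp D), ∑ r ∈ Ico 1 (Nsupp D),
          (C₁ * bigT D ^ (-c) * NB₁ *
              (if 1 / 2 < ((d * r : ℕ) : ℝ) ∧ ((d * r : ℕ) : ℝ) ≤ bigP D ^ (0.5 : ℝ) / bigT D then
                ‖lamZero c' D j (d * r)‖ * (1 + ‖PiW χ d r‖) / ((d : ℝ) * r * (Nat.totient r : ℝ)) *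
                  (((d * r : ℕ) : ℝ) / (Nat.totient (d * r) : ℝ)) ^ 2
              else 0) +
            C₁ * (ell D ^ 7)⁻¹ * NB₂ *
              (if bigP D ^ (0.5 : ℝ) / bigT D < ((d * r : ℕ) : ℝ) ∧
                  ((d * r : ℕ) : ℝ) ≤ bigP D ^ (0.5 : ℝ) then
                ‖lamZero c' D j (d * r)‖ * (1 + ‖PiW χ d r‖) / ((d : ℝ) * r * (Nat.totient r : ℝ)) *
                  (((d * r : ℕ) : ℝ) / (Nat.totient (d * r) : ℝ)) ^ 2
              else 0)) :=
        sum_le_sum fun d hd => sum_le_sum fun r hr => hpt d hd r hr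
    _ = C₁ * bigT D ^ (-c) * NB₁ *
            ∑ d ∈ Ico 1 (Nsupp D), ∑ r ∈ Ico 1 (Nsupp D),
              (if 1 / 2 < ((d * r : ℕ) : ℝ) ∧ ((d * r : ℕ) : ℝ) ≤ bigP D ^ (0.5 : ℝ) / bigT D then
                ‖lamZero c' D j (d * r)‖ * (1 + ‖PiW χ d r‖) / ((d : ℝ) * r * (Nat.totient r : ℝ)) *
                  (((d * r : ℕ) : ℝ) / (Nat.totient (d * r) : ℝ)) ^ 2
              else 0) +
          C₁ * (ell D ^ 7)⁻¹ * NB₂ *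
            ∑ d ∈ Ico 1 (Nsupp D), ∑ r ∈ Ico 1 (Nsupp D),
              (if bigP D ^ (0.5 : ℝ) / bigT D < ((d * r : ℕ) : ℝ) ∧
                  ((d * r : ℕ) : ℝ) ≤ bigP D ^ (0.5 : ℝ) then
                ‖lamZero c' D j (d * r)‖ * (1 + ‖PiW χ d r‖) / ((d : ℝ) * r * (Nat.totient r : ℝ)) *
                  (((d * r : ℕ) : ℝ) / (Nat.totient (d * r) : ℝ)) ^ 2
              else 0) := by
        simp only [sum_add_distrib, mul_sum]
    _ ≤ C₁ * bigT D ^ (-c) * NB₁ *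
            (4 * Real.exp 428 * (1 + Real.log ((bigP D ^ (0.5 : ℝ) / bigT D) / (1 / 2)))) +
          C₁ * (ell D ^ 7)⁻¹ * NB₂ *
            (4 * Real.exp 428 *
              (1 + Real.log (bigP D ^ (0.5 : ℝ) / (bigP D ^ (0.5 : ℝ) / bigT D)))) :=
        add_le_add (mul_le_mul_of_nonneg_left hW1 ha0) (mul_le_mul_of_nonneg_left hW2 hb0)

end AssemblyRel

/-! ### Part G.F. The endgame with the window constant `4e⁴²⁸` and the relative deduction -/

section EndgameRel

/-- **The numerical endgame, relative weights** (`4e⁴²⁸` in place of `4e¹⁰⁴`): same arithmetic as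
`endgame`. [cite: Zhang2022LandauSiegel, §10 p. 58] -/
private theorem endgame_rel {L c ε C₁ C₄ Cξ Kg Lp lP1 lP2 lT Tc lA : ℝ} (hL : 3 ≤ L) (hc : 0 < c)
    (hε : 0 < ε) (hC₁ : 0 ≤ C₁) (hC₄ : 0 ≤ C₄) (hCξ : 0 ≤ Cξ) (hKg : 0 ≤ Kg) (hLp0 : 0 ≤ Lp)
    (hLp : Lp ≤ 2 * Real.exp (9 / 2) * (1 + L) * L)
    (hlP1 : lP1 = 0.504 * L ^ 9) (hlP2 : 0.25 * L ^ 9 ≤ lP2) (hlT0 : 0 ≤ lT) (hlT : lT ≤ L ^ 2)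
    (hTc : Tc ≤ Real.exp (-(c * L))) (hlA0 : 0 ≤ lA) (hlA : lA ≤ 1 + 0.5 * L ^ 9)
    (hL1 : 2 * (4 * Real.exp 428 * C₁ * (40 * Real.exp (9 / 2) * Kg + 10 * C₄ + 160 * Cξ)) *
        (Nat.factorial 19) / (c ^ 19 * (ε * π)) ≤ L)
    (hL2 : 2 * (8 * Real.exp 428 * C₁ * (2 * (4 * Real.exp (9 / 2) * Kg + C₄))) / (ε * π) ≤ L) :
    C₁ * Tc * ((1 / lP1 + 2 / lP2) * (Lp * Kg + C₄ + Cξ * L * (1 + lT) ^ 4)) *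
          (4 * Real.exp 428 * (1 + lA)) +
        C₁ * (L ^ 7)⁻¹ * (1 / lP1 * (Lp * Kg + C₄)) * (4 * Real.exp 428 * (1 + lT)) ≤
      ε * (π / L ^ 9) := by
  have hL1' : 1 ≤ L := by linarith
  have hL0 : 0 < L := by linarith
  have hL9 : 1 ≤ L ^ 9 := one_le_pow₀ hL1'
  have hL2sq : 1 ≤ L ^ 2 := one_le_pow₀ hL1'
  have hπ : 0 < π := Real.pi_pos
  have hεπ : 0 < ε * π := mul_pos hε hπ
  have he : 0 < Real.exp (9 / 2) := Real.exp_pos _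
  have he428 : 0 < Real.exp 428 := Real.exp_pos _
  set K₁ : ℝ := 40 * Real.exp (9 / 2) * Kg + 10 * C₄ + 160 * Cξ with hK₁
  set K₂ : ℝ := 2 * (4 * Real.exp (9 / 2) * Kg + C₄) with hK₂
  set A₁ : ℝ := 4 * Real.exp 428 * C₁ * K₁ with hA₁
  set A₂ : ℝ := 8 * Real.exp 428 * C₁ * K₂ with hA₂
  have hK₁0 : 0 ≤ K₁ := by rw [hK₁]; positivity
  have hK₂0 : 0 ≤ K₂ := by rw [hK₂]; positivity
  have hA₁0 : 0 ≤ A₁ := by rw [hA₁]; positivity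
  have hA₂0 : 0 ≤ A₂ := by rw [hA₂]; positivity
  have hlP1pos : 0 < lP1 := by rw [hlP1]; positivity
  have hlP2pos : 0 < lP2 := lt_of_lt_of_le (by positivity) hlP2
  -- (i) the `1/log P` factors
  have h1lP1 : 1 / lP1 ≤ 2 / L ^ 9 := by
    rw [hlP1, div_le_div_iff₀ (by positivity) (by positivity)]
    linarith
  have hi : 1 / lP1 + 2 / lP2 ≤ 10 / L ^ 9 := by
    have h2 : 2 / lP2 ≤ 8 / L ^ 9 := by
      rw [div_le_div_iff₀ hlP2pos (by positivity)]
      linarith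
    calc 1 / lP1 + 2 / lP2 ≤ 2 / L ^ 9 + 8 / L ^ 9 := add_le_add h1lP1 h2
      _ = 10 / L ^ 9 := by ring
  -- (ii) the `n`-sum factors
  have hLp' : Lp ≤ 4 * Real.exp (9 / 2) * L ^ 2 := by
    have hLL : L ≤ L ^ 2 := le_self_pow₀ hL1' (by norm_num)
    have h : (1 + L) * L ≤ 2 * L ^ 2 := by
      have e : (1 + L) * L = L + L ^ 2 := by ring
      rw [e]; linarith
    calc Lp ≤ 2 * Real.exp (9 / 2) * (1 + L) * L := hLp
      _ = 2 * Real.exp (9 / 2) * ((1 + L) * L) := by ring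
      _ ≤ 2 * Real.exp (9 / 2) * (2 * L ^ 2) := by gcongr
      _ = 4 * Real.exp (9 / 2) * L ^ 2 := by ring
  have h1lT : 1 + lT ≤ 2 * L ^ 2 := by linarith
  have hlT4 : (1 + lT) ^ 4 ≤ 16 * L ^ 8 := by
    calc (1 + lT) ^ 4 ≤ (2 * L ^ 2) ^ 4 := pow_le_pow_left₀ (by linarith) h1lT 4
      _ = 16 * L ^ 8 := by ring
  have ha : Lp * Kg ≤ 4 * Real.exp (9 / 2) * L ^ 2 * Kg := mul_le_mul_of_nonneg_right hLp' hKg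
  have hb : Cξ * L * (1 + lT) ^ 4 ≤ Cξ * L * (16 * L ^ 8) :=
    mul_le_mul_of_nonneg_left hlT4 (by positivity)
  have hii : Lp * Kg + C₄ + Cξ * L * (1 + lT) ^ 4 ≤
      4 * Real.exp (9 / 2) * L ^ 2 * Kg + C₄ + Cξ * L * (16 * L ^ 8) := by linarith
  -- (iii) `NB₁ ≤ K₁`
  have hpos2 : 0 ≤ Lp * Kg + C₄ + Cξ * L * (1 + lT) ^ 4 := by positivity
  have hiii : (1 / lP1 + 2 / lP2) * (Lp * Kg + C₄ + Cξ * L * (1 + lT) ^ 4) ≤ K₁ := by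
    have hq1 : L ^ 2 / L ^ 9 ≤ 1 := by
      rw [div_le_one (by positivity)]
      exact pow_le_pow_right₀ hL1' (by norm_num)
    have hq2 : 1 / L ^ 9 ≤ 1 := by rw [div_le_one (by positivity)]; exact hL9
    calc (1 / lP1 + 2 / lP2) * (Lp * Kg + C₄ + Cξ * L * (1 + lT) ^ 4)
        ≤ (10 / L ^ 9) * (4 * Real.exp (9 / 2) * L ^ 2 * Kg + C₄ + Cξ * L * (16 * L ^ 8)) :=
          mul_le_mul hi hii hpos2 (by positivity)
      _ = 40 * Real.exp (9 / 2) * Kg * (L ^ 2 / L ^ 9) + 10 * C₄ * (1 / L ^ 9) + 160 * Cξ := by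
          field_simp
          ring
      _ ≤ 40 * Real.exp (9 / 2) * Kg * 1 + 10 * C₄ * 1 + 160 * Cξ := by gcongr
      _ = K₁ := by rw [hK₁]; ring
  -- (iv) the first window factor
  have h39 : (3 : ℝ) ^ 9 ≤ L ^ 9 := pow_le_pow_left₀ (by norm_num) hL 9
  have hiv : 4 * Real.exp 428 * (1 + lA) ≤ 4 * Real.exp 428 * L ^ 9 := by
    norm_num at h39
    have : 1 + lA ≤ L ^ 9 := by linarith
    exact mul_le_mul_of_nonneg_left this (by positivity)
  -- zone 1
  have hZ1 : C₁ * Tc * ((1 / lP1 + 2 / lP2) * (Lp * Kg + C₄ + Cξ * L * (1 + lT) ^ 4)) *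
      (4 * Real.exp 428 * (1 + lA)) ≤ A₁ * (Real.exp (-(c * L)) * L ^ 18) / L ^ 9 := by
    calc C₁ * Tc * ((1 / lP1 + 2 / lP2) * (Lp * Kg + C₄ + Cξ * L * (1 + lT) ^ 4)) *
          (4 * Real.exp 428 * (1 + lA))
        ≤ C₁ * Real.exp (-(c * L)) * K₁ * (4 * Real.exp 428 * L ^ 9) :=
          mul_le_mul (mul_le_mul (mul_le_mul_of_nonneg_left hTc hC₁) hiii
            (mul_nonneg (by positivity) hpos2) (by positivity)) hiv (by positivity) (by positivity)
      _ = A₁ * (Real.exp (-(c * L)) * L ^ 18) / L ^ 9 := by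
          rw [hA₁]; field_simp
  have hZ1' : A₁ * (Real.exp (-(c * L)) * L ^ 18) / L ^ 9 ≤ (ε * π / 2) / L ^ 9 := by
    apply div_le_div_of_nonneg_right _ (by positivity)
    have hf : (0 : ℝ) < Nat.factorial 19 := by positivity
    have h := hL1
    rw [div_le_iff₀ (by positivity)] at h
    calc A₁ * (Real.exp (-(c * L)) * L ^ 18) ≤ A₁ * ((Nat.factorial 19 : ℝ) / (c ^ 19 * L)) :=
          mul_le_mul_of_nonneg_left (exp_neg_mul_pow_le hc hL0) hA₁0
      _ = (A₁ * Nat.factorial 19) / (c ^ 19 * L) := by ring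
      _ ≤ ε * π / 2 := by
          rw [div_le_iff₀ (by positivity)]
          linear_combination (1 / 2 : ℝ) * h
  -- zone 2
  have hZ2 : C₁ * (L ^ 7)⁻¹ * (1 / lP1 * (Lp * Kg + C₄)) * (4 * Real.exp 428 * (1 + lT)) ≤
      A₂ / L ^ 12 := by
    have hC₄' : C₄ ≤ C₄ * L ^ 2 := le_mul_of_one_le_right hC₄ hL2sq
    have h1 : 1 / lP1 * (Lp * Kg + C₄) ≤ K₂ * L ^ 2 / L ^ 9 := by
      calc 1 / lP1 * (Lp * Kg + C₄) ≤ (2 / L ^ 9) * (4 * Real.exp (9 / 2) * L ^ 2 * Kg + C₄ * L ^ 2) :=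
            mul_le_mul h1lP1 (by linarith) (by positivity) (by positivity)
        _ = K₂ * L ^ 2 / L ^ 9 := by rw [hK₂]; field_simp
    have h2 : 4 * Real.exp 428 * (1 + lT) ≤ 8 * Real.exp 428 * L ^ 2 := by
      have := mul_le_mul_of_nonneg_left h1lT he428.le
      linarith
    calc C₁ * (L ^ 7)⁻¹ * (1 / lP1 * (Lp * Kg + C₄)) * (4 * Real.exp 428 * (1 + lT))
        ≤ C₁ * (L ^ 7)⁻¹ * (K₂ * L ^ 2 / L ^ 9) * (8 * Real.exp 428 * L ^ 2) :=
          mul_le_mul (mul_le_mul_of_nonneg_left h1 (by positivity)) h2 (by positivity)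
            (by positivity)
      _ = A₂ / L ^ 12 := by rw [hA₂]; field_simp
  have hZ2' : A₂ / L ^ 12 ≤ (ε * π / 2) / L ^ 9 := by
    rw [div_le_div_iff₀ (by positivity) (by positivity)]
    have h := hL2
    rw [div_le_iff₀ hεπ] at h
    have hL3' : L ≤ L ^ 3 := le_self_pow₀ hL1' (by norm_num)
    have k : A₂ ≤ ε * π / 2 * L := by linear_combination (1 / 2 : ℝ) * h
    have k2 : ε * π / 2 * L ≤ ε * π / 2 * L ^ 3 := mul_le_mul_of_nonneg_left hL3' (by positivity)
    calc A₂ * L ^ 9 ≤ (ε * π / 2 * L ^ 3) * L ^ 9 :=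
          mul_le_mul_of_nonneg_right (k.trans k2) (by positivity)
      _ = ε * π / 2 * L ^ 12 := by ring
  calc _ ≤ (ε * π / 2) / L ^ 9 + (ε * π / 2) / L ^ 9 :=
        add_le_add (hZ1.trans hZ1') (hZ2.trans hZ2')
    _ = ε * (π / L ^ 9) := by ring

end EndgameRel

section MainRel

/-- **DEDUCTION for node `Z22:§10.u042` over the RELATIVE Lemma 8.4** (prose claim "By Lemma 10.1
and the results in Section 8, the sum over `dr < P^{0.5}` is `o(α)`", p. 58 tex L2977): Lemma 10.1 and
`Skeleton.Lemma84Rel` (Lemma 8.4 with the error `O(𝓛⁻⁶)(∏_{q∣dr}(1−q⁻¹)⁻¹)²` that its Appendix-A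
proof delivers; `Skeleton.lemma84Rel_of_lemma83Rel`), together with the tree's unconditional
`ξ₀ⱼ`-tail mean, `|L′(1,χ)| ≪ 𝓛²` and `|𝔤_{jμ}| ≪ 1`, imply `Typed.Sec10B.Small1321 c′`. Same proof
as `small1321_of` through `norm_drSum_low_le_rel` and `endgame_rel` (window constant `4e⁴²⁸`).
[cite: Zhang2022LandauSiegel, §10 p. 58] -/
theorem small1321_of_rel (c' : ℝ) (h101 : Lemma101 c') (h84 : Lemma84Rel c') : Small1321 c' := by
  intro ε hε
  obtain ⟨c, hc, C₁, D₁, H101⟩ := h101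
  obtain ⟨C₄, D₄, H84⟩ := h84
  obtain ⟨Cξ, Dξ, Hξ⟩ := XiZeroMajorant.xiZeroTailMean c'
  obtain ⟨Kg, hKg1, HKg⟩ := Section9Discharge.exists_norm_frakgW_le c'
  have hKg0 : 0 ≤ Kg := by linarith
  -- nonnegative majorants of the constants
  set C₁p : ℝ := max C₁ 0 with hC₁p
  set C₄p : ℝ := max C₄ 0 with hC₄p
  set Cξp : ℝ := max Cξ 0 with hCξp
  have hC₁0 : 0 ≤ C₁p := le_max_right _ _
  have hC₄0 : 0 ≤ C₄p := le_max_right _ _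
  have hCξ0 : 0 ≤ Cξp := le_max_right _ _
  -- the threshold
  set Lε : ℝ := max 3 (max
    (2 * (4 * Real.exp 428 * C₁p * (40 * Real.exp (9 / 2) * Kg + 10 * C₄p + 160 * Cξp)) *
        (Nat.factorial 19) / (c ^ 19 * (ε * π)))
    (2 * (8 * Real.exp 428 * C₁p * (2 * (4 * Real.exp (9 / 2) * Kg + C₄p))) / (ε * π))) with hLε
  refine ⟨max (max D₁ D₄) (max Dξ ⌈Real.exp Lε⌉₊), fun D _ χ hD hq hp hA j hj => ?_⟩
  have hD₁ : D₁ ≤ D := le_trans (le_trans (le_max_left _ _) (le_max_left _ _)) hD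
  have hD₄ : D₄ ≤ D := le_trans (le_trans (le_max_right _ _) (le_max_left _ _)) hD
  have hDξ : Dξ ≤ D := le_trans (le_trans (le_max_left _ _) (le_max_right _ _)) hD
  have hLεD : Lε ≤ ell D :=
    le_ell_of_ceil_exp_le (le_trans (le_trans (le_max_right _ _) (le_max_right _ _)) hD)
  have hL3 : 3 ≤ ell D := le_trans (le_max_left _ _) hLεD
  have hT1 : (2 * (4 * Real.exp 428 * C₁p * (40 * Real.exp (9 / 2) * Kg + 10 * C₄p + 160 * Cξp)) *
        (Nat.factorial 19) / (c ^ 19 * (ε * π))) ≤ ell D :=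
    le_trans (le_trans (le_max_left _ _) (le_max_right _ _)) hLεD
  have hT2 : 2 * (8 * Real.exp 428 * C₁p * (2 * (4 * Real.exp (9 / 2) * Kg + C₄p))) / (ε * π) ≤
      ell D := le_trans (le_trans (le_max_right _ _) (le_max_right _ _)) hLεD
  have hL0 : 0 < ell D := by linarith
  have hL1 : 1 ≤ ell D := by linarith
  have hL2 : 2 ≤ ell D := by linarith
  have hT0 : 0 < bigT D := Real.exp_pos _
  have hTc0 : 0 < bigT D ^ (-c) := Real.rpow_pos_of_pos hT0 _
  -- the instantiated inputs
  have h101D := H101 D χ hD₁ hq hp hA j hj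
  have hM1 : ∀ y : ℝ, 1 ≤ y → y ≤ bigP D ^ (0.5 : ℝ) / bigT D →
      ‖frakv1 c' χ j y‖ ≤ C₁p * bigT D ^ (-c) := fun y h1 h2 =>
    ((h101D y).1 h1 h2).trans (mul_le_mul_of_nonneg_right (le_max_left _ _) hTc0.le)
  have hM2 : ∀ y : ℝ, bigP D ^ (0.5 : ℝ) / bigT D < y → y ≤ bigP D ^ (0.5 : ℝ) →
      ‖frakv1 c' χ j y‖ ≤ C₁p * (ell D ^ 7)⁻¹ := fun y h1 h2 =>
    ((h101D y).2.2.2 (Or.inl ⟨h1, h2⟩)).trans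
      (mul_le_mul_of_nonneg_right (le_max_left _ _) (by positivity))
  have h84D : ∀ μ ∈ ({6, 7} : Finset ℕ), ∀ d r : ℕ, 1 ≤ d → 1 ≤ r →
      ((d * r : ℕ) : ℝ) < bigP D / bigT D ^ 2 → ∀ y : ℝ, bigT D < y → y < bigP D →
        ‖(∑ n ∈ Ico 1 ⌈y⌉₊, χ (n : ZMod D) * xiZero c' D j n d r / (n : ℂ) *
              ((y / n : ℝ) : ℂ) ^ (-betaMu D μ) * (Real.log (y / n) : ℂ)) -
            deriv χ.LFunction 1 * PiW χ d r * frakgW c' D j μ y‖ ≤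
          C₄p * (ell D ^ 6)⁻¹ * (∏ q ∈ (d * r).primeFactors, (1 - (q : ℝ)⁻¹)⁻¹) ^ 2 :=
    fun μ hμ d r hd hr hdr y hy1 hy2 =>
      (H84 D χ hD₄ hq hp hA j hj μ hμ d r hd hr hdr y hy1 hy2).trans
        (mul_le_mul_of_nonneg_right (mul_le_mul_of_nonneg_right (le_max_left _ _)
          (by positivity)) (by positivity))
  have hξD : ∀ d r : ℕ, 1 ≤ d → 1 ≤ r → ((d * r : ℕ) : ℝ) < Skeleton.P1 D → ∀ x : ℝ, 1 ≤ x →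
      x ≤ bigT D → ∑ n ∈ Ico 1 ⌈x⌉₊, ‖xiZero c' D j n d r‖ / n ≤
        Cξp * ell D * (1 + Real.log x) ^ 3 := fun d r hd hr hdr x hx1 hx2 => by
    have hlog : 0 ≤ 1 + Real.log x := by
      have := Real.log_nonneg hx1; linarith
    exact (Hξ D χ hDξ hq hp j hj d r hd hr hdr x hx1 hx2).trans
      (mul_le_mul_of_nonneg_right (mul_le_mul_of_nonneg_right (le_max_left _ _) hL0.le)
        (by positivity))
  have hgD : ∀ (μ : ℕ) (y : ℝ), |Real.log y| ≤ ell D ^ 9 → ‖frakgW c' D j μ y‖ ≤ Kg :=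
    fun μ y hy => HKg D j μ y hL1 hy
  have main := norm_drSum_low_le_rel c' χ hL3 hC₁0 hC₄0 hCξ0 hKg0 hM1 hM2 h84D hξD hgD
  -- the transcendental quantities of the bound
  have hB0 : bigP D ^ (0.5 : ℝ) ≠ 0 := (Real.rpow_pos_of_pos (Real.exp_pos _) _).ne'
  have hBA : Real.log (bigP D ^ (0.5 : ℝ) / (bigP D ^ (0.5 : ℝ) / bigT D)) = Real.log (bigT D) := by
    rw [div_div_eq_mul_div, mul_div_cancel_left₀ _ hB0]
  rw [hBA] at main
  have hLp := ResidueValues.norm_deriv_LFunction_one_le χ hL3 hp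
  have hlT : Real.log (bigT D) ≤ ell D ^ 2 := by rw [log_bigT]; exact rpow11_le_sq hL1
  have hlT0 : 0 ≤ Real.log (bigT D) := Real.log_nonneg one_le_bigT
  have hTc : bigT D ^ (-c) ≤ Real.exp (-(c * ell D)) := by
    rw [bigT, ← Real.exp_mul, Real.exp_le_exp]
    have := self_le_rpow11 hL1
    nlinarith
  have hA1 : 1 ≤ bigP D ^ (0.5 : ℝ) / bigT D := one_le_sqrtP_div_T hL2
  have hlA0 : 0 ≤ Real.log ((bigP D ^ (0.5 : ℝ) / bigT D) / (1 / 2)) :=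
    Real.log_nonneg (by rw [le_div_iff₀ (by norm_num : (0:ℝ) < 1 / 2)]; linarith)
  have hlA : Real.log ((bigP D ^ (0.5 : ℝ) / bigT D) / (1 / 2)) ≤ 1 + 0.5 * ell D ^ 9 := by
    have hA0 : 0 < bigP D ^ (0.5 : ℝ) / bigT D := by linarith
    rw [Real.log_div hA0.ne' (by norm_num), Real.log_div hB0 hT0.ne', sqrtP_eq,
      Real.log_exp, log_bigT]
    have h2 : Real.log (1 / 2 : ℝ) = -Real.log 2 := by
      rw [one_div, Real.log_inv]
    have hlog2 : Real.log 2 ≤ 1 := by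
      have := Real.log_le_sub_one_of_pos (show (0:ℝ) < 2 by norm_num); linarith
    have := rpow11_nonneg (D := D)
    rw [h2]
    linarith
  refine main.trans (endgame_rel hL3 hc hε hC₁0 hC₄0 hCξ0 hKg0 (norm_nonneg _) hLp log_P1
    (log_P2_ge hL2) hlT0 hlT hTc hlA0 hlA hT1 hT2) |>.trans ?_
  rw [alpha, log_bigP]

/-- **Z22:§10.u042 modulo the RELATIVE Lemma 8.4 only** (for the manuscript's parameter range
`c′ ≥ 0`): Lemma 10.1 is the tree theorem `Skeleton.lemma101_holds`, so the low range of
`S_j(𝐚₁₃,𝐚₂₁)` is `o(α)` as soon as `Skeleton.Lemma84Rel c′` holds — an in-scope term of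
`Skeleton.theorem1_of_leaves_v19` (`lemma84Rel_of_lemma83Rel h83`). [cite: Zhang2022LandauSiegel, §10 p. 58] -/
theorem small1321_of_lemma84Rel {c' : ℝ} (hc' : 0 ≤ c') (h84 : Lemma84Rel c') : Small1321 c' :=
  small1321_of_rel c' (lemma101_holds hc') h84

end MainRel

end Literature.NumberTheory.LFunctions.Zhang2022.Sj1321Outer
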